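import Literature.NumberTheory.LFunctions.ChebyshevHalfLineBiasThm6ivProofs
import Literature.NumberTheory.LFunctions.ChebyshevHalfLineBiasThm2Proofs
import Literature.NumberTheory.LFunctions.ExplicitFormulaPsiCharProofs
import HarnessLib

/-!
# GRH-EQUIVALENT criteria PROVED as equivalences (Suzuki 2025, Thm 6 (iii) (1.24)–(1.25), and Thm 6 (v) (1.29)–(1.30) with the limit `−(2φ(q))^{-1}Σ_χ m_χ`) — «nothing here bears on the truth of RH»
# the `xe²` cut-off Riesz sums `G(x) = Σ_{n ≤ xe², n ≡ 1 (q)} Λ(n) n^{-1/2}(1 − log n/log x)`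

LINE 1 — LABEL: RH-FREE literature (kernel proofs of GRH-EQUIVALENCES; «GRH ∧ zero-sum condition ⟹ limit» is
GRH-CONDITIONAL, «limit ⟹ GRH» is GRH-implying). bears_on: LADDER-RH COLUMN 1 SCREW (S-C, criterion rung). WHAT THIS
IS NOT: not a route, not progress toward RH or GRH — an equivalence fixes WHICH limit statement is «GRH for all `χ` mod
`q` together with `Σ_χΣ_ρ x^ρ/ρ = o(√x logᵏx)`»; nothing here bears on the truth of RH.

M. Suzuki, *On variants of Chebyshev's conjecture*, Ramanujan J. **68** (2025), no. 4, art. 95 = arXiv:2411.07436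
[`Suzuki2025Chebyshev`; PUBLISHED, refereed], §1.3 **Theorem 6 (iii)**, AS PRINTED (p. 5 of the arXiv text): «Suppose that
`L(1/2, χ) ≠ 0` for all Dirichlet character `χ` modulo `q`. Then, we have
`lim_{x→∞} Σ_{n ≤ xe², n ≡ 1 mod q} Λ(n)/√n (1 − log n/log x) = −φ(q)^{-1} Σ_{χ mod q} (L'/L)(1/2, χ)` (1.24)
if and only if the GRH for `L(s, χ)` holds for all Dirichlet characters `χ` modulo `q` and
`Σ_{χ mod q} Σ_{ρ_{χ*}} x^{ρ_{χ*}}/ρ_{χ*} = o(√x log x)` (1.25) holds as `x → ∞` …, where `χ*` is a primitive Dirichlet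
character that induces `χ` … and `Σ_{ρ_{χ*}} = lim_{T→∞} Σ_{|Im ρ_{χ*}| ≤ T}`.» **Theorem 6 (v)**, AS PRINTED:
«Under the notation of the third and fourth statements [`m_χ` = the order of the zero of `L(s, χ)` at `s = 1/2`], we
have `lim_{x→∞} (1/log x) Σ_{n ≤ xe², n ≡ 1 mod q} Λ(n)/√n (1 − log n/log x) = −½ Σ_{χ mod q} m_χ` (1.29) if and only if the
GRH for `L(s, χ)` holds for all Dirichlet characters `χ` modulo `q` and `Σ_χ Σ_{ρ_{χ*}} x^{ρ_{χ*}}/ρ_{χ*} = o(√x (log x)²)`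
(1.30) ….» Printed proof: §5.1, (5.5)–(5.9) for (iii) («Comparing this with (5.9) … (1.25) follows»; «Additionally, if we
assume (1.25) …»), and for (v) the last paragraph («By using (4.4') in place of (2.13) and (4.5') in place of (4.5) … one
can show that both (1.28) and (1.29) are equivalent to the GRH … We omit the details.»).

These are clauses 2 and 4 of the named fact `Suzuki2025Chebyshev_thm6_limits` (`ChebyshevHalfLineBiasCharacters.lean`,
typed verbatim from the print; the «for all large `T`» reading of `lim_{T→∞}`, zero sums `charZeroSumTrunc χ x T`,
`m_χ = DirichletDisc.zeroOrder χ (1/2)`).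

AS-PRINTED AUDIT of (1.29) (recorded, not endorsed; the same slip as in (1.28), see
`SuzukiThm6iv.Suzuki2025Chebyshev_thm6_iv_as_printed_iff` in `ChebyshevHalfLineBiasThm6ivProofs.lean`): orthogonality
(5.1)/(5.2) gives `Σ_{n ≡ 1 (q)} = φ(q)^{-1} Σ_χ χ̄(1)·`, exactly as (1.23)/(1.24) carry `−φ(q)^{-1} Σ_χ (L'/L)(½, χ)`; replacing
(4.5) by the order-`m` formula (4.5') turns `−(log y)(L'/L)(½, χ)` into `−m_χ log²y/2 + O(log y)` per character, so the
method of §5.1 yields the limit `−(2φ(q))^{-1} Σ_χ m_χ` in (1.29), NOT the printed `−½ Σ_χ m_χ`; the two coincide iff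
`φ(q) = 1` or `Σ_χ m_χ = 0` (no `L(s, χ)` vanishing at `½` — expected, unproved). THIS FILE proves (iii) exactly as typed
(`Suzuki2025Chebyshev_thm6_iii`, `Suzuki2025Chebyshev_thm6_limits_clause_iii`), (v) with the corrected limit
(`Suzuki2025Chebyshev_thm6_v_corrected`), and the typed clause 4 (printed limit) whenever `φ(q) = 1 ∨ Σ_χ m_χ = 0`
(`Suzuki2025Chebyshev_thm6_v_as_printed_of`), in particular for `q ≤ 2` (`…_clause_v_of_totient_eq_one`) and under
`∀ χ, L(½, χ) ≠ 0` (`Suzuki2025Chebyshev_thm6_v_of_forall_ne_zero`). Without that disjunction the printed (1.29) asserts — modulo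
GRH, by `exists_cutoff_link_v` — that `A(y)/(√y log²y)` converges to a specific NON-ZERO constant, which we neither prove
nor refute. The named fact is NOT discharged (clauses 3, 4 as printed remain).

## What is proved, and how (the §5.1 architecture, run per character and summed by orthogonality)

Notation: `y = xe²`, `Π_χ(y) = Σ_{n ≤ y} Λ(n)χ(n)n^{-1/2}`, `f_χ(y) = Σ_{n ≤ y} Λ(n)χ(n)n^{-1/2} log(y/n)` (`halfLineSum`),
`A(y) = (ψ(y) − y) + Σ_{χ ≠ χ₀} ψ(y, χ*)`, `m_χ = ord_{s=½} L(s, χ)`.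
* §1–§4 (`exists_norm_primeCountChar_sub_le`): for primitive `χ` mod `q > 1` under GRH,
  `‖Π_χ(y) − ψ(y, χ)/√y + m_χ log y‖ ≤ C` (`y > 1`). Mechanism: the weight `w_L(u) = (L − u) − 2 + 2e^{−(L−u)/2}` (`L = log y`)
  is an admissible smoothing (`IsSmoothedEFTest`, `|p'(0)| + ∫|p''| ≤ 2`, §1 gives `‖F₀(z)‖ ≤ 2/‖z‖²` on `Re z ≥ 0` uniformly in
  `L`), and `Π_χ(y) − ψ(y, χ)/√y = ½(f_χ(y) − K_{w_L,χ}(½))` (`halfLineSum_sub_charFordK_w`); both smoothed sums are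
  `−m_χ·(their log-weight) + O(1)` under GRH by the tree's order-`m` explicit formulas (`HalfLineRiesz`, Suzuki (4.5');
  `exists_norm_charFordK_half_le`, `exists_norm_halfLineSum_add_le_of_GRH''`). This replaces the paper's partial summation
  from `ψ(x, χ)` with MV (13.41).
* §5 (`exists_eventually_norm_psiChar_add_le`): MV Thm 12.10 at a point — for primitive `χ` mod `q > 1` and `y ≥ 2`,
  eventually in `T`, `‖ψ(y, χ) + Σ_{|γ|≤T} m(ρ)y^ρ/ρ‖ ≤ C + 2 log y` (tree: `ExplicitFormulaPsiCharProofs`); the `ζ` analogue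
  (MV Thm 12.5) is the tree's `ChebyshevHalfLineBiasThm2.eventually_abs_sub_re_zetaZeroSumTrunc_le`.
* §6: `charZeroSumTrunc χ = charZeroSumTrunc χ*` for `χ ≠ χ₀` (the extra Euler factors `1 − χ*(p)p^{-s}` of `L(s, χ)` do not
  vanish on `0 < Re s`), and `charZeroSumTrunc χ₀ = zetaZeroSumTrunc` (`L(s, χ₀) = ζ(s)Π_{p∣q}(1 − p^{-s})`).
* §7: the prime powers `n` with `(n, q) > 1` contribute `O(1)` to `Π_χ` and to the cut-off sums (`p ∣ q`, geometric series).
* §8: per-character brackets (`exists_bracket_of_ne_one` via `χ*`; `exists_bracket_one` via the tree's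
  `ProgressionsRiesz.exists_norm_halfLineSum_one_le_of_RH`, `ChebyshevHalfLineBiasThm2.exists_abs_primeCount_sub_le` and
  `ζ(½) ≠ 0`), orthogonality `φ(q) log x · G(x) = Σ_χ [f_χ(y) − 2Π_χ(y)]` (`cutoff_orthogonality`, MV §4.3/§11.3), and the two
  key estimates: KEY 1 (GRH-conditional, `exists_norm_cutoff_sub_le`)
  `‖φ log x·G(x) + log y·Σ_χ c_χ + (log²y/2 − 2 log y)Σ_χ m_χ + (2/√y)A(y)‖ ≤ B` with `c_χ = (L'/L)(½, χ)` when `L(½, χ) ≠ 0`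
  (Suzuki (5.9) and its order-`m` modification); KEY 2 (unconditional, `exists_eventually_norm_A_add_le`)
  `‖A(y) + Σ_χ Σ_{|γ_χ|≤T} m(ρ)y^ρ/ρ‖ ≤ C(1 + log y)` eventually in `T`, for every `y ≥ 2`.
* §9 (`forall_riemannHypothesis_of_cutoff_le`): `|G(x)| ≤ C(1 + log x)` for large `x` ⟹ GRH for every `χ` mod `q` — the
  continuation argument of §5.1 with the transform (5.6), sign-free: `Z₀(s) = (s−1)L(s, χ₀)·Π_{χ≠χ₀} L(s, χ)` is entire,
  zero-free on `Re s ≥ 1`, `(Z₀'/Z₀)(w) = 1/(w−1) + Σ_χ (L'/L)(w, χ)` (`Re w > 1`); with `d = Λ·1_{n ≡ 1 (q)}`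
  (`vonMangoldt.residueClass 1`) and `u = log x + 2`, `φ_d(u) − 2Π_d(u) = (u − 2)G(e^{u−2})`, so the hypothesis is a quadratic
  bound `|2Π_d(u) − φ_d(u)| ≤ K + C'u²`, which the tree engine `DirichletHalfLineRiesz.entire_ne_zero_of_laplace_eq_of_integrable`
  accepts with the transform `HalfLinePrimeOnlyLandau.laplace_two_count_sub_weighted`; the plumbing repeats (they are private
  there) the lemmas of the tree's `SuzukiProgressionsRiesz.forall_riemannHypothesis_of_tendsto_progressionRieszMean`.
* §10: transfers `A(y) = o(√y logᵏy) ⟺ Σ_χ charZeroSumTrunc = o(√x logᵏx)` (KEY 2; `k ≥ 1`), the two-sided links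
  `(2/√y)‖A(y)‖ ≶ B' + φ log x‖G(x) − τ‖` (`exists_cutoff_link`, under `∀χ L(½, χ) ≠ 0`, `τ = −φ^{-1}Σ_χ(L'/L)(½, χ)`) and
  `(2/√y)‖A(y)‖ ≶ K(1 + log y) + φ log²x |G(x)/log x − τ'|` (`exists_cutoff_link_v`, GRH only, `τ' = −(2φ)^{-1}Σ_χ m_χ`), GRH from
  any limit (`forall_riemannHypothesis_of_tendsto_cutoff[_div_log]`), and the final equivalences.

Theorems only (D-0014/D-0026): no definitions, no named facts, no instances, no notation.

## References
* [Suzuki2025Chebyshev] M. Suzuki, Ramanujan J. 68 (2025) 95 = arXiv:2411.07436: §1.3 Thm 6 (iii) (1.24)–(1.25), (v)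
  (1.29)–(1.30); §5.1 (5.1)–(5.9) and the last paragraph; §4.1 (4.4'), (4.5'); §2 (2.13).
* [MontgomeryVaughan2007] H. L. Montgomery, R. C. Vaughan, *Multiplicative Number Theory I*, CUP 2007: Thm 12.5, Thm 12.10
  (explicit formulae for `ψ(x)` and `ψ(x, χ)`), §11.3 (orthogonality), (13.41).
* [DavenportMNT1980] H. Davenport, *Multiplicative Number Theory*, 2nd ed., §19 (explicit formula for `ψ(x, χ)`).
-/

noncomputable section

open Complex Filter Topology Set MeasureTheory ArithmeticFunction
open scoped Real

namespace Literature.NumberTheory.LFunctions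

namespace SuzukiThm6iii

open ExplicitPsiChar HalfLineRiesz HalfLineRieszImprimitive

variable {q : ℕ} [NeZero q] {χ : DirichletCharacter ℂ q}

/-! ## §1 Admissible smoothings with `|p'(0)| + ∫|p''| ≤ M`: `‖F₀(z)‖ ≤ M/‖z‖²` on `Re z ≥ 0` -/

/-- For an admissible smoothing (`IsSmoothedEFTest f p p' p'' x₀`) and `Re z ≥ 0`, `z ≠ 0`:
`‖F₀(z)‖ ≤ (|p'(0)| + ∫₀^{x₀} |p''|)/‖z‖²` (two integrations by parts, the tree's `fordLaplace₀_eq_of_C2`,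
and `|e^{−zt}| ≤ 1`). [cite: Ford2002Millennium, Lemma 4.5 (Remark)] -/
theorem norm_fordLaplace₀_le_of_re_nonneg {f p p' p'' : ℝ → ℝ} {x₀ : ℝ} (h : IsSmoothedEFTest f p p' p'' x₀)
    {z : ℂ} (hz : z ≠ 0) (hzre : 0 ≤ z.re) :
    ‖fordLaplace₀ f z‖ ≤ (|p' 0| + ∫ t in (0 : ℝ)..x₀, |p'' t|) / ‖z‖ ^ 2 := by
  rw [fordLaplace₀_eq_of_C2 h.x₀_nonneg h.eqOn h.eq_zero h.hasDerivAt h.hasDerivAt' h.cont'' h.p_x₀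
    h.p'_x₀ hz, norm_div, norm_pow]
  gcongr
  refine (norm_add_le _ _).trans (add_le_add ?_ ?_)
  · rw [Complex.norm_real, Real.norm_eq_abs]
  · refine (intervalIntegral.norm_integral_le_integral_norm h.x₀_nonneg).trans ?_
    refine intervalIntegral.integral_mono_on h.x₀_nonneg ?_ ?_ fun t ht ↦ ?_
    · exact ((Complex.continuous_ofReal.comp h.cont'').mul (by fun_prop)).norm.intervalIntegrable _ _
    · exact (continuous_abs.comp h.cont'').intervalIntegrable _ _
    · rw [norm_mul, Complex.norm_real, Real.norm_eq_abs, Complex.norm_exp]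
      have hre : (-(z * (t : ℂ))).re = -(z.re * t) := by simp
      rw [hre]
      have h1 : Real.exp (-(z.re * t)) ≤ 1 := by
        rw [Real.exp_le_one_iff]
        nlinarith [ht.1]
      exact mul_le_of_le_one_right (abs_nonneg _) h1

/-! ## §2 The smoothed prime sum at `s = ½` under GRH, uniformly in the smoothing -/

/-- The multiplicity `m_χ = 0` when `L(½, χ) ≠ 0` (`χ ≠ χ₀`). [cite: Suzuki2025Chebyshev, §1.3, after Thm 6 («If
`L(1/2, χ) ≠ 0` for all Dirichlet character `χ` modulo `q`, then the right-hand sides of (1.28) and (1.29) vanish»)] -/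
theorem zeroOrder_half_eq_zero (hχ : χ ≠ 1) (hhalf : χ.LFunction (1 / 2) ≠ 0) :
    DirichletDisc.zeroOrder χ (1 / 2) = 0 := by
  have han : AnalyticAt ℂ χ.LFunction (1 / 2) :=
    (DirichletCharacter.differentiable_LFunction hχ).analyticAt _
  rw [DirichletDisc.zeroOrder, analyticOrderNatAt, han.analyticOrderAt_eq_zero.2 hhalf]
  rfl

/-- **The exact explicit formula at `s = ½` under GRH, uniformly in the admissible smoothing** (primitive `χ` mod
`q > 1`): there are `c₀` — equal to `(L'/L)(½, χ)` if `L(½, χ) ≠ 0`, and the regular part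
`lim_{s→½}[(L'/L)(s, χ) − m/(s − ½)]` otherwise — and `C` such that for every admissible `f` with
`|p'(0)| + ∫₀^{x₀}|p''| ≤ M`,
`‖K_{f,χ}(½) + f(0)·c₀ + m·F(0)‖ ≤ C·M`
(`m = m_χ` the order at `½`, `F = fordLaplace f`; the term `m·F(0)` is the contribution of the zero `ρ = ½`).
From the tree's `charFordK_eq_explicit` / `HalfLineRiesz.charFordK_half_eq_explicit_of_zero`, with the zero side
bounded by `M·Σ_ρ m(ρ)/‖½ − ρ‖²` (`Re(½ − ρ) = 0` under GRH), the trivial zeros by `M·Σ_τ m(τ)/‖½ − τ‖²`, and the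
left-line integral by the tree's `exists_norm_charEFRemainder_le`. GRH-CONDITIONAL.
[cite: Suzuki2025Chebyshev, §4.1 (4.4)–(4.5') («each term … is bounded»)] [cite: HeathBrown1992PLMS, Lemma 5.1] -/
theorem exists_norm_charFordK_half_le (hprim : χ.IsPrimitive) (hq : 1 < q) (hGRH : χ.RiemannHypothesis) :
    ∃ c₀ : ℂ, (χ.LFunction (1 / 2) ≠ 0 → c₀ = logDeriv χ.LFunction (1 / 2)) ∧
      (χ.LFunction (1 / 2) = 0 → Tendsto (fun s ↦ logDeriv χ.LFunction s -
          (DirichletDisc.zeroOrder χ (1 / 2) : ℂ) / (s - 1 / 2)) (𝓝[≠] (1 / 2)) (𝓝 c₀)) ∧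
      ∃ C : ℝ, ∀ (f p p' p'' : ℝ → ℝ) (x₀ M : ℝ), IsSmoothedEFTest f p p' p'' x₀ →
        |p' 0| + (∫ t in (0 : ℝ)..x₀, |p'' t|) ≤ M →
        ‖charFordK χ f (1 / 2) + (f 0 : ℂ) * c₀ +
            (DirichletDisc.zeroOrder χ (1 / 2) : ℂ) * fordLaplace f 0‖ ≤ C * M := by
  classical
  have hχ : χ ≠ 1 := ne_one_of_isPrimitive hprim hq
  -- the three constants
  set Z : ℝ := ∑' ρ : charNontrivialZeros χ,
    (DirichletDisc.zeroOrder χ (ρ : ℂ) : ℝ) / ‖(1 / 2 : ℂ) - ρ‖ ^ 2 with hZ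
  have hZs := summable_zeroOrder_div_norm_sq' hprim hq
  set T : ℝ := ∑ τ ∈ charTrivialZeroFinset hχ,
    (DirichletDisc.zeroOrder χ τ : ℝ) / ‖(1 / 2 : ℂ) - τ‖ ^ 2 with hT
  obtain ⟨CJ, hCJ0, hCJ⟩ := exists_norm_charEFRemainder_le
  have hq1 : (1 : ℝ) < q := by exact_mod_cast hq
  have hlogq : 0 ≤ Real.log q := Real.log_nonneg hq1.le
  -- generic bounds, valid for every admissible `f` with `|p'(0)| + ∫|p''| ≤ M`
  have hM0 : ∀ {f p p' p'' : ℝ → ℝ} {x₀ M : ℝ}, IsSmoothedEFTest f p p' p'' x₀ →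
      |p' 0| + (∫ t in (0 : ℝ)..x₀, |p'' t|) ≤ M → 0 ≤ M := by
    intro f p p' p'' x₀ M h hM
    refine le_trans (add_nonneg (abs_nonneg _) ?_) hM
    exact intervalIntegral.integral_nonneg h.x₀_nonneg fun t _ ↦ abs_nonneg _
  -- zero side, terms with `ρ ≠ ½`
  have hzero_term : ∀ {f p p' p'' : ℝ → ℝ} {x₀ M : ℝ}, IsSmoothedEFTest f p p' p'' x₀ →
      |p' 0| + (∫ t in (0 : ℝ)..x₀, |p'' t|) ≤ M → ∀ ρ : charNontrivialZeros χ, (ρ : ℂ) ≠ 1 / 2 →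
      ‖(DirichletDisc.zeroOrder χ (ρ : ℂ) : ℂ) * fordLaplace₀ f (1 / 2 - ρ)‖ ≤
        M * ((DirichletDisc.zeroOrder χ (ρ : ℂ) : ℝ) / ‖(1 / 2 : ℂ) - ρ‖ ^ 2) := by
    intro f p p' p'' x₀ M h hM ρ hρ
    have hre : ((1 / 2 : ℂ) - (ρ : ℂ)).re = 0 := by
      have := hGRH ρ ρ.2.1 ρ.2.2.1 ρ.2.2.2
      simp [this]
    have hz : (1 / 2 : ℂ) - (ρ : ℂ) ≠ 0 := sub_ne_zero.2 (Ne.symm hρ)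
    have hm : (0 : ℝ) ≤ DirichletDisc.zeroOrder χ (ρ : ℂ) := Nat.cast_nonneg _
    have hb := norm_fordLaplace₀_le_of_re_nonneg h hz hre.ge
    rw [norm_mul, Complex.norm_natCast]
    calc (DirichletDisc.zeroOrder χ (ρ : ℂ) : ℝ) * ‖fordLaplace₀ f (1 / 2 - ρ)‖
        ≤ (DirichletDisc.zeroOrder χ (ρ : ℂ) : ℝ) * (M / ‖(1 / 2 : ℂ) - ρ‖ ^ 2) :=
          mul_le_mul_of_nonneg_left (hb.trans (by gcongr)) hm
      _ = M * ((DirichletDisc.zeroOrder χ (ρ : ℂ) : ℝ) / ‖(1 / 2 : ℂ) - ρ‖ ^ 2) := by ring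
  -- trivial zeros
  have htriv : ∀ {f p p' p'' : ℝ → ℝ} {x₀ M : ℝ}, IsSmoothedEFTest f p p' p'' x₀ →
      |p' 0| + (∫ t in (0 : ℝ)..x₀, |p'' t|) ≤ M →
      ‖∑ τ ∈ charTrivialZeroFinset hχ, (DirichletDisc.zeroOrder χ τ : ℂ) * fordLaplace₀ f (1 / 2 - τ)‖ ≤
        M * T := by
    intro f p p' p'' x₀ M h hM
    rw [hT, Finset.mul_sum]
    refine (norm_sum_le _ _).trans (Finset.sum_le_sum fun τ hτ ↦ ?_)
    obtain ⟨-, -, hτre, hτim⟩ := mem_charTrivialZeroFinset.1 hτ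
    have hzre : 0 ≤ ((1 / 2 : ℂ) - τ).re := by simp; linarith
    have hz : (1 / 2 : ℂ) - τ ≠ 0 := by
      intro h0
      have := congrArg Complex.re h0
      simp at this
      linarith
    have hm : (0 : ℝ) ≤ DirichletDisc.zeroOrder χ τ := Nat.cast_nonneg _
    have hb := norm_fordLaplace₀_le_of_re_nonneg h hz hzre
    rw [norm_mul, Complex.norm_natCast]
    calc (DirichletDisc.zeroOrder χ τ : ℝ) * ‖fordLaplace₀ f (1 / 2 - τ)‖
        ≤ (DirichletDisc.zeroOrder χ τ : ℝ) * (M / ‖(1 / 2 : ℂ) - τ‖ ^ 2) :=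
          mul_le_mul_of_nonneg_left (hb.trans (by gcongr)) hm
      _ = M * ((DirichletDisc.zeroOrder χ τ : ℝ) / ‖(1 / 2 : ℂ) - τ‖ ^ 2) := by ring
  -- the left-line integral
  have hrem : ∀ {f p p' p'' : ℝ → ℝ} {x₀ M : ℝ}, IsSmoothedEFTest f p p' p'' x₀ →
      |p' 0| + (∫ t in (0 : ℝ)..x₀, |p'' t|) ≤ M →
      ‖charEFRemainder χ f (1 / 2)‖ ≤ CJ * M * Real.log q := by
    intro f p p' p'' x₀ M h hM
    have hM' := hM0 h hM
    have key := hCJ q χ hprim hq f (1 / 2) M hM' (by norm_num) (fun y ↦ ?_)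
    · simpa using key
    · have hz : (1 / 2 : ℂ) - ((((-(5 / 2) : ℝ)) : ℂ) + y * I) ≠ 0 := by
        intro h0
        have := congrArg Complex.re h0
        simp at this
        linarith
      have hzre : 0 ≤ ((1 / 2 : ℂ) - ((((-(5 / 2) : ℝ)) : ℂ) + y * I)).re := by simp; norm_num
      have hb := norm_fordLaplace₀_le_of_re_nonneg h hz hzre
      have hns : ‖(1 / 2 : ℂ) - ((((-(5 / 2) : ℝ)) : ℂ) + y * I)‖ ^ 2 =
          ((1 / 2 : ℂ).re + 5 / 2) ^ 2 + ((1 / 2 : ℂ).im - y) ^ 2 := by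
        rw [Complex.sq_norm, Complex.normSq_apply]
        simp
        ring
      rw [← hns]
      exact hb.trans (by gcongr)
  by_cases hhalf : χ.LFunction (1 / 2) = 0
  · -- `L(½, χ) = 0`: the regularised formula
    obtain ⟨c₀, hc₀, hK⟩ := charFordK_half_eq_explicit_of_zero hprim hq hhalf
    obtain ⟨ρ₀, hρ₀v⟩ : ∃ ρ₀ : charNontrivialZeros χ, (ρ₀ : ℂ) = 1 / 2 :=
      ⟨⟨1 / 2, hhalf, by norm_num, by norm_num⟩, rfl⟩
    refine ⟨c₀, fun h ↦ (h hhalf).elim, fun _ ↦ hc₀, Z + T + CJ * Real.log q, ?_⟩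
    intro f p p' p'' x₀ M h hM
    have hM' := hM0 h hM
    have hsum := summable_zeroTerm_half hprim hq h
    set g : charNontrivialZeros χ → ℂ := fun ρ ↦
      (DirichletDisc.zeroOrder χ (ρ : ℂ) : ℂ) * fordLaplace₀ f (1 / 2 - ρ) with hg
    have hsplit := hsum.tsum_eq_add_tsum_ite ρ₀
    have hρ₀term : g ρ₀ = (DirichletDisc.zeroOrder χ (1 / 2) : ℂ) * fordLaplace f 0 := by
      simp only [hg, hρ₀v, sub_self, fordLaplace₀, div_zero, sub_zero]
    -- the remaining zero sum
    have hrest : ‖∑' ρ : charNontrivialZeros χ, (if ρ = ρ₀ then 0 else g ρ)‖ ≤ M * Z := by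
      rw [hZ, ← tsum_mul_left]
      refine tsum_of_norm_bounded (hZs.mul_left M).hasSum fun ρ ↦ ?_
      split_ifs with hρ
      · rw [norm_zero]
        exact mul_nonneg hM' (div_nonneg (Nat.cast_nonneg _) (sq_nonneg _))
      · have hρ' : (ρ : ℂ) ≠ 1 / 2 := fun h' ↦ hρ (Subtype.ext (h'.trans hρ₀v.symm))
        exact hzero_term h hM ρ hρ'
    rw [hK f p p' p'' x₀ h]
    have heq : -(f 0 : ℂ) * c₀ - ∑' ρ : charNontrivialZeros χ, g ρ
        - ∑ τ ∈ charTrivialZeroFinset hχ, (DirichletDisc.zeroOrder χ τ : ℂ) * fordLaplace₀ f (1 / 2 - τ)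
        + charEFRemainder χ f (1 / 2) + (f 0 : ℂ) * c₀
        + (DirichletDisc.zeroOrder χ (1 / 2) : ℂ) * fordLaplace f 0 =
        -(∑' ρ : charNontrivialZeros χ, (if ρ = ρ₀ then 0 else g ρ))
        - ∑ τ ∈ charTrivialZeroFinset hχ, (DirichletDisc.zeroOrder χ τ : ℂ) * fordLaplace₀ f (1 / 2 - τ)
        + charEFRemainder χ f (1 / 2) := by
      rw [hsplit, hρ₀term]; ring
    rw [heq]
    calc ‖-(∑' ρ : charNontrivialZeros χ, (if ρ = ρ₀ then 0 else g ρ))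
          - ∑ τ ∈ charTrivialZeroFinset hχ, (DirichletDisc.zeroOrder χ τ : ℂ) * fordLaplace₀ f (1 / 2 - τ)
          + charEFRemainder χ f (1 / 2)‖
        ≤ ‖-(∑' ρ : charNontrivialZeros χ, (if ρ = ρ₀ then 0 else g ρ))‖
          + ‖∑ τ ∈ charTrivialZeroFinset hχ, (DirichletDisc.zeroOrder χ τ : ℂ) * fordLaplace₀ f (1 / 2 - τ)‖
          + ‖charEFRemainder χ f (1 / 2)‖ := by
          refine (norm_add_le _ _).trans (add_le_add (norm_sub_le _ _) le_rfl)
      _ ≤ M * Z + M * T + CJ * M * Real.log q := by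
          rw [norm_neg]
          exact add_le_add (add_le_add hrest (htriv h hM)) (hrem h hM)
      _ = (Z + T + CJ * Real.log q) * M := by ring
  · -- `L(½, χ) ≠ 0`: the tree's formula, `m = 0`
    refine ⟨logDeriv χ.LFunction (1 / 2), fun _ ↦ rfl, fun h ↦ (hhalf h).elim, Z + T + CJ * Real.log q, ?_⟩
    intro f p p' p'' x₀ M h hM
    have hM' := hM0 h hM
    have hm0 : DirichletDisc.zeroOrder χ (1 / 2) = 0 := zeroOrder_half_eq_zero hχ hhalf
    have hK := charFordK_eq_explicit hprim hq h (s := 1 / 2) (by norm_num) (by norm_num) hhalf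
    set g : charNontrivialZeros χ → ℂ := fun ρ ↦
      (DirichletDisc.zeroOrder χ (ρ : ℂ) : ℂ) * fordLaplace₀ f (1 / 2 - ρ) with hg
    have hzsum : ‖∑' ρ : charNontrivialZeros χ, g ρ‖ ≤ M * Z := by
      rw [hZ, ← tsum_mul_left]
      refine tsum_of_norm_bounded (hZs.mul_left M).hasSum fun ρ ↦ ?_
      have hρ' : (ρ : ℂ) ≠ 1 / 2 := by
        intro h'
        exact hhalf (h' ▸ ρ.2.1)
      exact hzero_term h hM ρ hρ'
    rw [hK, hm0, logDeriv_apply]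
    have heq : -(f 0 : ℂ) * (deriv χ.LFunction (1 / 2) / χ.LFunction (1 / 2)) - ∑' ρ : charNontrivialZeros χ, g ρ
        - ∑ τ ∈ charTrivialZeroFinset hχ, (DirichletDisc.zeroOrder χ τ : ℂ) * fordLaplace₀ f (1 / 2 - τ)
        + charEFRemainder χ f (1 / 2) + (f 0 : ℂ) * (deriv χ.LFunction (1 / 2) / χ.LFunction (1 / 2))
        + ((0 : ℕ) : ℂ) * fordLaplace f 0 =
        -(∑' ρ : charNontrivialZeros χ, g ρ)
        - ∑ τ ∈ charTrivialZeroFinset hχ, (DirichletDisc.zeroOrder χ τ : ℂ) * fordLaplace₀ f (1 / 2 - τ)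
        + charEFRemainder χ f (1 / 2) := by
      push_cast; ring
    rw [heq]
    calc ‖-(∑' ρ : charNontrivialZeros χ, g ρ)
          - ∑ τ ∈ charTrivialZeroFinset hχ, (DirichletDisc.zeroOrder χ τ : ℂ) * fordLaplace₀ f (1 / 2 - τ)
          + charEFRemainder χ f (1 / 2)‖
        ≤ ‖-(∑' ρ : charNontrivialZeros χ, g ρ)‖
          + ‖∑ τ ∈ charTrivialZeroFinset hχ, (DirichletDisc.zeroOrder χ τ : ℂ) * fordLaplace₀ f (1 / 2 - τ)‖
          + ‖charEFRemainder χ f (1 / 2)‖ := by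
          refine (norm_add_le _ _).trans (add_le_add (norm_sub_le _ _) le_rfl)
      _ ≤ M * Z + M * T + CJ * M * Real.log q := by
          rw [norm_neg]
          exact add_le_add (add_le_add hzsum (htriv h hM)) (hrem h hM)
      _ = (Z + T + CJ * Real.log q) * M := by ring


/-! ## §3 `f_χ` under GRH with the SAME constant `c₀` (both cases `L(½, χ) = 0` / `≠ 0`) -/

/-- **`‖f_χ(x) + c₀ log x + (m/2) log²x‖ ≤ B` under GRH** for a primitive `χ` mod `q > 1`, with `c₀` characterised as
in `exists_norm_charFordK_half_le` (`c₀ = (L'/L)(½, χ)` if `L(½, χ) ≠ 0`, the regular part of `L'/L` at `½`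
otherwise). The tree's `HalfLineRiesz.exists_norm_halfLineSum_add_le_of_GRH` (`m = 0`) resp. the road of
`HalfLineRiesz.exists_norm_halfLineSum_add_le_of_GRH_of_zero` from `halfLineSum_eq_explicit_of_zero` (repeated here
to keep the characterisation of `c₀`). GRH-CONDITIONAL. [cite: Suzuki2025Chebyshev, §4.1 (4.5), (4.5')] -/
theorem exists_norm_halfLineSum_add_le_of_GRH'' (hprim : χ.IsPrimitive) (hq : 1 < q) (hGRH : χ.RiemannHypothesis)
    {c₀ : ℂ} (hc₁ : χ.LFunction (1 / 2) ≠ 0 → c₀ = logDeriv χ.LFunction (1 / 2))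
    (hc₂ : χ.LFunction (1 / 2) = 0 → Tendsto (fun s ↦ logDeriv χ.LFunction s -
          (DirichletDisc.zeroOrder χ (1 / 2) : ℂ) / (s - 1 / 2)) (𝓝[≠] (1 / 2)) (𝓝 c₀)) :
    ∃ B : ℝ, ∀ x : ℝ, 1 < x →
      ‖halfLineSum χ x + (Real.log x : ℂ) * c₀
        + (DirichletDisc.zeroOrder χ (1 / 2) : ℂ) * (((Real.log x) ^ 2 / 2 : ℝ) : ℂ)‖ ≤ B := by
  have hχ : χ ≠ 1 := ne_one_of_isPrimitive hprim hq
  by_cases hhalf : χ.LFunction (1 / 2) = 0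
  · obtain ⟨c₀', hc₀', hF⟩ := halfLineSum_eq_explicit_of_zero hprim hq hhalf
    have hcc : c₀' = c₀ := tendsto_nhds_unique hc₀' (hc₂ hhalf)
    subst hcc
    obtain ⟨BJ, hBJ⟩ := exists_norm_remSideDeriv_le (χ := χ) hprim hq
    set BZ : ℝ := ∑' ρ : charNontrivialZeros χ,
      2 * ((DirichletDisc.zeroOrder χ (ρ : ℂ) : ℝ) / ‖(1 / 2 : ℂ) - ρ‖ ^ 2)
    set BT : ℝ := ∑ τ ∈ charTrivialZeroFinset hχ,
      2 * ((DirichletDisc.zeroOrder χ τ : ℝ) / ‖(1 / 2 : ℂ) - τ‖ ^ 2)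
    refine ⟨BZ + BT + BJ, fun x hx ↦ ?_⟩
    have hL : 0 ≤ Real.log x := (Real.log_pos hx).le
    have heq : halfLineSum χ x + (Real.log x : ℂ) * c₀'
        + (DirichletDisc.zeroOrder χ (1 / 2) : ℂ) * (((Real.log x) ^ 2 / 2 : ℝ) : ℂ) =
        -zeroSideDeriv χ (Real.log x) - trivSideDeriv hχ (Real.log x) + remSideDeriv χ (Real.log x) := by
      rw [hF x hx]; ring
    rw [heq]
    have h1 := norm_zeroSideDeriv_le_of_GRH' hprim hq hGRH (Real.log x)
    have h2 := norm_trivSideDeriv_le hχ hL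
    have h3 := hBJ _ hL
    calc ‖-zeroSideDeriv χ (Real.log x) - trivSideDeriv hχ (Real.log x) + remSideDeriv χ (Real.log x)‖
        ≤ ‖-zeroSideDeriv χ (Real.log x) - trivSideDeriv hχ (Real.log x)‖ + ‖remSideDeriv χ (Real.log x)‖ :=
          norm_add_le _ _
      _ ≤ ‖-zeroSideDeriv χ (Real.log x)‖ + ‖trivSideDeriv hχ (Real.log x)‖
          + ‖remSideDeriv χ (Real.log x)‖ := by
          gcongr; exact norm_sub_le _ _
      _ ≤ BZ + BT + BJ := by rw [norm_neg]; gcongr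
  · obtain ⟨B, hB⟩ := exists_norm_halfLineSum_add_le_of_GRH hprim hq hhalf hGRH
    refine ⟨B, fun x hx ↦ ?_⟩
    have hm0 : DirichletDisc.zeroOrder χ (1 / 2) = 0 := zeroOrder_half_eq_zero hχ hhalf
    rw [hc₁ hhalf, hm0, logDeriv_apply]
    simpa using hB x hx

/-! ## §4 The weight `w_L(u) = (L − u) − 2 + 2e^{−(L−u)/2}` (`u ≤ L`): `Π_χ(y) − ψ(y, χ)/√y = ½(f_χ(y) − K_{w_L,χ}(½))` -/

/-- The weight `w_L` is an admissible smoothing: `w_L = p` on `[0, L]` with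
`p(u) = (L − u) − 2 + 2e^{(u−L)/2}`, `p'(u) = −1 + e^{(u−L)/2}`, `p''(u) = e^{(u−L)/2}/2`, `p(L) = p'(L) = 0`.
[cite: Ford2002Millennium, Lemma 4.5 (Remark)] -/
theorem isSmoothedEFTest_w {L : ℝ} (hL : 0 ≤ L) :
    IsSmoothedEFTest (fun u ↦ max (L - u) 0 - 2 + 2 * Real.exp (-(max (L - u) 0) / 2))
      (fun u ↦ (L - u) - 2 + 2 * Real.exp ((u - L) / 2)) (fun u ↦ -1 + Real.exp ((u - L) / 2))
      (fun u ↦ Real.exp ((u - L) / 2) / 2) L where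
  cont := by fun_prop
  x₀_nonneg := hL
  eqOn := fun t ht ↦ by
    have h : max (L - t) 0 = L - t := max_eq_left (by linarith [ht.2])
    simp only [h]
    congr 2
    ring
  eq_zero := fun u hu ↦ by
    have h : max (L - u) 0 = 0 := max_eq_right (by linarith)
    simp [h]
  hasDerivAt := fun t ↦ by
    have h1 : HasDerivAt (fun u : ℝ ↦ (u - L) / 2) (1 / 2) t := by
      simpa using ((hasDerivAt_id t).sub_const L).div_const 2
    have h2 := h1.exp
    have h3 := (((hasDerivAt_id t).const_sub L).sub_const (2 : ℝ)).add (h2.const_mul 2)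
    refine h3.congr_deriv ?_
    simp; ring
  hasDerivAt' := fun t ↦ by
    have h1 : HasDerivAt (fun u : ℝ ↦ (u - L) / 2) (1 / 2) t := by
      simpa using ((hasDerivAt_id t).sub_const L).div_const 2
    have h2 := h1.exp
    refine (h2.const_add (-1)).congr_deriv ?_
    ring
  cont'' := by fun_prop
  p_x₀ := by simp
  p'_x₀ := by simp

/-- `|p'(0)| + ∫₀^L |p''| = 2(1 − e^{−L/2}) ≤ 2` for the weight `w_L`. [folklore] -/
private theorem w_decay_le_two {L : ℝ} (hL : 0 ≤ L) :
    |(-1 + Real.exp ((0 - L) / 2))| + (∫ t in (0 : ℝ)..L, |Real.exp ((t - L) / 2) / 2|) ≤ 2 := by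
  have hFTC : ∫ t in (0 : ℝ)..L, Real.exp ((t - L) / 2) / 2 =
      (-1 + Real.exp ((L - L) / 2)) - (-1 + Real.exp ((0 - L) / 2)) := by
    refine intervalIntegral.integral_eq_sub_of_hasDerivAt (f := fun u : ℝ ↦ -1 + Real.exp ((u - L) / 2))
      (fun t _ ↦ (isSmoothedEFTest_w hL).hasDerivAt' t) ?_
    exact (by fun_prop : Continuous fun t : ℝ ↦ Real.exp ((t - L) / 2) / 2).intervalIntegrable _ _
  have habs : (∫ t in (0 : ℝ)..L, |Real.exp ((t - L) / 2) / 2|) = ∫ t in (0 : ℝ)..L, Real.exp ((t - L) / 2) / 2 :=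
    intervalIntegral.integral_congr fun t _ ↦ abs_of_nonneg (by positivity)
  have he0 : Real.exp ((0 - L) / 2) ≤ 1 := by rw [Real.exp_le_one_iff]; linarith
  have he0' : 0 < Real.exp ((0 - L) / 2) := Real.exp_pos _
  rw [habs, hFTC, sub_self, zero_div, Real.exp_zero, abs_of_nonpos (by linarith)]
  linarith

/-- `F(0) = ∫₀^L w_L = L²/2 − 2L + 4 − 4e^{−L/2}` for the weight `w_L`. [folklore] -/
private theorem fordLaplace_w_zero {L : ℝ} (hL : 0 ≤ L) :
    fordLaplace (fun u ↦ max (L - u) 0 - 2 + 2 * Real.exp (-(max (L - u) 0) / 2)) 0 =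
      ((L ^ 2 / 2 - 2 * L + 4 - 4 * Real.exp (-L / 2) : ℝ) : ℂ) := by
  have h := isSmoothedEFTest_w hL
  rw [fordLaplace_eq_intervalIntegral h.x₀_nonneg h.eqOn h.eq_zero (by fun_prop) 0]
  simp only [zero_mul, neg_zero, Complex.exp_zero, mul_one]
  rw [intervalIntegral.integral_ofReal]
  congr 1
  have hFTC : ∫ t in (0 : ℝ)..L, ((L - t) - 2 + 2 * Real.exp ((t - L) / 2)) =
      (-(L - L) ^ 2 / 2 - 2 * L + 4 * Real.exp ((L - L) / 2)) -
        (-(L - 0) ^ 2 / 2 - 2 * 0 + 4 * Real.exp ((0 - L) / 2)) := by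
    have hder : ∀ t : ℝ, HasDerivAt (fun u : ℝ ↦ -(L - u) ^ 2 / 2 - 2 * u + 4 * Real.exp ((u - L) / 2))
        ((L - t) - 2 + 2 * Real.exp ((t - L) / 2)) t := by
      intro t
      have h1 : HasDerivAt (fun u : ℝ ↦ (u - L) / 2) (1 / 2) t := by
        simpa using ((hasDerivAt_id t).sub_const L).div_const 2
      have h2 := h1.exp
      have h3 : HasDerivAt (fun u : ℝ ↦ -(L - u) ^ 2 / 2) (L - t) t := by
        have := (((hasDerivAt_id t).const_sub L).pow 2).neg.div_const 2
        refine this.congr_deriv ?_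
        simp
      have h4 := (h3.sub ((hasDerivAt_id t).const_mul (2 : ℝ))).add (h2.const_mul 4)
      refine h4.congr_deriv ?_
      simp; ring
    refine intervalIntegral.integral_eq_sub_of_hasDerivAt (fun t _ ↦ hder t) ?_
    exact (by fun_prop : Continuous fun t : ℝ ↦ (L - t) - 2 + 2 * Real.exp ((t - L) / 2)).intervalIntegrable _ _
  rw [hFTC]
  simp only [sub_self, zero_div, Real.exp_zero]
  rw [show (0 - L) / 2 = -L / 2 by ring]
  ring

/-- `ψ(y, χ) = Σ_{1 ≤ n ≤ y} Λ(n)χ(n)` as a sum over `Finset.Icc 1 ⌊y⌋₊` (the `n = 0` term vanishes). [folklore] -/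
private theorem chebyshevPsiChar_eq_sum_Icc {N : ℕ} (ψ : DirichletCharacter ℂ N) (y : ℝ) :
    Sieve.chebyshevPsiChar ψ y = ∑ n ∈ Finset.Icc 1 ⌊y⌋₊, (Λ n : ℂ) * ψ n := by
  rw [Sieve.chebyshevPsiChar, Finset.range_eq_Ico, Finset.sum_eq_sum_Ico_succ_bot (Nat.succ_pos _)]
  simp only [Nat.cast_zero, ArithmeticFunction.map_zero, Complex.ofReal_zero, mul_zero, zero_add]
  rw [show Finset.Ico 1 (⌊y⌋₊ + 1) = Finset.Icc 1 ⌊y⌋₊ from rfl]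
  exact Finset.sum_congr rfl fun n _ ↦ mul_comm _ _

/-- **The identity `f_χ(y) − K_{w_L,χ}(½) = 2(Π_χ(y) − ψ(y, χ)/√y)`** (`L = log y`, `y > 1`; finite sums):
`log(y/n) − w_L(log n) = 2 − 2√(n/y)` for `n ≤ y`. [folklore] -/
private theorem halfLineSum_sub_charFordK_w {N : ℕ} (ψ : DirichletCharacter ℂ N) {y : ℝ} (hy : 1 < y) :
    halfLineSum ψ y -
        charFordK ψ (fun u ↦ max (Real.log y - u) 0 - 2 + 2 * Real.exp (-(max (Real.log y - u) 0) / 2)) (1 / 2) =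
      2 * ((∑ n ∈ Finset.Icc 1 ⌊y⌋₊, (Λ n : ℂ) * ψ n / (Real.sqrt n : ℂ)) -
        Sieve.chebyshevPsiChar ψ y / (Real.sqrt y : ℂ)) := by
  have hy0 : 0 < y := by linarith
  set L := Real.log y with hLdef
  have hL : 0 ≤ L := (Real.log_pos hy).le
  have hN : 1 ≤ ⌊y⌋₊ + 1 := by omega
  have hlogN : L ≤ Real.log ((⌊y⌋₊ + 1 : ℕ) : ℝ) := by
    rw [hLdef]
    exact Real.log_le_log hy0 (by push_cast; exact (Nat.lt_floor_add_one y).le)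
  rw [charFordK_eq_sum ψ (fun u hu ↦ (isSmoothedEFTest_w hL).eq_zero u hu) hN hlogN,
    Finset.range_eq_Ico, Finset.sum_eq_sum_Ico_succ_bot (Nat.succ_pos _)]
  simp only [Nat.cast_zero, ArithmeticFunction.map_zero, Complex.ofReal_zero, zero_mul, zero_add]
  rw [show Finset.Ico 1 (⌊y⌋₊ + 1) = Finset.Icc 1 ⌊y⌋₊ from rfl, chebyshevPsiChar_eq_sum_Icc, halfLineSum,
    Finset.sum_div, ← Finset.sum_sub_distrib, ← Finset.sum_sub_distrib, Finset.mul_sum]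
  refine Finset.sum_congr rfl fun n hn ↦ ?_
  obtain ⟨hn1, hny⟩ := Finset.mem_Icc.1 hn
  have hn0 : (0 : ℝ) < n := by exact_mod_cast hn1
  have hnle : (n : ℝ) ≤ y := (Nat.floor_le hy0.le).trans' (by exact_mod_cast hny)
  have hlogn : Real.log n ≤ L := Real.log_le_log hn0 hnle
  have hmax : max (L - Real.log n) 0 = L - Real.log n := max_eq_left (by linarith)
  have hsqrt : Real.exp (-(L - Real.log n) / 2) = Real.sqrt n / Real.sqrt y := by
    rw [show -(L - Real.log n) / 2 = Real.log n * (1 / 2) - Real.log y * (1 / 2) by rw [hLdef]; ring,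
      Real.exp_sub, ← Real.rpow_def_of_pos hn0, ← Real.rpow_def_of_pos hy0, ← Real.sqrt_eq_rpow,
      ← Real.sqrt_eq_rpow]
  have hlogdiv : Real.log (y / n) = L - Real.log n := by rw [hLdef, Real.log_div hy0.ne' hn0.ne']
  have hcpow : (n : ℂ) ^ (-(1 / 2 : ℂ)) = 1 / (Real.sqrt n : ℂ) := by
    rw [show (n : ℂ) = ((n : ℝ) : ℂ) by norm_cast,
      show (-(1 / 2 : ℂ)) = ((-(1 / 2) : ℝ) : ℂ) by push_cast; ring,
      ← Complex.ofReal_cpow hn0.le, Real.rpow_neg hn0.le, Real.sqrt_eq_rpow]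
    push_cast
    ring
  have hsn : (Real.sqrt n : ℂ) ≠ 0 := by exact_mod_cast (Real.sqrt_pos.2 hn0).ne'
  have hsy : (Real.sqrt y : ℂ) ≠ 0 := by exact_mod_cast (Real.sqrt_pos.2 hy0).ne'
  rw [hmax, hsqrt, hlogdiv, hcpow]
  push_cast
  field_simp
  ring

/-- **`Π_χ(y) − ψ(y, χ)/√y = −m_χ log y + O(1)` under GRH** for a primitive `χ` mod `q > 1` (`y > 1`,
`m_χ` the order of `L(s, χ)` at `½`; `m_χ = 0` if `L(½, χ) ≠ 0`): with the weight `w_L` (`L = log y`),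
`2(Π_χ − ψ/√y) = f_χ(y) − K_{w_L,χ}(½) = [f_χ + Lc₀ + mL²/2] − [K + w_L(0)c₀ + mF(0)] + c₀(w_L(0) − L) + m(F(0) − L²/2)`,
where `w_L(0) − L = −2 + 2e^{−L/2}` and `F(0) − L²/2 = −2L + 4 − 4e^{−L/2}`. GRH-CONDITIONAL.
[cite: Suzuki2025Chebyshev, §4.1 (4.5)–(4.5') and §2 (2.13) (the shape of `Σ_{n≤x}Λ(n)χ(n)n^{-1/2}`)] -/
theorem exists_norm_primeCountChar_sub_le (hprim : χ.IsPrimitive) (hq : 1 < q) (hGRH : χ.RiemannHypothesis) :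
    ∃ C : ℝ, ∀ y : ℝ, 1 < y →
      ‖(∑ n ∈ Finset.Icc 1 ⌊y⌋₊, (Λ n : ℂ) * χ n / (Real.sqrt n : ℂ)) - Sieve.chebyshevPsiChar χ y / (Real.sqrt y : ℂ)
          + (DirichletDisc.zeroOrder χ (1 / 2) : ℂ) * Real.log y‖ ≤ C := by
  obtain ⟨c₀, hc₁, hc₂, CK, hK⟩ := exists_norm_charFordK_half_le hprim hq hGRH
  obtain ⟨B, hB⟩ := exists_norm_halfLineSum_add_le_of_GRH'' hprim hq hGRH hc₁ hc₂
  set m : ℂ := (DirichletDisc.zeroOrder χ (1 / 2) : ℂ) with hm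
  refine ⟨(B + CK * 2 + ‖c₀‖ * 2 + ‖m‖ * 4) / 2, fun y hy ↦ ?_⟩
  have hy0 : 0 < y := by linarith
  set L := Real.log y with hLdef
  have hL : 0 ≤ L := (Real.log_pos hy).le
  have hw := isSmoothedEFTest_w hL
  set f : ℝ → ℝ := fun u ↦ max (L - u) 0 - 2 + 2 * Real.exp (-(max (L - u) 0) / 2) with hf
  have hKf := hK f _ _ _ L 2 hw (w_decay_le_two hL)
  have hF0 : fordLaplace f 0 = ((L ^ 2 / 2 - 2 * L + 4 - 4 * Real.exp (-L / 2) : ℝ) : ℂ) :=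
    fordLaplace_w_zero hL
  have hf0 : f 0 = L - 2 + 2 * Real.exp (-L / 2) := by
    simp only [hf, sub_zero, max_eq_left hL]
  have hid := halfLineSum_sub_charFordK_w χ hy
  have hBy := hB y hy
  -- `2(Π − ψ/√y) + 2mL` as a combination of the two bounded brackets
  have heq : 2 * ((∑ n ∈ Finset.Icc 1 ⌊y⌋₊, (Λ n : ℂ) * χ n / (Real.sqrt n : ℂ)) -
        Sieve.chebyshevPsiChar χ y / (Real.sqrt y : ℂ) + m * Real.log y) =
      (halfLineSum χ y + (Real.log y : ℂ) * c₀ + m * (((Real.log y) ^ 2 / 2 : ℝ) : ℂ))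
        - (charFordK χ f (1 / 2) + (f 0 : ℂ) * c₀ + m * fordLaplace f 0)
        + c₀ * (((-2 + 2 * Real.exp (-L / 2) : ℝ) : ℂ))
        + m * (((4 - 4 * Real.exp (-L / 2) : ℝ) : ℂ)) := by
    rw [mul_add, ← hid, hF0, hf0, ← hLdef]
    push_cast
    ring
  have he : Real.exp (-L / 2) ≤ 1 := by rw [Real.exp_le_one_iff]; linarith
  have he' : 0 < Real.exp (-L / 2) := Real.exp_pos _
  have hn1 : ‖c₀ * (((-2 + 2 * Real.exp (-L / 2) : ℝ) : ℂ))‖ ≤ ‖c₀‖ * 2 := by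
    rw [norm_mul, Complex.norm_real, Real.norm_eq_abs]
    refine mul_le_mul_of_nonneg_left ?_ (norm_nonneg _)
    rw [abs_le]; constructor <;> linarith
  have hn2 : ‖m * (((4 - 4 * Real.exp (-L / 2) : ℝ) : ℂ))‖ ≤ ‖m‖ * 4 := by
    rw [norm_mul, Complex.norm_real, Real.norm_eq_abs]
    refine mul_le_mul_of_nonneg_left ?_ (norm_nonneg _)
    rw [abs_le]; constructor <;> linarith
  have h2 : ‖2 * ((∑ n ∈ Finset.Icc 1 ⌊y⌋₊, (Λ n : ℂ) * χ n / (Real.sqrt n : ℂ)) -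
        Sieve.chebyshevPsiChar χ y / (Real.sqrt y : ℂ) + m * Real.log y)‖ ≤
      B + CK * 2 + ‖c₀‖ * 2 + ‖m‖ * 4 := by
    rw [heq]
    refine (norm_add_le _ _).trans (add_le_add ((norm_add_le _ _).trans
      (add_le_add ((norm_sub_le _ _).trans (add_le_add hBy hKf)) hn1)) hn2)
  rw [norm_mul, Complex.norm_two] at h2
  linarith


/-! ## §5 Montgomery–Vaughan Thm 12.10 at a single point, `T → ∞` -/

/-- **MV Thm 12.10 at a single point, `T → ∞`**: for a primitive `χ` mod `q > 1` there is `C` such that for every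
`y ≥ 2`, eventually in `T`, `‖ψ(y, χ) + Σ_{|γ|≤T} m(ρ) y^ρ/ρ‖ ≤ C + 2 log y` (`⟨y⟩ > 0`; `|ψ − ψ₀| ≤ ½ log y`,
`½log(y−1) + ½log(y+1) ≤ log y + ½`). [cite: MontgomeryVaughan2007, Theorem 12.10 (12.6)–(12.8)] -/
theorem exists_eventually_norm_psiChar_add_le (hprim : χ.IsPrimitive) (hq : 1 < q) :
    ∃ C : ℝ, ∀ y : ℝ, 2 ≤ y → ∀ᶠ T : ℝ in atTop,
      ‖Sieve.chebyshevPsiChar χ y + charZeroSumTrunc χ y T‖ ≤ C + 2 * Real.log y := by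
  obtain ⟨K, hK⟩ := truncatedExplicitFormula_psiChar_holds 2 (by norm_num)
  refine ⟨‖explicitFormulaConst χ‖ + 2, fun y hy ↦ ?_⟩
  have hy0 : 0 < y := by linarith
  have hy1 : 1 ≤ y := by linarith
  have hq0 : (0 : ℝ) < q := by exact_mod_cast (zero_lt_one.trans hq)
  have hd := primePowDist_pos y
  have hlogy : 0 ≤ Real.log y := Real.log_nonneg hy1
  have h1 : Tendsto (fun T : ℝ ↦ Real.log y * (y / primePowDist y) * T⁻¹) atTop (𝓝 0) := by
    simpa using tendsto_inv_atTop_zero.const_mul (Real.log y * (y / primePowDist y))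
  have h2 : Tendsto (fun T : ℝ ↦ 4 * y * (Real.log T ^ 2 / T)) atTop (𝓝 0) := by
    have := (Real.isLittleO_pow_log_id_atTop (n := 2)).tendsto_div_nhds_zero
    simpa using this.const_mul (4 * y)
  have hev : ∀ᶠ T : ℝ in atTop, max K 0 * (Real.log y * (y / primePowDist y) * T⁻¹ +
      4 * y * (Real.log T ^ 2 / T)) < 1 := by
    have := ((h1.add h2).const_mul (max K 0))
    rw [add_zero, mul_zero] at this
    exact this.eventually (gt_mem_nhds one_pos)
  filter_upwards [hev, eventually_ge_atTop (2 : ℝ), eventually_ge_atTop (q * y)] with T hT hT2 hTqy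
  have hT0 : 0 < T := by linarith
  have h := hK q hq χ hprim y hy T hT2
  have hyT : y ≤ T := le_trans (le_mul_of_one_le_left hy0.le (by exact_mod_cast hq.le)) hTqy
  -- `log(q y T)² ≤ 4 log² T` since `q y ≤ T`
  have hlogqyT : Real.log (q * y * T) ^ 2 ≤ 4 * Real.log T ^ 2 := by
    have hqyT : q * y * T ≤ T * T := mul_le_mul_of_nonneg_right hTqy hT0.le
    have hq1' : (1 : ℝ) ≤ q := by exact_mod_cast hq.le
    have h0 : 0 ≤ Real.log (q * y * T) :=
      Real.log_nonneg (one_le_mul_of_one_le_of_one_le (one_le_mul_of_one_le_of_one_le hq1' hy1) (by linarith))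
    have hle : Real.log (q * y * T) ≤ 2 * Real.log T := by
      rw [show 2 * Real.log T = Real.log (T * T) by rw [Real.log_mul hT0.ne' hT0.ne']; ring]
      exact Real.log_le_log (by positivity) hqyT
    nlinarith
  have hmaj : K * (Real.log y * min 1 (y / (T * primePowDist y)) + y / T * Real.log (q * y * T) ^ 2) ≤
      max K 0 * (Real.log y * (y / primePowDist y) * T⁻¹ + 4 * y * (Real.log T ^ 2 / T)) := by
    have hs0 : 0 ≤ Real.log y * min 1 (y / (T * primePowDist y)) + y / T * Real.log (q * y * T) ^ 2 :=
      add_nonneg (mul_nonneg hlogy (le_min zero_le_one (by positivity))) (by positivity)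
    calc K * (Real.log y * min 1 (y / (T * primePowDist y)) + y / T * Real.log (q * y * T) ^ 2)
        ≤ max K 0 * (Real.log y * min 1 (y / (T * primePowDist y)) + y / T * Real.log (q * y * T) ^ 2) :=
          mul_le_mul_of_nonneg_right (le_max_left _ _) hs0
      _ ≤ max K 0 * (Real.log y * (y / primePowDist y) * T⁻¹ + 4 * y * (Real.log T ^ 2 / T)) := by
          refine mul_le_mul_of_nonneg_left (add_le_add ?_ ?_) (le_max_right _ _)
          · rw [show Real.log y * (y / primePowDist y) * T⁻¹ = Real.log y * (y / (T * primePowDist y)) by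
              field_simp]
            exact mul_le_mul_of_nonneg_left (min_le_right _ _) hlogy
          · rw [show 4 * y * (Real.log T ^ 2 / T) = y / T * (4 * Real.log T ^ 2) by ring]
            exact mul_le_mul_of_nonneg_left hlogqyT (by positivity)
  have hnorm : ‖chebyshevPsiChar₀ χ y - (-charZeroSumTrunc χ y T - 1 / 2 * Real.log (y - 1) -
      χ (-1) / 2 * Real.log (y + 1) + explicitFormulaConst χ)‖ < 1 := (h.trans hmaj).trans_lt hT
  -- the elementary terms
  have hψ := norm_chebyshevPsiChar₀_sub_le (χ := χ) hy1
  have hl1 : ‖(1 / 2 : ℂ) * Real.log (y - 1)‖ ≤ Real.log y / 2 := by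
    rw [norm_mul, Complex.norm_real, Real.norm_eq_abs, abs_of_nonneg (Real.log_nonneg (by linarith))]
    have := Real.log_le_log (by linarith : 0 < y - 1) (by linarith : y - 1 ≤ y)
    norm_num
    linarith
  have hl2 : ‖χ (-1) / 2 * Real.log (y + 1)‖ ≤ (Real.log y + 1) / 2 := by
    rw [norm_mul, norm_div, Complex.norm_real, Real.norm_eq_abs, Complex.norm_two,
      abs_of_nonneg (Real.log_nonneg (by linarith))]
    have hχ1 : ‖χ (-1)‖ ≤ 1 := χ.norm_le_one _
    have hly : Real.log (y + 1) ≤ Real.log y + 1 := by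
      have : Real.log (y + 1) ≤ Real.log (2 * y) := Real.log_le_log (by linarith) (by linarith)
      rw [Real.log_mul (by norm_num) hy0.ne'] at this
      have h2 : Real.log 2 ≤ 1 := by
        have := Real.log_le_sub_one_of_pos (show (0:ℝ) < 2 by norm_num); linarith
      linarith
    have hl0 : 0 ≤ Real.log (y + 1) := Real.log_nonneg (by linarith)
    calc ‖χ (-1)‖ / 2 * Real.log (y + 1) ≤ 1 / 2 * (Real.log y + 1) :=
          mul_le_mul (by linarith) hly hl0 (by norm_num)
      _ = (Real.log y + 1) / 2 := by ring
  have heq : Sieve.chebyshevPsiChar χ y + charZeroSumTrunc χ y T =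
      (chebyshevPsiChar₀ χ y - (-charZeroSumTrunc χ y T - 1 / 2 * Real.log (y - 1) -
        χ (-1) / 2 * Real.log (y + 1) + explicitFormulaConst χ))
      - (chebyshevPsiChar₀ χ y - Sieve.chebyshevPsiChar χ y)
      - (1 / 2 : ℂ) * Real.log (y - 1) - χ (-1) / 2 * Real.log (y + 1) + explicitFormulaConst χ := by ring
  rw [heq]
  calc ‖(chebyshevPsiChar₀ χ y - (-charZeroSumTrunc χ y T - 1 / 2 * Real.log (y - 1) -
        χ (-1) / 2 * Real.log (y + 1) + explicitFormulaConst χ))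
      - (chebyshevPsiChar₀ χ y - Sieve.chebyshevPsiChar χ y)
      - (1 / 2 : ℂ) * Real.log (y - 1) - χ (-1) / 2 * Real.log (y + 1) + explicitFormulaConst χ‖
      ≤ ‖chebyshevPsiChar₀ χ y - (-charZeroSumTrunc χ y T - 1 / 2 * Real.log (y - 1) -
          χ (-1) / 2 * Real.log (y + 1) + explicitFormulaConst χ)‖
        + ‖chebyshevPsiChar₀ χ y - Sieve.chebyshevPsiChar χ y‖
        + ‖(1 / 2 : ℂ) * Real.log (y - 1)‖ + ‖χ (-1) / 2 * Real.log (y + 1)‖ + ‖explicitFormulaConst χ‖ := by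
        refine (norm_add_le _ _).trans (add_le_add ((norm_sub_le _ _).trans (add_le_add
          ((norm_sub_le _ _).trans (add_le_add (norm_sub_le _ _) le_rfl)) le_rfl)) le_rfl)
    _ ≤ 1 + Real.log y / 2 + Real.log y / 2 + (Real.log y + 1) / 2 + ‖explicitFormulaConst χ‖ := by
        gcongr
    _ ≤ ‖explicitFormulaConst χ‖ + 2 + 2 * Real.log y := by linarith

/-! ## §6 The truncated zero sums of `χ`, of `χ*`, and of `ζ` -/

/-- The order of `L(s, χ)` equals that of `L(s, χ*)` at every `s` with `Re s > 0` (`χ ≠ χ₀`; the Euler factors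
`1 − χ*(p)p^{-s}` are analytic and non-zero there). The tree's `SuzukiThm8Limits.zeroOrder_eq_primitiveCharacter`
is the case `s = ½`; same proof. [cite: DavenportMNT1980, ch. 5 (2)–(3)] -/
theorem zeroOrder_eq_primitiveCharacter_of_re_pos (χ : DirichletCharacter ℂ q) (hχ : χ ≠ 1) {s : ℂ}
    (hs : 0 < s.re) :
    haveI : NeZero χ.conductor := ⟨χ.conductor_ne_zero⟩
    DirichletDisc.zeroOrder χ s = DirichletDisc.zeroOrder χ.primitiveCharacter s := by
  haveI : NeZero χ.conductor := ⟨χ.conductor_ne_zero⟩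
  set ψ := χ.primitiveCharacter with hψ
  have hψ1 : ψ ≠ 1 := by
    intro h
    apply hχ
    rw [← DirichletCharacter.changeLevel_primitiveCharacter χ, ← hψ, h, map_one]
  set E : ℂ → ℂ := fun s ↦ ∏ p ∈ q.primeFactors, (1 - ψ p * (p : ℂ) ^ (-s)) with hE
  have hfun : χ.LFunction = fun s ↦ ψ.LFunction s * E s := by
    funext s
    have key := DirichletCharacter.LFunction_changeLevel χ.conductor_dvd_level ψ (s := s) (Or.inl hψ1)
    rw [hψ, DirichletCharacter.changeLevel_primitiveCharacter] at key
    rw [key]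
  have hdfac : ∀ s : ℂ, ∀ p ∈ q.primeFactors, DifferentiableAt ℂ (fun s : ℂ ↦ 1 - ψ p * (p : ℂ) ^ (-s)) s := by
    intro s p hp
    have hp0 : (p : ℂ) ≠ 0 := by exact_mod_cast (Nat.prime_of_mem_primeFactors hp).ne_zero
    exact ((differentiableAt_id.neg.const_cpow (Or.inl hp0)).const_mul _).const_sub _
  have hEd : Differentiable ℂ E := fun s ↦ by
    rw [hE]
    exact DifferentiableAt.fun_finsetProd (hdfac s)
  have hEan : AnalyticAt ℂ E s := hEd.analyticAt _
  have hE0 : E s ≠ 0 := by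
    rw [hE]
    exact Finset.prod_ne_zero_iff.2 fun p hp ↦
      DirichletCharacter.one_sub_mul_prime_cpow_ne_zero ψ (Nat.prime_of_mem_primeFactors hp) hs
  have hψan : AnalyticAt ℂ ψ.LFunction s :=
    (DirichletCharacter.differentiable_LFunction hψ1).analyticAt _
  have hord : analyticOrderAt χ.LFunction s = analyticOrderAt ψ.LFunction s := by
    rw [hfun, show (fun s ↦ ψ.LFunction s * E s) = ψ.LFunction * E from rfl,
      analyticOrderAt_mul hψan hEan, hEan.analyticOrderAt_eq_zero.2 hE0, add_zero]
  rw [DirichletDisc.zeroOrder, DirichletDisc.zeroOrder, analyticOrderNatAt, analyticOrderNatAt, hord]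

/-- **`Σ_{|γ|≤T} m(ρ) x^ρ/ρ` is the same for `χ` and for `χ*`** (`χ ≠ χ₀`): the zeros of `L(s, χ)` and `L(s, χ*)` in the open
strip and their multiplicities agree (`DirichletCharacter.LFunction_eq_zero_iff_primitiveCharacter`,
`zeroOrder_eq_primitiveCharacter_of_re_pos`). [cite: DavenportMNT1980, ch. 5 (2)–(3) and ch. 19] -/
theorem charZeroSumTrunc_eq_primitiveCharacter (χ : DirichletCharacter ℂ q) (hχ : χ ≠ 1) (x T : ℝ) :
    haveI : NeZero χ.conductor := ⟨χ.conductor_ne_zero⟩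
    charZeroSumTrunc χ x T = charZeroSumTrunc χ.primitiveCharacter x T := by
  haveI : NeZero χ.conductor := ⟨χ.conductor_ne_zero⟩
  set ψ := χ.primitiveCharacter with hψ
  have hψ1 : ψ ≠ 1 := by
    intro h
    apply hχ
    rw [← DirichletCharacter.changeLevel_primitiveCharacter χ, ← hψ, h, map_one]
  have hset : lfunctionZeroBox χ T = lfunctionZeroBox ψ T := by
    ext ρ
    simp only [mem_lfunctionZeroBox]
    constructor
    · rintro ⟨h0, h1, h2, h3⟩
      have hρ1 : ρ ≠ 1 := fun h ↦ by rw [h, Complex.one_re] at h2; exact lt_irrefl _ h2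
      exact ⟨(χ.LFunction_eq_zero_iff_primitiveCharacter h1 hρ1).1 h0, h1, h2, h3⟩
    · rintro ⟨h0, h1, h2, h3⟩
      have hρ1 : ρ ≠ 1 := fun h ↦ by rw [h, Complex.one_re] at h2; exact lt_irrefl _ h2
      exact ⟨(χ.LFunction_eq_zero_iff_primitiveCharacter h1 hρ1).2 h0, h1, h2, h3⟩
  rw [charZeroSumTrunc_eq hχ, charZeroSumTrunc_eq hψ1]
  have hfin : (lfunctionZeroBox_finite hχ T).toFinset = (lfunctionZeroBox_finite hψ1 T).toFinset := by
    ext ρ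
    rw [Set.Finite.mem_toFinset, Set.Finite.mem_toFinset, hset]
  rw [hfin]
  refine Finset.sum_congr rfl fun ρ hρ ↦ ?_
  obtain ⟨-, h1, -, -⟩ := (Set.Finite.mem_toFinset _).1 hρ
  rw [zeroOrder_eq_primitiveCharacter_of_re_pos χ hχ h1]

/-- `1 − p^{-s} ≠ 0` for a prime `p` and `Re s > 0`. [folklore] -/
private theorem one_sub_prime_cpow_ne_zero {p : ℕ} (hp : p.Prime) {s : ℂ} (hs : 0 < s.re) :
    1 - (p : ℂ) ^ (-s) ≠ 0 := by
  have hlt : ‖(p : ℂ) ^ (-s)‖ < 1 := by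
    rw [Complex.norm_natCast_cpow_of_pos hp.pos, neg_re]
    exact Real.rpow_lt_one_of_one_lt_of_neg (by exact_mod_cast hp.one_lt) (by linarith)
  intro h
  rw [(sub_eq_zero.1 h).symm, norm_one] at hlt
  exact lt_irrefl _ hlt

/-- **For the principal character, `Σ_{|γ|≤T} m(ρ) x^ρ/ρ` is the zeta sum** `zetaZeroSumTrunc x T`: in the open strip
`L(s, χ₀) = ζ(s)Π_{p∣q}(1 − p^{-s})` (Mathlib `LFunctionTrivChar_eq_mul_riemannZeta`), the Euler factors do not vanish,
the zeros of `ζ` there have `Im ρ ≠ 0`, and the multiplicities agree. [cite: MontgomeryVaughan2007, §10.1 (10.20), Cor. 10.8] -/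
theorem charZeroSumTrunc_one (x T : ℝ) :
    charZeroSumTrunc (1 : DirichletCharacter ℂ q) x T = zetaZeroSumTrunc x T := by
  classical
  set E : ℂ → ℂ := fun s ↦ ∏ p ∈ q.primeFactors, (1 - (p : ℂ) ^ (-s)) with hE
  have hL : ∀ s : ℂ, s ≠ 1 → (1 : DirichletCharacter ℂ q).LFunction s = riemannZeta s * E s := by
    intro s hs
    have := DirichletCharacter.LFunctionTrivChar_eq_mul_riemannZeta (N := q) hs
    rw [DirichletCharacter.LFunctionTrivChar] at this
    rw [this, hE, mul_comm]
  have hE0 : ∀ s : ℂ, 0 < s.re → E s ≠ 0 := fun s hs ↦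
    Finset.prod_ne_zero_iff.2 fun p hp ↦ one_sub_prime_cpow_ne_zero (Nat.prime_of_mem_primeFactors hp) hs
  have hEd : Differentiable ℂ E := fun s ↦ by
    rw [hE]
    refine DifferentiableAt.fun_finsetProd fun p hp ↦ ?_
    have hp0 : (p : ℂ) ≠ 0 := by exact_mod_cast (Nat.prime_of_mem_primeFactors hp).ne_zero
    exact (differentiableAt_id.neg.const_cpow (Or.inl hp0)).const_sub _
  -- the two index sets coincide
  have hset : lfunctionZeroBox (1 : DirichletCharacter ℂ q) T = weilZeroIndex T := by
    ext ρ
    simp only [mem_lfunctionZeroBox, weilZeroIndex, Set.mem_setOf_eq]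
    constructor
    · rintro ⟨h0, h1, h2, h3⟩
      have hρ1 : ρ ≠ 1 := fun h ↦ by rw [h, Complex.one_re] at h2; exact lt_irrefl _ h2
      have hζ : riemannZeta ρ = 0 := by
        rw [hL ρ hρ1, mul_eq_zero] at h0
        exact h0.resolve_right (hE0 ρ h1)
      refine ⟨hζ, h1.le, h2.le, fun him ↦ ?_, h3⟩
      have hρ : ρ = ((ρ.re : ℝ) : ℂ) := Complex.ext (by simp) (by simp [him])
      rw [hρ] at hζ
      exact riemannZeta_ofReal_ne_zero_of_pos_of_lt_one ρ.re h1 h2 hζ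
    · rintro ⟨h0, h1, h2, h3, h4⟩
      have hntz : ρ ∈ ZetaZeros.riemannZetaNontrivialZeros := by
        refine ⟨h0, ?_⟩
        rintro ⟨n, hn⟩
        apply h3
        rw [← hn]
        simp
      obtain ⟨-, hre0, hre1⟩ := mem_riemannZetaNontrivialZeros_iff_holds.1 hntz
      have hρ1 : ρ ≠ 1 := fun h ↦ by rw [h, Complex.one_re] at hre1; exact lt_irrefl _ hre1
      refine ⟨?_, hre0, hre1, h4⟩
      rw [hL ρ hρ1, h0, zero_mul]
  have hfin : (lfunctionZeroBox (1 : DirichletCharacter ℂ q) T).Finite := hset ▸ weilZeroIndex_finite T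
  rw [charZeroSumTrunc, dif_pos hfin, zetaZeroSumTrunc]
  have hfs : hfin.toFinset = (weilZeroIndex_finite T).toFinset := by
    ext ρ
    rw [Set.Finite.mem_toFinset, Set.Finite.mem_toFinset, hset]
  rw [hfs]
  refine Finset.sum_congr rfl fun ρ hρ ↦ ?_
  obtain ⟨h0, -, -, h3, -⟩ := (Set.Finite.mem_toFinset _).1 hρ
  have hntz : ρ ∈ ZetaZeros.riemannZetaNontrivialZeros := by
    refine ⟨h0, ?_⟩
    rintro ⟨n, hn⟩
    apply h3
    rw [← hn]
    simp
  obtain ⟨-, hre0, hre1⟩ := mem_riemannZetaNontrivialZeros_iff_holds.1 hntz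
  have hρ1 : ρ ≠ 1 := fun h ↦ by rw [h, Complex.one_re] at hre1; exact lt_irrefl _ hre1
  -- multiplicities: `m_{L(·,χ₀)}(ρ) = m_ζ(ρ)`
  congr 1
  have hζan : AnalyticAt ℂ riemannZeta ρ := analyticOn_riemannZeta ρ hρ1
  have hEan : AnalyticAt ℂ E ρ := (hEd.analyticAt _)
  have hev : (1 : DirichletCharacter ℂ q).LFunction =ᶠ[𝓝 ρ] fun s ↦ riemannZeta s * E s := by
    filter_upwards [isOpen_ne.eventually_mem hρ1] with s hs
    exact hL s hs
  have hordL : analyticOrderAt (1 : DirichletCharacter ℂ q).LFunction ρ = analyticOrderAt riemannZeta ρ := by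
    rw [analyticOrderAt_congr hev, show (fun s ↦ riemannZeta s * E s) = riemannZeta * E from rfl,
      analyticOrderAt_mul hζan hEan, hEan.analyticOrderAt_eq_zero.2 (hE0 ρ hre0), add_zero]
  -- `ζ` is not locally zero at `ρ`
  have hne : analyticOrderAt riemannZeta ρ ≠ ⊤ := by
    intro htop
    have h2 : riemannZeta 2 = 0 :=
      analyticOn_riemannZeta.eqOn_zero_of_preconnected_of_eventuallyEq_zero
        (isConnected_compl_singleton_of_one_lt_rank (by simp) (1 : ℂ)).isPreconnected hρ1
        (analyticOrderAt_eq_top.mp htop) (show (2 : ℂ) ∈ ({1}ᶜ : Set ℂ) by norm_num)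
    exact riemannZeta_ne_zero_of_one_le_re (s := 2) (by norm_num) h2
  obtain ⟨n, hn⟩ := ENat.ne_top_iff_exists.mp hne
  have hzo : riemannZetaZeroOrder ρ = (n : ℤ) := by
    rw [riemannZetaZeroOrder, hζan.meromorphicOrderAt_eq, ← hn, ENat.map_coe, WithTop.untop₀_coe]
  have hno : DirichletDisc.zeroOrder (1 : DirichletCharacter ℂ q) ρ = n := by
    rw [DirichletDisc.zeroOrder, analyticOrderNatAt, hordL, ← hn, ENat.toNat_coe]
  rw [hzo, hno]
  norm_cast

/-! ## §7 The prime powers not coprime to `q`: bounded corrections -/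

/-- `√(y^k) = (√y)^k` for `y ≥ 0`. [folklore] -/
private theorem sqrt_pow_eq {y : ℝ} (hy : 0 ≤ y) (k : ℕ) : Real.sqrt (y ^ k) = Real.sqrt y ^ k := by
  rw [show y ^ k = (Real.sqrt y ^ k) ^ 2 by rw [← pow_mul, mul_comm, pow_mul, Real.sq_sqrt hy],
    Real.sqrt_sq (pow_nonneg (Real.sqrt_nonneg _) _)]

/-- Equal prime powers have equal primes. [folklore] -/
private theorem prime_eq_of_pow_eq {p p' k k' : ℕ} (hp : p.Prime) (hp' : p'.Prime) (hk : k ≠ 0)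
    (h : p ^ k = p' ^ k') : p = p' := by
  have h1 : p ∣ p' ^ k' := h ▸ dvd_pow_self p hk
  exact (Nat.prime_dvd_prime_iff_eq hp hp').1 (hp.dvd_of_dvd_pow h1)

omit [NeZero q] in
/-- The prime powers `≤ X` not coprime to `q` are the `p^k`, `p ∣ q`, `1 ≤ k ≤ log_p X` (the tree's private lemma of
`ChebyshevHalfLineBiasImprimitiveRiesz`, repeated). [folklore] -/
private theorem filter_eq_biUnion (hq : q ≠ 0) (X : ℕ) :
    ((Finset.Icc 1 X).filter fun n ↦ ¬ n.Coprime q).filter IsPrimePow =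
      q.primeFactors.biUnion fun p ↦ (Finset.Icc 1 (Nat.log p X)).image fun k ↦ p ^ k := by
  ext n
  simp only [Finset.mem_filter, Finset.mem_Icc, Finset.mem_biUnion, Finset.mem_image, Nat.mem_primeFactors]
  constructor
  · rintro ⟨⟨⟨hn1, hnX⟩, hcop⟩, hpp⟩
    obtain ⟨p, k, hp, hk, rfl⟩ := (isPrimePow_nat_iff _).1 hpp
    have hpq : p ∣ q := by
      by_contra h
      exact hcop (Nat.Coprime.pow_left k (hp.coprime_iff_not_dvd.2 h))
    exact ⟨p, ⟨hp, hpq, hq⟩, k, ⟨hk, Nat.le_log_of_pow_le hp.one_lt hnX⟩, rfl⟩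
  · rintro ⟨p, ⟨hp, hpq, -⟩, k, ⟨hk1, hkK⟩, rfl⟩
    have hX : X ≠ 0 := by
      rintro rfl
      rw [Nat.log_zero_right] at hkK
      omega
    have hk0 : k ≠ 0 := by omega
    refine ⟨⟨⟨Nat.one_le_pow _ _ hp.pos, Nat.pow_le_of_le_log hX hkK⟩, fun hcop ↦ ?_⟩, hp.isPrimePow.pow hk0⟩
    exact (hp.coprime_iff_not_dvd.1 (Nat.Coprime.coprime_dvd_left (dvd_pow_self p hk0) hcop)) hpq

/-- **The unweighted correction reindexed**: for `x ≥ 0`,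
`Σ_{n ≤ x, (n,q) > 1} Λ(n)ψ(n) n^{-1/2} = Σ_{p ∣ q} Σ_{1 ≤ k ≤ log_p ⌊x⌋} log p · r_p^k` (`r_p = ψ(p)/√p`).
[cite: DavenportMNT1980, ch. 5 (2)–(3)] -/
theorem sum_not_coprime_unweighted_eq {N : ℕ} (ψ : DirichletCharacter ℂ N) (x : ℝ) :
    ∑ n ∈ (Finset.Icc 1 ⌊x⌋₊).filter (fun n ↦ ¬ n.Coprime q), (Λ n : ℂ) * ψ n / (Real.sqrt n : ℂ) =
      ∑ p ∈ q.primeFactors, ∑ k ∈ Finset.Icc 1 (Nat.log p ⌊x⌋₊), (Real.log p : ℂ) * eulerRatio ψ p ^ k := by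
  have hq : q ≠ 0 := NeZero.ne q
  set g : ℕ → ℂ := fun n ↦ (Λ n : ℂ) * ψ n / (Real.sqrt n : ℂ) with hg
  have h1 : ∑ n ∈ ((Finset.Icc 1 ⌊x⌋₊).filter fun n ↦ ¬ n.Coprime q).filter IsPrimePow, g n =
      ∑ n ∈ (Finset.Icc 1 ⌊x⌋₊).filter (fun n ↦ ¬ n.Coprime q), g n := by
    refine Finset.sum_filter_of_ne fun n _ hne ↦ ?_
    by_contra h
    apply hne
    rw [hg]
    simp only [vonMangoldt_eq_zero_iff.2 h, Complex.ofReal_zero, zero_mul, zero_div]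
  rw [← h1, filter_eq_biUnion hq, Finset.sum_biUnion]
  · refine Finset.sum_congr rfl fun p hp ↦ ?_
    have hpr := Nat.prime_of_mem_primeFactors hp
    rw [Finset.sum_image fun k _ k' _ h ↦ Nat.pow_right_injective hpr.two_le h]
    refine Finset.sum_congr rfl fun k hk ↦ ?_
    rw [Finset.mem_Icc] at hk
    have hp0 : (0 : ℝ) < p := by exact_mod_cast hpr.pos
    rw [hg]
    simp only
    rw [vonMangoldt_apply_pow (by omega), vonMangoldt_apply_prime hpr, Nat.cast_pow, Nat.cast_pow,
      map_pow, sqrt_pow_eq hp0.le, eulerRatio, div_pow, Complex.ofReal_pow]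
    ring
  · intro p hp p' hp' hne
    simp only [Function.onFun]
    rw [Finset.disjoint_left]
    intro n hn hn'
    rw [Finset.mem_image] at hn hn'
    obtain ⟨k, hk, rfl⟩ := hn
    obtain ⟨k', -, h⟩ := hn'
    rw [Finset.mem_Icc] at hk
    have hpr : (p : ℕ).Prime := Nat.prime_of_mem_primeFactors (Finset.mem_coe.1 hp)
    have hpr' : (p' : ℕ).Prime := Nat.prime_of_mem_primeFactors (Finset.mem_coe.1 hp')
    exact hne (prime_eq_of_pow_eq hpr hpr' (by omega) h.symm)

/-- **The unweighted correction is bounded**: `‖Σ_{n ≤ x, (n,q) > 1} Λ(n)ψ(n) n^{-1/2}‖ ≤ 3 Σ_{p ∣ q} log p`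
(`‖r_p‖ ≤ 1/√2 ≤ 3/4`, `Σ_{k ≥ 1}(3/4)^k = 3`). [folklore] -/
private theorem norm_sum_not_coprime_unweighted_le {N : ℕ} (ψ : DirichletCharacter ℂ N) (x : ℝ) :
    ‖∑ n ∈ (Finset.Icc 1 ⌊x⌋₊).filter (fun n ↦ ¬ n.Coprime q), (Λ n : ℂ) * ψ n / (Real.sqrt n : ℂ)‖ ≤
      3 * ∑ p ∈ q.primeFactors, Real.log p := by
  rw [sum_not_coprime_unweighted_eq, Finset.mul_sum]
  refine (norm_sum_le _ _).trans (Finset.sum_le_sum fun p hp ↦ ?_)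
  have hpr := Nat.prime_of_mem_primeFactors hp
  have hlp : 0 ≤ Real.log p := Real.log_natCast_nonneg p
  have hsp : 0 < Real.sqrt p := Real.sqrt_pos.2 (by exact_mod_cast hpr.pos)
  have hr : ‖eulerRatio ψ p‖ ≤ 3 / 4 := by
    rw [eulerRatio, norm_div, Complex.norm_real, Real.norm_eq_abs, abs_of_pos hsp]
    have h43 : (4 / 3 : ℝ) ≤ Real.sqrt p := by
      rw [Real.le_sqrt (by norm_num) (Nat.cast_nonneg _)]
      have h2 : (2 : ℝ) ≤ p := by exact_mod_cast hpr.two_le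
      nlinarith
    calc ‖ψ p‖ / Real.sqrt p ≤ 1 / Real.sqrt p := by gcongr; exact ψ.norm_le_one _
      _ ≤ 1 / (4 / 3) := by gcongr
      _ = 3 / 4 := by norm_num
  refine (norm_sum_le _ _).trans ?_
  calc ∑ k ∈ Finset.Icc 1 (Nat.log p ⌊x⌋₊), ‖(Real.log p : ℂ) * eulerRatio ψ p ^ k‖
      ≤ ∑ k ∈ Finset.Icc 1 (Nat.log p ⌊x⌋₊), Real.log p * (3 / 4 : ℝ) ^ k := by
        refine Finset.sum_le_sum fun k _ ↦ ?_
        rw [norm_mul, Complex.norm_real, Real.norm_eq_abs, abs_of_nonneg hlp, norm_pow]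
        exact mul_le_mul_of_nonneg_left (pow_le_pow_left₀ (norm_nonneg _) hr k) hlp
    _ = Real.log p * ∑ k ∈ Finset.Ico 1 (Nat.log p ⌊x⌋₊ + 1), (3 / 4 : ℝ) ^ k := by
        rw [← Finset.mul_sum]
        rfl
    _ ≤ Real.log p * 3 := by
        refine mul_le_mul_of_nonneg_left ?_ hlp
        refine (geom_sum_Ico_le_of_lt_one (by norm_num) (by norm_num)).trans ?_
        norm_num
    _ = 3 * Real.log p := mul_comm _ _

omit [NeZero q] in
/-- At `n` coprime to `q`, `χ(n) = χ*(n)`; otherwise `χ(n) = 0` (the tree's private lemma of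
`ChebyshevHalfLineBiasImprimitiveRiesz`, repeated). [folklore] -/
private theorem map_natCast_eq (χ : DirichletCharacter ℂ q) (n : ℕ) :
    χ (n : ZMod q) = if n.Coprime q then χ.primitiveCharacter (n : ZMod χ.conductor) else 0 := by
  by_cases hn : n.Coprime q
  · rw [if_pos hn]
    obtain ⟨u, hu⟩ := (ZMod.isUnit_iff_coprime n q).2 hn
    conv_lhs => rw [← DirichletCharacter.changeLevel_primitiveCharacter χ, ← hu]
    rw [DirichletCharacter.changeLevel_eq_cast_of_dvd, hu, ZMod.cast_natCast χ.conductor_dvd_level]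
  · rw [if_neg hn]
    exact MulChar.map_nonunit _ ((ZMod.isUnit_iff_coprime n q).not.2 hn)

omit [NeZero q] in
/-- **`Π_χ(y) = Π_{χ*}(y) − Σ_{n ≤ y, (n,q) > 1} Λ(n)χ*(n) n^{-1/2}`**. [cite: DavenportMNT1980, ch. 5 (2)–(3)] -/
theorem primeCountChar_eq_sub (χ : DirichletCharacter ℂ q) (y : ℝ) :
    ∑ n ∈ Finset.Icc 1 ⌊y⌋₊, (Λ n : ℂ) * χ n / (Real.sqrt n : ℂ) =
      (∑ n ∈ Finset.Icc 1 ⌊y⌋₊, (Λ n : ℂ) * χ.primitiveCharacter n / (Real.sqrt n : ℂ)) -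
        ∑ n ∈ (Finset.Icc 1 ⌊y⌋₊).filter (fun n ↦ ¬ n.Coprime q),
          (Λ n : ℂ) * χ.primitiveCharacter n / (Real.sqrt n : ℂ) := by
  rw [eq_sub_iff_add_eq]
  conv_rhs => rw [← Finset.sum_filter_add_sum_filter_not (Finset.Icc 1 ⌊y⌋₊) (fun n ↦ n.Coprime q)]
  congr 1
  rw [Finset.sum_filter]
  refine Finset.sum_congr rfl fun n _ ↦ ?_
  rw [map_natCast_eq χ n]
  split_ifs with h
  · rfl
  · simp


/-! ## §8 The per-character brackets and the two key estimates -/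

/-- **Non-principal characters**: for `χ ≠ χ₀` mod `q` under the GRH for `L(s, χ)` there are `c` (`= (L'/L)(½, χ)` when
`L(½, χ) ≠ 0`) and `B` with, for `y > 1`,
`‖[f_χ(y) − 2Π_χ(y)] + c log y + m_χ(log²y/2 − 2 log y) + 2ψ(y, χ*)/√y‖ ≤ B`
(`f_χ = f_{χ*} − Σ_{p∣q}(…)`, `Π_χ = Π_{χ*} − O(1)`, `Π_{χ*} − ψ(·,χ*)/√y = −m log y + O(1)`, `m_χ = m_{χ*}`).
GRH-CONDITIONAL. [cite: Suzuki2025Chebyshev, §5.1 (5.7)–(5.9)] -/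
theorem exists_bracket_of_ne_one (χ : DirichletCharacter ℂ q) (hχ : χ ≠ 1) (hGRH : χ.RiemannHypothesis) :
    ∃ c : ℂ, (χ.LFunction (1 / 2) ≠ 0 → c = logDeriv χ.LFunction (1 / 2)) ∧ ∃ B : ℝ, ∀ y : ℝ, 1 < y →
      ‖(halfLineSum χ y - 2 * ∑ n ∈ Finset.Icc 1 ⌊y⌋₊, (Λ n : ℂ) * χ n / (Real.sqrt n : ℂ))
        + (Real.log y : ℂ) * c
        + (DirichletDisc.zeroOrder χ (1 / 2) : ℂ) * (((Real.log y) ^ 2 / 2 - 2 * Real.log y : ℝ) : ℂ)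
        + 2 * (Sieve.chebyshevPsiChar χ.primitiveCharacter y / (Real.sqrt y : ℂ))‖ ≤ B := by
  haveI : NeZero χ.conductor := ⟨χ.conductor_ne_zero⟩
  have hN1 : 1 < χ.conductor := by
    have h1 : χ.conductor ≠ 1 := fun h ↦ hχ (DirichletCharacter.eq_one_iff_conductor_eq_one.2 h)
    have h0 : χ.conductor ≠ 0 := χ.conductor_ne_zero
    omega
  set ψ := χ.primitiveCharacter with hψdef
  have hprim : ψ.IsPrimitive := DirichletCharacter.primitiveCharacter_isPrimitive χ
  have hψGRH : ψ.RiemannHypothesis :=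
    (DirichletCharacter.riemannHypothesis_iff_primitiveCharacter_holds χ).1 hGRH
  obtain ⟨c₀, hc₁, hc₂, -⟩ := exists_norm_charFordK_half_le hprim hN1 hψGRH
  obtain ⟨B₁, hB₁⟩ := exists_norm_halfLineSum_add_le_of_GRH'' hprim hN1 hψGRH hc₁ hc₂
  obtain ⟨C₁, hC₁⟩ := exists_norm_primeCountChar_sub_le hprim hN1 hψGRH
  have hm : DirichletDisc.zeroOrder χ (1 / 2) = DirichletDisc.zeroOrder ψ (1 / 2) :=
    SuzukiThm8Limits.zeroOrder_eq_primitiveCharacter χ hχ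
  set κ : ℂ := ∑ p ∈ q.primeFactors, (Real.log p : ℂ) * eulerRatio ψ p / (1 - eulerRatio ψ p) with hκ
  set CP : ℝ := ∑ p ∈ q.primeFactors, (8 * Real.log p + 12 * Real.log p ^ 2) with hCP
  set CL : ℝ := ∑ p ∈ q.primeFactors, Real.log p with hCL
  refine ⟨c₀ + κ, fun hhalf ↦ ?_, B₁ + CP + 2 * C₁ + 2 * (3 * CL), fun y hy ↦ ?_⟩
  · -- `c = (L'/L)(½, χ)` when `L(½, χ) ≠ 0`
    have hψhalf : ψ.LFunction (1 / 2) ≠ 0 := fun h0 ↦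
      hhalf ((χ.LFunction_eq_zero_iff_primitiveCharacter (by norm_num) (by norm_num)).2 h0)
    rw [hc₁ hψhalf, logDeriv_LFunction_eq χ hχ hψhalf]
  have hy0 : 0 < y := by linarith
  have hy1 : 1 ≤ y := hy.le
  -- the weighted correction
  have hf : halfLineSum χ y = halfLineSum ψ y -
      ∑ p ∈ q.primeFactors, ∑ k ∈ Finset.Icc 1 (Nat.log p ⌊y⌋₊),
        (Real.log p : ℂ) * eulerRatio ψ p ^ k * ((Real.log y - k * Real.log p : ℝ) : ℂ) := by
    rw [halfLineSum_eq_sub χ y, sum_not_coprime_eq ψ hy0]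
  have hcorr_f : ‖(∑ p ∈ q.primeFactors, ∑ k ∈ Finset.Icc 1 (Nat.log p ⌊y⌋₊),
        (Real.log p : ℂ) * eulerRatio ψ p ^ k * ((Real.log y - k * Real.log p : ℝ) : ℂ))
        - (Real.log y : ℂ) * κ‖ ≤ CP := by
    rw [hκ, Finset.mul_sum, ← Finset.sum_sub_distrib, hCP]
    refine (norm_sum_le _ _).trans (Finset.sum_le_sum fun p hp ↦ ?_)
    exact norm_inner_sub_le ψ (Nat.prime_of_mem_primeFactors hp) hy1
  -- the unweighted correction
  have hP := primeCountChar_eq_sub χ y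
  have hcorr_P := norm_sum_not_coprime_unweighted_le (q := q) ψ y
  have h1 := hB₁ y hy
  have h2 := hC₁ y hy
  rw [hm]
  set m : ℂ := (DirichletDisc.zeroOrder ψ (1 / 2) : ℂ)
  set Pψ := ∑ n ∈ Finset.Icc 1 ⌊y⌋₊, (Λ n : ℂ) * ψ n / (Real.sqrt n : ℂ)
  set corrP := ∑ n ∈ (Finset.Icc 1 ⌊y⌋₊).filter (fun n ↦ ¬ n.Coprime q), (Λ n : ℂ) * ψ n / (Real.sqrt n : ℂ)
  set corrF := ∑ p ∈ q.primeFactors, ∑ k ∈ Finset.Icc 1 (Nat.log p ⌊y⌋₊),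
    (Real.log p : ℂ) * eulerRatio ψ p ^ k * ((Real.log y - k * Real.log p : ℝ) : ℂ)
  have heq : (halfLineSum χ y - 2 * ∑ n ∈ Finset.Icc 1 ⌊y⌋₊, (Λ n : ℂ) * χ n / (Real.sqrt n : ℂ))
        + (Real.log y : ℂ) * (c₀ + κ)
        + m * (((Real.log y) ^ 2 / 2 - 2 * Real.log y : ℝ) : ℂ)
        + 2 * (Sieve.chebyshevPsiChar ψ y / (Real.sqrt y : ℂ)) =
      (halfLineSum ψ y + (Real.log y : ℂ) * c₀ + m * (((Real.log y) ^ 2 / 2 : ℝ) : ℂ))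
        - (corrF - (Real.log y : ℂ) * κ)
        - 2 * (Pψ - Sieve.chebyshevPsiChar ψ y / (Real.sqrt y : ℂ) + m * Real.log y)
        + 2 * corrP := by
    rw [hf, hP]
    push_cast
    ring
  rw [heq]
  have hn3 : ‖2 * (Pψ - Sieve.chebyshevPsiChar ψ y / (Real.sqrt y : ℂ) + m * Real.log y)‖ ≤ 2 * C₁ := by
    rw [norm_mul, Complex.norm_two]; exact mul_le_mul_of_nonneg_left h2 (by norm_num)
  have hn4 : ‖2 * corrP‖ ≤ 2 * (3 * CL) := by
    rw [norm_mul, Complex.norm_two]; exact mul_le_mul_of_nonneg_left hcorr_P (by norm_num)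
  calc ‖(halfLineSum ψ y + (Real.log y : ℂ) * c₀ + m * (((Real.log y) ^ 2 / 2 : ℝ) : ℂ))
        - (corrF - (Real.log y : ℂ) * κ)
        - 2 * (Pψ - Sieve.chebyshevPsiChar ψ y / (Real.sqrt y : ℂ) + m * Real.log y)
        + 2 * corrP‖
      ≤ ‖halfLineSum ψ y + (Real.log y : ℂ) * c₀ + m * (((Real.log y) ^ 2 / 2 : ℝ) : ℂ)‖
        + ‖corrF - (Real.log y : ℂ) * κ‖
        + ‖2 * (Pψ - Sieve.chebyshevPsiChar ψ y / (Real.sqrt y : ℂ) + m * Real.log y)‖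
        + ‖2 * corrP‖ := by
        refine (norm_add_le _ _).trans (add_le_add ((norm_sub_le _ _).trans (add_le_add
          (norm_sub_le _ _) le_rfl)) le_rfl)
    _ ≤ B₁ + CP + 2 * C₁ + 2 * (3 * CL) := add_le_add (add_le_add (add_le_add h1 hcorr_f) hn3) hn4

/-- GRH for the principal character mod `q` gives RH (the tree's private lemma, restated). [folklore] -/
private theorem riemannHypothesis_of_principal
    (h : (1 : DirichletCharacter ℂ q).RiemannHypothesis) : RiemannHypothesis := by
  refine riemannHypothesis_iff_strip_holds.2 fun s hs h0 h1 ↦ h s ?_ h0 h1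
  have hs1 : s ≠ 1 := fun h ↦ by rw [h, Complex.one_re] at h1; exact lt_irrefl _ h1
  have key := DirichletCharacter.LFunction_changeLevel (one_dvd q) (1 : DirichletCharacter ℂ 1) (s := s) (Or.inr hs1)
  rw [DirichletCharacter.changeLevel_one, DirichletCharacter.LFunction_modOne_eq, hs, zero_mul] at key
  exact key

/-- `L(½, χ₀) ≠ 0` for the principal character mod `q`: `L(s, χ₀) = ζ(s)Π_{p∣q}(1 − p^{-s})` and `ζ(½) = −1.46035… ≠ 0`.
[cite: Suzuki2025Chebyshev, §1.1 («where `−ζ(1/2) = 1.46035⋯`»); MontgomeryVaughan2007, §11.3 (the Euler factors of `L(s, χ₀)`)] -/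
theorem LFunction_one_half_ne_zero : (1 : DirichletCharacter ℂ q).LFunction (1 / 2) ≠ 0 := by
  have h1 : (1 / 2 : ℂ) ≠ 1 := by norm_num
  show DirichletCharacter.LFunctionTrivChar q (1 / 2) ≠ 0
  rw [DirichletCharacter.LFunctionTrivChar_eq_mul_riemannZeta h1]
  refine mul_ne_zero (Finset.prod_ne_zero_iff.2 fun p hp ↦
    one_sub_prime_cpow_ne_zero (Nat.prime_of_mem_primeFactors hp) (by norm_num)) ?_
  have := riemannZeta_ofReal_ne_zero_of_pos_of_lt_one (1 / 2) (by norm_num) (by norm_num)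
  push_cast at this
  exact this

/-- `m_{χ₀} = 0` (the tree's private `SuzukiThm6iv.zeroOrder_one_half`, re-proved: `L(½, χ₀) ≠ 0`).
[cite: Suzuki2025Chebyshev, §1.3, after Thm 6 («… then the right-hand sides of (1.28) and (1.29) vanish»), case `χ = χ₀`] -/
theorem zeroOrder_one_half_eq_zero : DirichletDisc.zeroOrder (1 : DirichletCharacter ℂ q) (1 / 2) = 0 := by
  have hd : ∀ᶠ z in 𝓝 (1 / 2 : ℂ), DifferentiableAt ℂ (1 : DirichletCharacter ℂ q).LFunction z := by
    filter_upwards [isOpen_ne.mem_nhds (show (1 / 2 : ℂ) ≠ 1 by norm_num)] with z hz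
    exact DirichletCharacter.differentiableAt_LFunction _ z (Or.inl hz)
  have han : AnalyticAt ℂ (1 : DirichletCharacter ℂ q).LFunction (1 / 2) :=
    Complex.analyticAt_iff_eventually_differentiableAt.2 hd
  rw [DirichletDisc.zeroOrder, analyticOrderNatAt, han.analyticOrderAt_eq_zero.2 LFunction_one_half_ne_zero]
  rfl

omit [NeZero q] in
/-- `Π_{χ₀}(y) = Π(y) − Σ_{n ≤ y, (n,q) > 1} Λ(n) n^{-1/2}` for the principal character (`χ₀(n) = [(n,q) = 1]`).
[folklore] -/
private theorem primeCountChar_one_eq (y : ℝ) :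
    ∑ n ∈ Finset.Icc 1 ⌊y⌋₊, (Λ n : ℂ) * (1 : DirichletCharacter ℂ q) n / (Real.sqrt n : ℂ) =
      ((∑ n ∈ Finset.Icc 1 ⌊y⌋₊, Λ n / Real.sqrt n : ℝ) : ℂ) -
        ∑ n ∈ (Finset.Icc 1 ⌊y⌋₊).filter (fun n ↦ ¬ n.Coprime q),
          (Λ n : ℂ) * (1 : DirichletCharacter ℂ 1) n / (Real.sqrt n : ℂ) := by
  have h1 : ∀ n : ℕ, (1 : DirichletCharacter ℂ q) n = if n.Coprime q then (1 : ℂ) else 0 := by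
    intro n
    by_cases h : n.Coprime q
    · rw [if_pos h]
      exact MulChar.one_apply ((ZMod.isUnit_iff_coprime n q).2 h)
    · rw [if_neg h]
      exact MulChar.map_nonunit _ ((ZMod.isUnit_iff_coprime n q).not.2 h)
  have h2 : ∀ n : ℕ, (1 : DirichletCharacter ℂ 1) n = 1 := fun n ↦ MulChar.one_apply (isUnit_of_subsingleton _)
  simp_rw [h1, h2]
  rw [eq_sub_iff_add_eq, Complex.ofReal_sum]
  conv_rhs => rw [← Finset.sum_filter_add_sum_filter_not (Finset.Icc 1 ⌊y⌋₊) (fun n ↦ n.Coprime q)]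
  congr 1
  · rw [Finset.sum_filter]
    refine Finset.sum_congr rfl fun n _ ↦ ?_
    split_ifs with h
    · push_cast; ring
    · simp
  · refine Finset.sum_congr rfl fun n _ ↦ ?_
    push_cast; ring

/-- **The principal character**: under the GRH for `L(s, χ₀)` (i.e. RH) there is `B` with, for `y > 1`,
`‖[f_{χ₀}(y) − 2Π_{χ₀}(y)] + (L'/L)(½, χ₀) log y + 2(ψ(y) − y)/√y‖ ≤ B`
(the tree's `ProgressionsRiesz.exists_norm_halfLineSum_one_le_of_RH` and
`ChebyshevHalfLineBiasThm2.exists_abs_primeCount_sub_le`: `Π(y) = ψ(y)/√y + √y + O(1)` under RH). RH-CONDITIONAL.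
[cite: Suzuki2025Chebyshev, §5.1 (5.7)–(5.9) (the case `χ = χ₀`, via (3.1))] -/
theorem exists_bracket_one (hGRH : (1 : DirichletCharacter ℂ q).RiemannHypothesis) :
    ∃ B : ℝ, ∀ y : ℝ, 1 < y →
      ‖(halfLineSum (1 : DirichletCharacter ℂ q) y -
          2 * ∑ n ∈ Finset.Icc 1 ⌊y⌋₊, (Λ n : ℂ) * (1 : DirichletCharacter ℂ q) n / (Real.sqrt n : ℂ))
        + (Real.log y : ℂ) * logDeriv (1 : DirichletCharacter ℂ q).LFunction (1 / 2)
        + 2 * (((Chebyshev.psi y - y : ℝ) : ℂ) / (Real.sqrt y : ℂ))‖ ≤ B := by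
  have hRH : RiemannHypothesis := riemannHypothesis_of_principal hGRH
  obtain ⟨B₁, hB₁⟩ := ProgressionsRiesz.exists_norm_halfLineSum_one_le_of_RH (q := q) hRH
  obtain ⟨K, hK⟩ := ChebyshevHalfLineBiasThm2.exists_abs_primeCount_sub_le hRH
  set CL : ℝ := ∑ p ∈ q.primeFactors, Real.log p with hCL
  refine ⟨B₁ + 2 * K + 2 * (3 * CL), fun y hy ↦ ?_⟩
  have hy0 : 0 < y := by linarith
  have hy1 : 1 ≤ y := hy.le
  have hsy : (Real.sqrt y : ℂ) ≠ 0 := by exact_mod_cast (Real.sqrt_pos.2 hy0).ne'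
  have hysq : (y : ℂ) / (Real.sqrt y : ℂ) = (Real.sqrt y : ℂ) := by
    rw [div_eq_iff hsy]
    exact_mod_cast (Real.mul_self_sqrt hy0.le).symm
  have h1 := hB₁ y hy
  have h2 := hK y hy1
  set corrP := ∑ n ∈ (Finset.Icc 1 ⌊y⌋₊).filter (fun n ↦ ¬ n.Coprime q),
    (Λ n : ℂ) * (1 : DirichletCharacter ℂ 1) n / (Real.sqrt n : ℂ)
  have hcorr : ‖corrP‖ ≤ 3 * CL := norm_sum_not_coprime_unweighted_le (q := q) (1 : DirichletCharacter ℂ 1) y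
  rw [primeCountChar_one_eq]
  set P : ℝ := ∑ n ∈ Finset.Icc 1 ⌊y⌋₊, Λ n / Real.sqrt n
  have heq : (halfLineSum (1 : DirichletCharacter ℂ q) y - 2 * ((P : ℂ) - corrP))
        + (Real.log y : ℂ) * logDeriv (1 : DirichletCharacter ℂ q).LFunction (1 / 2)
        + 2 * (((Chebyshev.psi y - y : ℝ) : ℂ) / (Real.sqrt y : ℂ)) =
      (halfLineSum (1 : DirichletCharacter ℂ q) y - 4 * Real.sqrt y
          + (Real.log y : ℂ) * logDeriv (1 : DirichletCharacter ℂ q).LFunction (1 / 2))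
        - 2 * (((P - Chebyshev.psi y / Real.sqrt y - Real.sqrt y : ℝ) : ℂ))
        + 2 * corrP := by
    push_cast
    rw [sub_div, hysq]
    ring
  rw [heq]
  have hn2 : ‖2 * (((P - Chebyshev.psi y / Real.sqrt y - Real.sqrt y : ℝ) : ℂ))‖ ≤ 2 * K := by
    rw [norm_mul, Complex.norm_two, Complex.norm_real, Real.norm_eq_abs]
    exact mul_le_mul_of_nonneg_left h2 (by norm_num)
  have hn3 : ‖2 * corrP‖ ≤ 2 * (3 * CL) := by
    rw [norm_mul, Complex.norm_two]; exact mul_le_mul_of_nonneg_left hcorr (by norm_num)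
  calc ‖(halfLineSum (1 : DirichletCharacter ℂ q) y - 4 * Real.sqrt y
          + (Real.log y : ℂ) * logDeriv (1 : DirichletCharacter ℂ q).LFunction (1 / 2))
        - 2 * (((P - Chebyshev.psi y / Real.sqrt y - Real.sqrt y : ℝ) : ℂ)) + 2 * corrP‖
      ≤ ‖halfLineSum (1 : DirichletCharacter ℂ q) y - 4 * Real.sqrt y
          + (Real.log y : ℂ) * logDeriv (1 : DirichletCharacter ℂ q).LFunction (1 / 2)‖
        + ‖2 * (((P - Chebyshev.psi y / Real.sqrt y - Real.sqrt y : ℝ) : ℂ))‖ + ‖2 * corrP‖ :=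
        (norm_add_le _ _).trans (add_le_add (norm_sub_le _ _) le_rfl)
    _ ≤ B₁ + 2 * K + 2 * (3 * CL) := add_le_add (add_le_add h1 hn2) hn3

/-- **Orthogonality for the cut-off sum**: with `y = xe²` (`x > 1`),
`φ(q) · log x · Σ_{n ≤ xe², n ≡ 1 (q)} Λ(n) n^{-1/2}(1 − log n/log x) = Σ_χ [f_χ(y) − 2Π_χ(y)]`
(the tree's `ChebyshevHalfLineBiasThm7.charHalfLineBiasSum_eq`; `log(x/n) = log(y/n) − 2`). [cite: Suzuki2025Chebyshev, §5.1 (5.1), (5.3)] -/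
theorem cutoff_orthogonality {x : ℝ} (hx : 1 < x) :
    (q.totient : ℂ) * (Real.log x : ℂ) *
        ((∑ n ∈ (Finset.Icc 1 ⌊x * Real.exp 2⌋₊).filter (fun n : ℕ ↦ (n : ZMod q) = 1),
          Λ n / Real.sqrt n * (1 - Real.log n / Real.log x) : ℝ) : ℂ) =
      ∑ χ : DirichletCharacter ℂ q, (halfLineSum χ (x * Real.exp 2) -
        2 * ∑ n ∈ Finset.Icc 1 ⌊x * Real.exp 2⌋₊, (Λ n : ℂ) * χ n / (Real.sqrt n : ℂ)) := by
  have hx0 : 0 < x := by linarith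
  have hlx : Real.log x ≠ 0 := (Real.log_pos hx).ne'
  set y := x * Real.exp 2 with hy
  have hy0 : 0 < y := by positivity
  have hlogy : Real.log y = Real.log x + 2 := by
    rw [hy, Real.log_mul hx0.ne' (Real.exp_pos 2).ne', Real.log_exp]
  have horth := ChebyshevHalfLineBiasThm7.charHalfLineBiasSum_eq q x y
  unfold charHalfLineBiasSum at horth
  -- left: per character, `Σ_n Λχ/√n·log(x/n) = f_χ(y) − 2Π_χ(y)`
  have hleft : ∀ χ : DirichletCharacter ℂ q,
      ∑ n ∈ Finset.Icc 1 ⌊y⌋₊, (Λ n : ℂ) * χ n / (Real.sqrt n : ℂ) * (Real.log (x / n) : ℂ) =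
        halfLineSum χ y - 2 * ∑ n ∈ Finset.Icc 1 ⌊y⌋₊, (Λ n : ℂ) * χ n / (Real.sqrt n : ℂ) := by
    intro χ
    rw [halfLineSum, Finset.mul_sum, ← Finset.sum_sub_distrib]
    refine Finset.sum_congr rfl fun n hn ↦ ?_
    have hn0 : (0 : ℝ) < n := by exact_mod_cast (Finset.mem_Icc.1 hn).1
    rw [Real.log_div hx0.ne' hn0.ne', Real.log_div hy0.ne' hn0.ne', hlogy]
    push_cast
    ring
  rw [Finset.sum_congr rfl fun χ _ ↦ (hleft χ).symm, horth, Complex.ofReal_sum, Finset.mul_sum,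
    Finset.sum_filter]
  refine Finset.sum_congr rfl fun n hn ↦ ?_
  have hn0 : (0 : ℝ) < n := by exact_mod_cast (Finset.mem_Icc.1 hn).1
  split_ifs with h
  · have hlog : Real.log (x / n) = Real.log x * (1 - Real.log n / Real.log x) := by
      rw [Real.log_div hx0.ne' hn0.ne', mul_sub, mul_one, mul_div_cancel₀ _ hlx]
    rw [hlog]
    push_cast
    ring
  · simp

/-- **KEY ESTIMATE 1 (GRH-CONDITIONAL)**: under the GRH for every `χ` mod `q` there are constants `c_χ` — with
`c_χ = (L'/L)(½, χ)` whenever `L(½, χ) ≠ 0` — and `B` such that for `x > 1`, `y = xe²`,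
`‖φ(q) log x · G(x) + log y · Σ_χ c_χ + (log²y/2 − 2 log y) Σ_χ m_χ + (2/√y) A(y)‖ ≤ B`, where `G(x)` is the typed
cut-off Riesz sum of (1.24)/(1.29) and `A(y) = (ψ(y) − y) + Σ_{χ ≠ χ₀} ψ(y, χ*)`.
[cite: Suzuki2025Chebyshev, §5.1 (5.9) and its order-`m` modification] -/
theorem exists_norm_cutoff_sub_le (hGRH : ∀ χ : DirichletCharacter ℂ q, χ.RiemannHypothesis) :
    ∃ c : DirichletCharacter ℂ q → ℂ, (∀ χ, χ.LFunction (1 / 2) ≠ 0 → c χ = logDeriv χ.LFunction (1 / 2)) ∧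
      ∃ B : ℝ, ∀ x : ℝ, 1 < x →
        ‖(q.totient : ℂ) * (Real.log x : ℂ) *
            ((∑ n ∈ (Finset.Icc 1 ⌊x * Real.exp 2⌋₊).filter (fun n : ℕ ↦ (n : ZMod q) = 1),
              Λ n / Real.sqrt n * (1 - Real.log n / Real.log x) : ℝ) : ℂ)
          + (Real.log (x * Real.exp 2) : ℂ) * ∑ χ : DirichletCharacter ℂ q, c χ
          + (((Real.log (x * Real.exp 2)) ^ 2 / 2 - 2 * Real.log (x * Real.exp 2) : ℝ) : ℂ) *
              ∑ χ : DirichletCharacter ℂ q, (DirichletDisc.zeroOrder χ (1 / 2) : ℂ)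
          + 2 / (Real.sqrt (x * Real.exp 2) : ℂ) * ∑ χ : DirichletCharacter ℂ q,
              (if χ = 1 then (((Chebyshev.psi (x * Real.exp 2) - x * Real.exp 2 : ℝ)) : ℂ)
                else Sieve.chebyshevPsiChar χ.primitiveCharacter (x * Real.exp 2))‖ ≤ B := by
  classical
  -- per-character data
  have hdata : ∀ χ : DirichletCharacter ℂ q, ∃ c : ℂ, (χ.LFunction (1 / 2) ≠ 0 → c = logDeriv χ.LFunction (1 / 2)) ∧
      ∃ B : ℝ, ∀ y : ℝ, 1 < y →
        ‖(halfLineSum χ y - 2 * ∑ n ∈ Finset.Icc 1 ⌊y⌋₊, (Λ n : ℂ) * χ n / (Real.sqrt n : ℂ))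
          + (Real.log y : ℂ) * c
          + (DirichletDisc.zeroOrder χ (1 / 2) : ℂ) * (((Real.log y) ^ 2 / 2 - 2 * Real.log y : ℝ) : ℂ)
          + 2 / (Real.sqrt y : ℂ) * (if χ = 1 then (((Chebyshev.psi y - y : ℝ)) : ℂ)
              else Sieve.chebyshevPsiChar χ.primitiveCharacter y)‖ ≤ B := by
    intro χ
    by_cases hχ : χ = 1
    · subst hχ
      obtain ⟨B, hB⟩ := exists_bracket_one (q := q) (hGRH 1)
      refine ⟨logDeriv (1 : DirichletCharacter ℂ q).LFunction (1 / 2), fun _ ↦ rfl, B, fun y hy ↦ ?_⟩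
      have := hB y hy
      rw [if_pos rfl, zeroOrder_one_half_eq_zero]
      simpa [div_mul_eq_mul_div, mul_div_assoc] using this
    · obtain ⟨c, hc, B, hB⟩ := exists_bracket_of_ne_one χ hχ (hGRH χ)
      refine ⟨c, hc, B, fun y hy ↦ ?_⟩
      have := hB y hy
      rw [if_neg hχ]
      simpa [div_mul_eq_mul_div, mul_div_assoc] using this
  choose c hc B hB using hdata
  refine ⟨c, hc, ∑ χ : DirichletCharacter ℂ q, B χ, fun x hx ↦ ?_⟩
  have hx0 : 0 < x := by linarith
  set y := x * Real.exp 2 with hy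
  have hy1 : 1 < y := by
    have : (1 : ℝ) < Real.exp 2 := Real.one_lt_exp_iff.2 (by norm_num)
    rw [hy]; nlinarith
  rw [cutoff_orthogonality hx, Finset.mul_sum, Finset.mul_sum, Finset.mul_sum, ← Finset.sum_add_distrib,
    ← Finset.sum_add_distrib, ← Finset.sum_add_distrib]
  refine (norm_sum_le _ _).trans (Finset.sum_le_sum fun χ _ ↦ ?_)
  have := hB χ y hy1
  refine le_trans (le_of_eq ?_) this
  congr 1
  ring

/-- **KEY ESTIMATE 2 (unconditional)**: there is `C` such that for every `y ≥ 2`, eventually in `T`,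
`‖A(y) + Σ_χ Σ_{|γ_χ|≤T} m(ρ) y^ρ/ρ‖ ≤ C(1 + log y)` (MV Thms 12.5/12.10 at the point `y`; the truncated zero sum of
`χ` is that of `χ*`, and that of `χ₀` is the zeta sum). [cite: MontgomeryVaughan2007, Theorems 12.5 and 12.10] -/
theorem exists_eventually_norm_A_add_le :
    ∃ C : ℝ, ∀ y : ℝ, 2 ≤ y → ∀ᶠ T : ℝ in atTop,
      ‖(∑ χ : DirichletCharacter ℂ q,
          (if χ = 1 then (((Chebyshev.psi y - y : ℝ)) : ℂ) else Sieve.chebyshevPsiChar χ.primitiveCharacter y))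
        + ∑ χ : DirichletCharacter ℂ q, charZeroSumTrunc χ y T‖ ≤ C * (1 + Real.log y) := by
  classical
  have hdata : ∀ χ : DirichletCharacter ℂ q, ∃ C : ℝ, 0 ≤ C ∧ ∀ y : ℝ, 2 ≤ y → ∀ᶠ T : ℝ in atTop,
      ‖(if χ = 1 then (((Chebyshev.psi y - y : ℝ)) : ℂ) else Sieve.chebyshevPsiChar χ.primitiveCharacter y)
        + charZeroSumTrunc χ y T‖ ≤ C + 2 * Real.log y := by
    intro χ
    by_cases hχ : χ = 1
    · subst hχ
      refine ⟨9, by norm_num, fun y hy ↦ ?_⟩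
      filter_upwards [ChebyshevHalfLineBiasThm2.eventually_abs_sub_re_zetaZeroSumTrunc_le hy] with T hT
      rw [if_pos rfl, charZeroSumTrunc_one]
      set Z := zetaZeroSumTrunc y T
      have hre : ((((Chebyshev.psi y - y : ℝ)) : ℂ) + Z).re = -(y - Chebyshev.psi y - Z.re) := by simp; ring
      have him : ((((Chebyshev.psi y - y : ℝ)) : ℂ) + Z).im = Z.im := by simp
      have h1 := Complex.norm_le_abs_re_add_abs_im ((((Chebyshev.psi y - y : ℝ)) : ℂ) + Z)
      rw [hre, him, abs_neg] at h1
      have hlog : 0 ≤ Real.log y := Real.log_nonneg (by linarith)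
      linarith [hT.1, hT.2]
    · haveI : NeZero χ.conductor := ⟨χ.conductor_ne_zero⟩
      have hN1 : 1 < χ.conductor := by
        have h1 : χ.conductor ≠ 1 := fun h ↦ hχ (DirichletCharacter.eq_one_iff_conductor_eq_one.2 h)
        have h0 : χ.conductor ≠ 0 := χ.conductor_ne_zero
        omega
      have hprim := DirichletCharacter.primitiveCharacter_isPrimitive χ
      obtain ⟨C, hC⟩ := exists_eventually_norm_psiChar_add_le hprim hN1
      refine ⟨max C 0, le_max_right _ _, fun y hy ↦ ?_⟩
      filter_upwards [hC y hy] with T hT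
      rw [if_neg hχ, charZeroSumTrunc_eq_primitiveCharacter χ hχ]
      exact hT.trans (by gcongr; exact le_max_left _ _)
  choose C hC0 hC using hdata
  refine ⟨∑ χ : DirichletCharacter ℂ q, (C χ + 2), fun y hy ↦ ?_⟩
  have hlog : 0 ≤ Real.log y := Real.log_nonneg (by linarith)
  have hev : ∀ᶠ T : ℝ in atTop, ∀ χ ∈ (Finset.univ : Finset (DirichletCharacter ℂ q)),
      ‖(if χ = 1 then (((Chebyshev.psi y - y : ℝ)) : ℂ) else Sieve.chebyshevPsiChar χ.primitiveCharacter y)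
        + charZeroSumTrunc χ y T‖ ≤ C χ + 2 * Real.log y :=
    (Filter.eventually_all_finset _).2 fun χ _ ↦ hC χ y hy
  filter_upwards [hev] with T hT
  rw [← Finset.sum_add_distrib]
  refine (norm_sum_le _ _).trans ?_
  rw [Finset.sum_mul]
  refine Finset.sum_le_sum fun χ hχ ↦ (hT χ hχ).trans ?_
  have := hC0 χ
  nlinarith


/-! ## §9 The cut-off Riesz sum forces GRH (the §5.1 continuation argument, sign-free, with the transform (5.6)) -/

section Landau

open DirichletCharacter

/-- `Z₀(s) = (s − 1)L(s, χ₀) · Π_{χ ≠ χ₀} L(s, χ)` is entire (the tree's private lemma, repeated). [folklore] -/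
private theorem differentiable_Z :
    Differentiable ℂ (fun s : ℂ ↦ LFunctionTrivChar₁ q s *
      ∏ χ ∈ Finset.univ.erase (1 : DirichletCharacter ℂ q), χ.LFunction s) :=
  (differentiable_LFunctionTrivChar₁ q).mul
    (Differentiable.fun_finsetProd fun _ hχ ↦ differentiable_LFunction (Finset.ne_of_mem_erase hχ))

/-- For `s ≠ 1`: if every `L(s, χ) ≠ 0` then `Z₀(s) ≠ 0`. [folklore] -/
private theorem Z_ne_zero_of_forall {s : ℂ} (hs : s ≠ 1)
    (h : ∀ χ : DirichletCharacter ℂ q, χ.LFunction s ≠ 0) :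
    LFunctionTrivChar₁ q s * ∏ χ ∈ Finset.univ.erase (1 : DirichletCharacter ℂ q), χ.LFunction s ≠ 0 := by
  refine mul_ne_zero ?_ (Finset.prod_ne_zero_iff.2 fun χ _ ↦ h χ)
  rw [LFunctionTrivChar₁, Function.update_of_ne hs]
  exact mul_ne_zero (sub_ne_zero.2 hs) (h 1)

/-- For `s ≠ 1`: `Z₀(s) ≠ 0` gives `L(s, χ) ≠ 0` for every `χ`. [folklore] -/
private theorem ne_zero_of_Z {s : ℂ} (hs : s ≠ 1)
    (h : LFunctionTrivChar₁ q s * ∏ χ ∈ Finset.univ.erase (1 : DirichletCharacter ℂ q), χ.LFunction s ≠ 0)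
    (χ : DirichletCharacter ℂ q) : χ.LFunction s ≠ 0 := by
  rcases eq_or_ne χ 1 with rfl | hχ
  · have h1 := left_ne_zero_of_mul h
    rw [LFunctionTrivChar₁, Function.update_of_ne hs] at h1
    exact right_ne_zero_of_mul h1
  · exact (Finset.prod_ne_zero_iff.1 (right_ne_zero_of_mul h)) χ (Finset.mem_erase.2 ⟨hχ, Finset.mem_univ _⟩)

/-- `Z₀ ≠ 0` on `Re s ≥ 1`. [folklore] -/
private theorem Z_ne_zero_of_one_le_re {s : ℂ} (hs : 1 ≤ s.re) :
    LFunctionTrivChar₁ q s * ∏ χ ∈ Finset.univ.erase (1 : DirichletCharacter ℂ q), χ.LFunction s ≠ 0 := by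
  rcases eq_or_ne s 1 with rfl | hs1
  · refine mul_ne_zero (LFunctionTrivChar₁_apply_one_ne_zero q) (Finset.prod_ne_zero_iff.2 fun χ hχ ↦ ?_)
    exact LFunction_ne_zero_of_one_le_re χ (Or.inl (Finset.ne_of_mem_erase hχ)) hs
  · exact Z_ne_zero_of_forall hs1 fun χ ↦ LFunction_ne_zero_of_one_le_re χ (Or.inr hs1) hs

/-- For `Re w > 1`: `(Z₀'/Z₀)(w) = 1/(w − 1) + Σ_χ (L'/L)(w, χ)` (the tree's private lemma, repeated). [folklore] -/
private theorem logDeriv_Z {w : ℂ} (hw : 1 < w.re) :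
    logDeriv (fun s : ℂ ↦ LFunctionTrivChar₁ q s *
      ∏ χ ∈ Finset.univ.erase (1 : DirichletCharacter ℂ q), χ.LFunction s) w =
      1 / (w - 1) + ∑ χ : DirichletCharacter ℂ q, logDeriv χ.LFunction w := by
  have hw1 : w ≠ 1 := fun h ↦ by rw [h, one_re] at hw; exact lt_irrefl _ hw
  have hL : ∀ χ : DirichletCharacter ℂ q, χ.LFunction w ≠ 0 := fun χ ↦
    LFunction_ne_zero_of_one_le_re χ (Or.inr hw1) hw.le
  have hdχ : ∀ χ ∈ Finset.univ.erase (1 : DirichletCharacter ℂ q), DifferentiableAt ℂ χ.LFunction w :=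
    fun χ hχ ↦ differentiable_LFunction (Finset.ne_of_mem_erase hχ) w
  have hd1 : DifferentiableAt ℂ (1 : DirichletCharacter ℂ q).LFunction w :=
    differentiableAt_LFunction _ w (Or.inl hw1)
  have hev : LFunctionTrivChar₁ q =ᶠ[𝓝 w] fun s ↦ (s - 1) * (1 : DirichletCharacter ℂ q).LFunction s := by
    filter_upwards [isOpen_ne.mem_nhds hw1] with s hs
    rw [LFunctionTrivChar₁, Function.update_of_ne hs]
  have hA0 : LFunctionTrivChar₁ q w ≠ 0 := by
    rw [hev.eq_of_nhds]
    exact mul_ne_zero (sub_ne_zero.2 hw1) (hL 1)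
  have hA : logDeriv (LFunctionTrivChar₁ q) w = 1 / (w - 1) + logDeriv (1 : DirichletCharacter ℂ q).LFunction w := by
    have h1 : logDeriv (LFunctionTrivChar₁ q) w =
        logDeriv (fun s ↦ (s - 1) * (1 : DirichletCharacter ℂ q).LFunction s) w := by
      rw [logDeriv_apply, logDeriv_apply, hev.deriv_eq, hev.eq_of_nhds]
    rw [h1, logDeriv_mul (f := fun s : ℂ ↦ s - 1) (g := (1 : DirichletCharacter ℂ q).LFunction) w
      (sub_ne_zero.2 hw1) (hL 1) (by fun_prop) hd1]
    congr 1
    rw [logDeriv_apply, deriv_sub_const, deriv_id'', one_div]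
  have hB0 : ∏ χ ∈ Finset.univ.erase (1 : DirichletCharacter ℂ q), χ.LFunction w ≠ 0 :=
    Finset.prod_ne_zero_iff.2 fun χ _ ↦ hL χ
  have hdB : DifferentiableAt ℂ
      (fun s : ℂ ↦ ∏ χ ∈ Finset.univ.erase (1 : DirichletCharacter ℂ q), χ.LFunction s) w :=
    DifferentiableAt.fun_finsetProd hdχ
  rw [logDeriv_mul (f := LFunctionTrivChar₁ q)
      (g := fun s : ℂ ↦ ∏ χ ∈ Finset.univ.erase (1 : DirichletCharacter ℂ q), χ.LFunction s) w hA0 hB0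
      ((differentiable_LFunctionTrivChar₁ q) w) hdB, hA,
    logDeriv_prod (s := Finset.univ.erase (1 : DirichletCharacter ℂ q)) (f := fun χ ↦ χ.LFunction) (x := w)
      (fun χ _ ↦ hL χ) hdχ, add_assoc,
    Finset.add_sum_erase Finset.univ (fun χ : DirichletCharacter ℂ q ↦ logDeriv χ.LFunction w) (Finset.mem_univ _)]

/-- `A_d(t) = Σ_{n ≤ e^t} d(n)/√n` is monotone for `d ≥ 0`. [folklore] -/
private theorem monotone_count {d : ℕ → ℝ} (hd0 : ∀ n, 0 ≤ d n) :
    Monotone fun t : ℝ ↦ ∑ n ∈ Finset.Icc 1 ⌊Real.exp t⌋₊, d n / Real.sqrt n := by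
  intro t u htu
  refine Finset.sum_le_sum_of_subset_of_nonneg
    (Finset.Icc_subset_Icc_right (Nat.floor_mono (Real.exp_le_exp.2 htu))) fun n _ _ ↦ ?_
  exact div_nonneg (hd0 n) (Real.sqrt_nonneg _)

/-- `B_d(t) = Σ_{n ≤ e^t} d(n) log n/√n` is monotone for `d ≥ 0`. [folklore] -/
private theorem monotone_countLog {d : ℕ → ℝ} (hd0 : ∀ n, 0 ≤ d n) :
    Monotone fun t : ℝ ↦ ∑ n ∈ Finset.Icc 1 ⌊Real.exp t⌋₊, d n / Real.sqrt n * Real.log n := by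
  intro t u htu
  refine Finset.sum_le_sum_of_subset_of_nonneg
    (Finset.Icc_subset_Icc_right (Nat.floor_mono (Real.exp_le_exp.2 htu))) fun n _ _ ↦ ?_
  exact mul_nonneg (div_nonneg (hd0 n) (Real.sqrt_nonneg _)) (Real.log_natCast_nonneg n)

/-- `φ_d(t) = Σ_{n ≤ e^t} d(n)/√n (t − log n) = t A_d(t) − B_d(t)` is measurable. [folklore] -/
private theorem measurable_weighted {d : ℕ → ℝ} (hd0 : ∀ n, 0 ≤ d n) :
    Measurable fun t : ℝ ↦ ∑ n ∈ Finset.Icc 1 ⌊Real.exp t⌋₊, d n / Real.sqrt n * (t - Real.log n) := by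
  have h : (fun t : ℝ ↦ ∑ n ∈ Finset.Icc 1 ⌊Real.exp t⌋₊, d n / Real.sqrt n * (t - Real.log n)) =
      fun t ↦ t * (∑ n ∈ Finset.Icc 1 ⌊Real.exp t⌋₊, d n / Real.sqrt n)
        - ∑ n ∈ Finset.Icc 1 ⌊Real.exp t⌋₊, d n / Real.sqrt n * Real.log n := by
    funext t
    rw [Finset.mul_sum, ← Finset.sum_sub_distrib]
    refine Finset.sum_congr rfl fun n _ ↦ ?_
    ring
  rw [h]
  exact (measurable_id.mul (monotone_count hd0).measurable).sub (monotone_countLog hd0).measurable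

/-- If `G` is measurable and `|G(t)| ≤ K + Ct²` for `t > 0`, then `G(t)e^{−σt} ∈ L¹(0, ∞)` for every `σ > 0`
(the tree's private lemma of `ChebyshevHalfLineBiasThm6ivProofs`, repeated). [folklore] -/
private theorem integrableOn_of_quadratic_bound {G : ℝ → ℝ} (hG : Measurable G) {K C : ℝ}
    (hb : ∀ t : ℝ, 0 < t → |G t| ≤ K + C * t ^ 2) {σ : ℝ} (hσ : 0 < σ) :
    IntegrableOn (fun t : ℝ ↦ G t * Real.exp (-σ * t)) (Ioi 0) := by
  have hmaj : IntegrableOn (fun t : ℝ ↦ (|K| + |C| * t ^ 2) * Real.exp (-σ * t)) (Ioi 0) := by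
    have h1 : IntegrableOn (fun t : ℝ ↦ Real.exp (-σ * t)) (Ioi 0) := exp_neg_integrableOn_Ioi 0 hσ
    have h2 : IntegrableOn (fun t : ℝ ↦ t ^ (2 : ℝ) * Real.exp (-σ * t ^ (1 : ℝ))) (Ioi 0) :=
      integrableOn_rpow_mul_exp_neg_mul_rpow (by norm_num) le_rfl hσ
    have h2' : IntegrableOn (fun t : ℝ ↦ t ^ 2 * Real.exp (-σ * t)) (Ioi 0) := by
      refine h2.congr_fun (fun t _ ↦ ?_) measurableSet_Ioi
      dsimp only
      rw [Real.rpow_one, Real.rpow_two]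
    have h3 : IntegrableOn (fun t : ℝ ↦ |K| * Real.exp (-σ * t) + |C| * (t ^ 2 * Real.exp (-σ * t))) (Ioi 0) :=
      (h1.const_mul |K|).add (h2'.const_mul |C|)
    refine h3.congr_fun (fun t _ ↦ ?_) measurableSet_Ioi
    ring
  refine hmaj.mono' ((hG.mul (by fun_prop)).aestronglyMeasurable) ?_
  refine (ae_restrict_iff' measurableSet_Ioi).2 (Eventually.of_forall fun t (ht : 0 < t) ↦ ?_)
  have h1 : |G t| ≤ |K| + |C| * t ^ 2 := by
    refine le_trans (hb t ht) ?_
    gcongr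
    · exact le_abs_self K
    · exact le_abs_self C
  rw [Real.norm_eq_abs, abs_mul, Real.abs_exp]
  exact mul_le_mul_of_nonneg_right h1 (Real.exp_pos _).le

omit [NeZero q] in
/-- A sum over `n ≡ 1 (mod q)` of `Λ(n) g(n)` is the sum of `d(n) g(n)` over all `n`, `d = Λ𝟙_{n ≡ 1 (q)}`. [folklore] -/
private theorem sum_filter_eq_sum_residueClass' (g : ℕ → ℝ) (N : ℕ) :
    ∑ n ∈ (Finset.Icc 1 N).filter (fun n : ℕ ↦ (n : ZMod q) = 1), Λ n * g n =
      ∑ n ∈ Finset.Icc 1 N, vonMangoldt.residueClass (1 : ZMod q) n * g n := by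
  rw [Finset.sum_filter]
  refine Finset.sum_congr rfl fun n _ ↦ ?_
  simp only [vonMangoldt.residueClass, Set.indicator_apply, Set.mem_setOf_eq]
  split_ifs <;> simp

/-- **The cut-off shape of §5.1, sign-free**: if `|2Π_d(t) − φ_d(t)| ≤ K + Ct²` for `t > 0`
(`d = Λ𝟙_{n ≡ 1 (q)}`, `Π_d(t) = Σ_{n ≤ e^t} d(n)/√n`, `φ_d(t) = Σ_{n ≤ e^t} d(n)/√n (t − log n)`), then the GRH holds
for every `χ` mod `q`. Transform (5.6): `∫₀^∞ (2Π_d − φ_d)e^{−St} dt = (2S − 1)S^{-2} L(d, ½ + S)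
= (c(S)(Z₀'/Z₀)(½ + S) + 2/φ(q))/S²`, `c(S) = −(2S − 1)/φ(q) ≠ 0` on `0 < Re S < ½`
(the tree's `HalfLinePrimeOnlyLandau.laplace_two_count_sub_weighted`, `SuzukiProgressions.LSeries_residueClass_one`), then
the engine `DirichletHalfLineRiesz.entire_ne_zero_of_laplace_eq_of_integrable` and the conclusion as in the tree's
`SuzukiProgressionsRiesz.forall_riemannHypothesis_of_tendsto_progressionRieszMean`.
[cite: Suzuki2025Chebyshev, §5.1 (5.5)–(5.6) and «Conversely, assuming (1.23) (resp. (1.24)) …»] -/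
theorem forall_riemannHypothesis_of_cutoff_sq_bound {K C : ℝ}
    (hb : ∀ t : ℝ, 0 < t →
      |(2 * (∑ n ∈ Finset.Icc 1 ⌊Real.exp t⌋₊, vonMangoldt.residueClass (1 : ZMod q) n / Real.sqrt n)
          - ∑ n ∈ Finset.Icc 1 ⌊Real.exp t⌋₊,
              vonMangoldt.residueClass (1 : ZMod q) n / Real.sqrt n * (t - Real.log n))| ≤ K + C * t ^ 2) :
    ∀ χ : DirichletCharacter ℂ q, χ.RiemannHypothesis := by
  have hφ0 : (q.totient : ℂ) ≠ 0 := by exact_mod_cast (Nat.totient_pos.mpr (NeZero.pos q)).ne'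
  set d : ℕ → ℝ := vonMangoldt.residueClass (1 : ZMod q) with hd_def
  have hd0 : ∀ n, 0 ≤ d n := vonMangoldt.residueClass_nonneg _
  have hdle : ∀ n, d n ≤ Λ n := vonMangoldt.residueClass_le _
  set Z₀ : ℂ → ℂ := fun s : ℂ ↦ LFunctionTrivChar₁ q s *
    ∏ χ ∈ Finset.univ.erase (1 : DirichletCharacter ℂ q), χ.LFunction s with hZ₀_def
  have hZ₀d : Differentiable ℂ Z₀ := differentiable_Z
  have hZ₀right : ∀ s : ℂ, 1 ≤ s.re → Z₀ s ≠ 0 := fun s hs ↦ Z_ne_zero_of_one_le_re hs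
  have hLd : ∀ s : ℂ, 1 < s.re →
      LSeries (fun n ↦ (d n : ℂ)) (1 / 2 + s) = -(q.totient : ℂ)⁻¹ * (logDeriv Z₀ (1 / 2 + s) - 1 / (s - 1 / 2)) := by
    intro s hs
    have hw : 1 < (1 / 2 + s : ℂ).re := by simp; linarith
    have h1 := SuzukiProgressions.LSeries_residueClass_one (q := q) hw
    rw [hd_def, h1, hZ₀_def, logDeriv_Z hw]
    rw [show (1 / 2 : ℂ) + s - 1 = s - 1 / 2 by ring]
    ring
  set G : ℝ → ℝ := fun t ↦
    2 * (∑ n ∈ Finset.Icc 1 ⌊Real.exp t⌋₊, d n / Real.sqrt n)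
      - ∑ n ∈ Finset.Icc 1 ⌊Real.exp t⌋₊, d n / Real.sqrt n * (t - Real.log n) with hG_def
  have hGm : Measurable G := ((monotone_count hd0).measurable.const_mul 2).sub (measurable_weighted hd0)
  have hZ : ∀ s : ℂ, 1 / 2 < s.re → Z₀ s ≠ 0 := by
    refine DirichletHalfLineRiesz.entire_ne_zero_of_laplace_eq_of_integrable hZ₀d hZ₀right hGm
      (fun σ hσ ↦ integrableOn_of_quadratic_bound hGm hb hσ)
      (c := fun s ↦ -(q.totient : ℂ)⁻¹ * (2 * s - 1)) (P := fun _ ↦ 2 * (q.totient : ℂ)⁻¹)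
      (by fun_prop) (fun s hs0 hs1 ↦ ?_) (by fun_prop) (fun s hs ↦ ?_)
    · refine mul_ne_zero (neg_ne_zero.2 (inv_ne_zero hφ0)) fun h ↦ ?_
      have := congrArg Complex.re h
      simp at this
      linarith
    · have hs' : 1 / 2 < s.re := by linarith
      obtain ⟨-, hI⟩ := HalfLinePrimeOnlyLandau.laplace_two_count_sub_weighted (d := d) hd0 hdle hs'
      have heq : EqOn (fun t : ℝ ↦ (G t : ℂ) * cexp (-s * t))
          (fun t ↦ ((2 * (∑ n ∈ Finset.Icc 1 ⌊Real.exp t⌋₊, d n / Real.sqrt n)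
              - ∑ n ∈ Finset.Icc 1 ⌊Real.exp t⌋₊, d n / Real.sqrt n * (t - Real.log n) : ℝ) : ℂ) *
            cexp (-s * t)) (Ioi 0) := fun t _ ↦ by simp only [hG_def]
      rw [setIntegral_congr_fun measurableSet_Ioi heq, hI]
      rw [show LSeries (fun n ↦ (d n : ℂ)) (1 / 2 + s) =
          -(q.totient : ℂ)⁻¹ * (logDeriv Z₀ (1 / 2 + s) - 1 / (s - 1 / 2)) from hLd s hs]
      have hs0 : s ≠ 0 := fun h ↦ by rw [h, zero_re] at hs; linarith
      have hs2 : s - 1 / 2 ≠ 0 := fun h ↦ by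
        have := congrArg re h
        simp at this
        linarith
      have hs4 : (2 * s - 1 : ℂ) ≠ 0 := fun h ↦ hs2 (by linear_combination h / 2)
      field_simp
      ring
  -- `L(s, χ) ≠ 0` for `½ < Re s`, `s ≠ 1`, every `χ`
  have hmain : ∀ χ : DirichletCharacter ℂ q, ∀ s : ℂ, 1 / 2 < s.re → s ≠ 1 → χ.LFunction s ≠ 0 :=
    fun χ s hs hs1 ↦ ne_zero_of_Z hs1 (hZ s hs) χ
  intro χ
  rcases ne_or_eq χ 1 with hχ | rfl
  · refine DirichletHalfLineLandau.riemannHypothesis_of_forall_ne_zero hχ fun s hs ↦ ?_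
    rcases eq_or_ne s 1 with rfl | hs1
    · exact LFunction_ne_zero_of_one_le_re χ (Or.inl hχ) (by simp)
    · exact hmain χ s hs hs1
  · intro s h0 h0re h1re
    by_contra hne
    have hs1 : s ≠ 1 := fun h ↦ by rw [h, one_re] at h1re; exact lt_irrefl _ h1re
    rcases lt_or_gt_of_ne hne with hlt | hgt
    · have hs0 : s ≠ 0 := fun h ↦ by rw [h, zero_re] at h0re; exact lt_irrefl _ h0re
      have heuler : ∀ w : ℂ, 0 < w.re → ∏ p ∈ q.primeFactors, (1 - (p : ℂ) ^ (-w)) ≠ 0 := fun w hw ↦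
        Finset.prod_ne_zero_iff.2 fun p hp ↦ one_sub_prime_cpow_ne_zero (Nat.prime_of_mem_primeFactors hp) hw
      have hζ : riemannZeta s = 0 := by
        have h0' : LFunctionTrivChar q s = 0 := h0
        rw [LFunctionTrivChar_eq_mul_riemannZeta hs1, mul_eq_zero] at h0'
        exact h0'.resolve_left (heuler s h0re)
      have hζ' := GeneralizedRH.riemannZeta_one_sub_eq_zero hζ h0re h1re
      have h1s : (1 - s) ≠ 1 := fun h ↦ hs0 (by linear_combination -h)
      have hL : LFunctionTrivChar q (1 - s) = 0 := by
        rw [LFunctionTrivChar_eq_mul_riemannZeta h1s, hζ', mul_zero]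
      exact hmain 1 (1 - s) (by simp; linarith) h1s hL
    · exact hmain 1 s hgt hs1 h0

/-- **An eventual bound `|G(x)| ≤ C(1 + log x)` for the cut-off Riesz sum forces GRH for every `χ` mod `q`**
(`G(x) = Σ_{n ≤ xe², n ≡ 1 (q)} Λ(n) n^{-1/2}(1 − log n/log x)`; with `u = log x + 2`:
`φ_d(u) − 2Π_d(u) = (u − 2) G(e^{u−2})`, so `|2Π_d − φ_d| ≤ K + C'u²`). [cite: Suzuki2025Chebyshev, §5.1 («`F_q(x) ≪ log x`»)] -/
theorem forall_riemannHypothesis_of_cutoff_le {C x₁ : ℝ}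
    (hF : ∀ x : ℝ, x₁ ≤ x → |∑ n ∈ (Finset.Icc 1 ⌊x * Real.exp 2⌋₊).filter (fun n : ℕ ↦ (n : ZMod q) = 1),
        Λ n / Real.sqrt n * (1 - Real.log n / Real.log x)| ≤ C * (1 + Real.log x)) :
    ∀ χ : DirichletCharacter ℂ q, χ.RiemannHypothesis := by
  set d : ℕ → ℝ := vonMangoldt.residueClass (1 : ZMod q) with hd_def
  have hd0 : ∀ n, 0 ≤ d n := vonMangoldt.residueClass_nonneg _
  have hdle : ∀ n, d n ≤ Λ n := vonMangoldt.residueClass_le _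
  set F : ℝ → ℝ := fun x ↦ ∑ n ∈ (Finset.Icc 1 ⌊x * Real.exp 2⌋₊).filter (fun n : ℕ ↦ (n : ZMod q) = 1),
    Λ n / Real.sqrt n * (1 - Real.log n / Real.log x) with hF_def
  -- the identity `φ_d(u) − 2Π_d(u) = (u − 2) F(e^{u − 2})` for `u > 3`
  have hid : ∀ u : ℝ, 3 < u →
      (∑ n ∈ Finset.Icc 1 ⌊Real.exp u⌋₊, d n / Real.sqrt n * (u - Real.log n))
        - 2 * (∑ n ∈ Finset.Icc 1 ⌊Real.exp u⌋₊, d n / Real.sqrt n) = (u - 2) * F (Real.exp (u - 2)) := by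
    intro u hu
    have hxe : Real.exp (u - 2) * Real.exp 2 = Real.exp u := by rw [← Real.exp_add]; ring_nf
    have hu2 : u - 2 ≠ 0 := by linarith
    rw [hF_def]
    simp only
    rw [hxe, Real.log_exp, Finset.mul_sum, Finset.mul_sum, ← Finset.sum_sub_distrib]
    have h1 : ∑ n ∈ (Finset.Icc 1 ⌊Real.exp u⌋₊).filter (fun n : ℕ ↦ (n : ZMod q) = 1),
        (u - 2) * (Λ n / Real.sqrt n * (1 - Real.log n / (u - 2))) =
        ∑ n ∈ (Finset.Icc 1 ⌊Real.exp u⌋₊).filter (fun n : ℕ ↦ (n : ZMod q) = 1),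
          Λ n * ((u - Real.log n - 2) / Real.sqrt n) := by
      refine Finset.sum_congr rfl fun n _ ↦ ?_
      field_simp
      ring
    rw [h1, sum_filter_eq_sum_residueClass']
    refine Finset.sum_congr rfl fun n _ ↦ ?_
    rw [hd_def]
    ring
  -- crude bound on `(0, 4]`
  set u₁ : ℝ := max (Real.log (max x₁ 1) + 2) 4 with hu₁
  have hu₁4 : 4 ≤ u₁ := le_max_right _ _
  set A : ℝ := ∑ n ∈ Finset.Icc 1 ⌊Real.exp u₁⌋₊, Λ n / Real.sqrt n with hA
  have hsum_le : ∀ t : ℝ, t ≤ u₁ → (∑ n ∈ Finset.Icc 1 ⌊Real.exp t⌋₊, d n / Real.sqrt n) ≤ A ∧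
      0 ≤ ∑ n ∈ Finset.Icc 1 ⌊Real.exp t⌋₊, d n / Real.sqrt n := by
    intro t ht
    refine ⟨?_, Finset.sum_nonneg fun n _ ↦ div_nonneg (hd0 n) (Real.sqrt_nonneg _)⟩
    calc (∑ n ∈ Finset.Icc 1 ⌊Real.exp t⌋₊, d n / Real.sqrt n)
        ≤ ∑ n ∈ Finset.Icc 1 ⌊Real.exp u₁⌋₊, d n / Real.sqrt n := monotone_count hd0 ht
      _ ≤ A := Finset.sum_le_sum fun n _ ↦ div_le_div_of_nonneg_right (hdle n) (Real.sqrt_nonneg _)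
  have hwt_le : ∀ t : ℝ, 0 < t → t ≤ u₁ →
      |∑ n ∈ Finset.Icc 1 ⌊Real.exp t⌋₊, d n / Real.sqrt n * (t - Real.log n)| ≤ u₁ * A := by
    intro t ht htu
    have hterm : ∀ n ∈ Finset.Icc 1 ⌊Real.exp t⌋₊,
        0 ≤ d n / Real.sqrt n * (t - Real.log n) ∧ d n / Real.sqrt n * (t - Real.log n) ≤ u₁ * (Λ n / Real.sqrt n) := by
      intro n hn
      rw [Finset.mem_Icc] at hn
      have hn0 : (0 : ℝ) < n := by exact_mod_cast hn.1
      have hnt : Real.log n ≤ t := by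
        have h1 : (n : ℝ) ≤ Real.exp t := le_trans (by exact_mod_cast hn.2) (Nat.floor_le (Real.exp_pos t).le)
        have := Real.log_le_log hn0 h1
        rwa [Real.log_exp] at this
      have hl0 : 0 ≤ t - Real.log n := by linarith
      have hdn : 0 ≤ d n / Real.sqrt n := div_nonneg (hd0 n) (Real.sqrt_nonneg _)
      refine ⟨mul_nonneg hdn hl0, ?_⟩
      calc d n / Real.sqrt n * (t - Real.log n) ≤ Λ n / Real.sqrt n * u₁ := by
            apply mul_le_mul (div_le_div_of_nonneg_right (hdle n) (Real.sqrt_nonneg _)) _ hl0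
              (div_nonneg vonMangoldt_nonneg (Real.sqrt_nonneg _))
            linarith [Real.log_natCast_nonneg n]
        _ = u₁ * (Λ n / Real.sqrt n) := mul_comm _ _
    rw [abs_of_nonneg (Finset.sum_nonneg fun n hn ↦ (hterm n hn).1), hA, Finset.mul_sum]
    calc ∑ n ∈ Finset.Icc 1 ⌊Real.exp t⌋₊, d n / Real.sqrt n * (t - Real.log n)
        ≤ ∑ n ∈ Finset.Icc 1 ⌊Real.exp t⌋₊, u₁ * (Λ n / Real.sqrt n) := Finset.sum_le_sum fun n hn ↦ (hterm n hn).2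
      _ ≤ ∑ n ∈ Finset.Icc 1 ⌊Real.exp u₁⌋₊, u₁ * (Λ n / Real.sqrt n) := by
          apply Finset.sum_le_sum_of_subset_of_nonneg
            (Finset.Icc_subset_Icc_right (Nat.floor_mono (Real.exp_le_exp.2 htu)))
          intro n _ _
          exact mul_nonneg (by linarith) (div_nonneg vonMangoldt_nonneg (Real.sqrt_nonneg _))
  set C' : ℝ := max C 0 with hC'
  refine forall_riemannHypothesis_of_cutoff_sq_bound (K := 2 * A + u₁ * A) (C := C') fun t ht ↦ ?_
  have hC'0 : 0 ≤ C' := le_max_right _ _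
  rcases le_or_gt t u₁ with hle | hgt
  · obtain ⟨hs1, hs0⟩ := hsum_le t hle
    have hw := hwt_le t ht hle
    have hct : 0 ≤ C' * t ^ 2 := by positivity
    calc |2 * (∑ n ∈ Finset.Icc 1 ⌊Real.exp t⌋₊, d n / Real.sqrt n)
          - ∑ n ∈ Finset.Icc 1 ⌊Real.exp t⌋₊, d n / Real.sqrt n * (t - Real.log n)|
        ≤ |2 * (∑ n ∈ Finset.Icc 1 ⌊Real.exp t⌋₊, d n / Real.sqrt n)|
          + |∑ n ∈ Finset.Icc 1 ⌊Real.exp t⌋₊, d n / Real.sqrt n * (t - Real.log n)| := abs_sub _ _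
      _ ≤ 2 * A + u₁ * A := by
          rw [abs_of_nonneg (by positivity)]
          exact add_le_add (by linarith) hw
      _ ≤ 2 * A + u₁ * A + C' * t ^ 2 := by linarith
  · -- `t > u₁ ≥ 4`: `e^{t−2} ≥ x₁`, `|F| ≤ C(1 + (t − 2))`
    have ht3 : 3 < t := by linarith
    have hxt : x₁ ≤ Real.exp (t - 2) := by
      have h1 : Real.log (max x₁ 1) + 2 ≤ u₁ := le_max_left _ _
      have h2 : Real.log (max x₁ 1) < t - 2 := by linarith
      have h3 : max x₁ 1 < Real.exp (t - 2) := by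
        rw [← Real.exp_log (lt_of_lt_of_le one_pos (le_max_right x₁ 1))]
        exact Real.exp_lt_exp.2 h2
      exact le_trans (le_max_left _ _) h3.le
    have hFt : |F (Real.exp (t - 2))| ≤ C' * (1 + (t - 2)) := by
      have h0 := hF (Real.exp (t - 2)) hxt
      simp only [hF_def, Real.log_exp] at h0 ⊢
      exact h0.trans (mul_le_mul_of_nonneg_right (le_max_left C 0) (by linarith))
    have hA0 : 0 ≤ A := Finset.sum_nonneg fun n _ ↦ div_nonneg vonMangoldt_nonneg (Real.sqrt_nonneg _)
    rw [abs_sub_comm, hid t ht3, abs_mul, abs_of_pos (by linarith : 0 < t - 2)]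
    calc (t - 2) * |F (Real.exp (t - 2))| ≤ (t - 2) * (C' * (1 + (t - 2))) :=
          mul_le_mul_of_nonneg_left hFt (by linarith)
      _ = C' * ((t - 2) * (t - 1)) := by ring
      _ ≤ C' * t ^ 2 := mul_le_mul_of_nonneg_left (by nlinarith) hC'0
      _ ≤ 2 * A + u₁ * A + C' * t ^ 2 := by nlinarith

end Landau


/-! ## §10 Assembly: Thm 6 (iii), the corrected (v), and (v) as printed -/

section Assembly

/-- `x ↦ xe²` tends to `+∞`. [folklore] -/
private theorem tendsto_mul_exp_two : Tendsto (fun x : ℝ ↦ x * Real.exp 2) atTop atTop :=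
  tendsto_id.atTop_mul_const (Real.exp_pos 2)

/-- What holds for all large `xe²` holds for all large `y`. [folklore] -/
private theorem eventually_of_mul_exp_two {P : ℝ → Prop} (h : ∀ᶠ x : ℝ in atTop, P (x * Real.exp 2)) :
    ∀ᶠ y : ℝ in atTop, P y := by
  obtain ⟨a, ha⟩ := Filter.eventually_atTop.1 h
  refine Filter.eventually_atTop.2 ⟨a * Real.exp 2, fun y hy ↦ ?_⟩
  have he : 0 < Real.exp 2 := Real.exp_pos 2
  have := ha (y / Real.exp 2) (by rw [le_div_iff₀ he]; exact hy)
  rwa [div_mul_cancel₀ _ he.ne'] at this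

/-- Eventually `K ≤ √x`. [folklore] -/
private theorem eventually_le_sqrt (K : ℝ) : ∀ᶠ x : ℝ in atTop, K ≤ Real.sqrt x := by
  filter_upwards [eventually_ge_atTop (max K 0 ^ 2)] with x hx
  calc K ≤ max K 0 := le_max_left _ _
    _ = Real.sqrt (max K 0 ^ 2) := (Real.sqrt_sq (le_max_right _ _)).symm
    _ ≤ Real.sqrt x := Real.sqrt_le_sqrt hx

/-- **`A(y)` small ⟹ the zero-sum condition** (with KEY ESTIMATE 2): if `‖A(y)‖ ≤ ε√y logᵏy` eventually for every
`ε > 0` (`k ≥ 1`), then `‖Σ_χ Σ_{|γ_χ|≤T} m(ρ)x^ρ/ρ‖ ≤ ε√x logᵏx` eventually in `x` and then in `T`, for every `ε > 0`.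
[cite: Suzuki2025Chebyshev, §5.1 («Comparing this with (5.9) … (1.25) follows»)] -/
theorem zeroSum_small_of_A_small {k : ℕ} (hk : 1 ≤ k)
    (hA : ∀ ε : ℝ, 0 < ε → ∀ᶠ y : ℝ in atTop,
      ‖∑ χ : DirichletCharacter ℂ q,
          (if χ = 1 then (((Chebyshev.psi y - y : ℝ)) : ℂ) else Sieve.chebyshevPsiChar χ.primitiveCharacter y)‖ ≤
        ε * (Real.sqrt y * Real.log y ^ k)) :
    ∀ ε : ℝ, 0 < ε → ∀ᶠ x : ℝ in atTop, ∀ᶠ T : ℝ in atTop,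
      ‖∑ χ : DirichletCharacter ℂ q, charZeroSumTrunc χ x T‖ ≤ ε * (Real.sqrt x * Real.log x ^ k) := by
  classical
  obtain ⟨C, hC⟩ := exists_eventually_norm_A_add_le (q := q)
  intro ε hε
  filter_upwards [hA (ε / 2) (half_pos hε), eventually_ge_atTop (Real.exp 1), eventually_le_sqrt (8 * max C 0 / ε)]
    with x hx hxe hsq
  have hx1 : 1 ≤ Real.log x := by
    have := Real.log_le_log (Real.exp_pos 1) hxe
    rwa [Real.log_exp] at this
  have hx2 : 2 ≤ x := le_trans (by have := Real.add_one_le_exp (1:ℝ); linarith) hxe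
  filter_upwards [hC x hx2] with T hT
  set A := ∑ χ : DirichletCharacter ℂ q,
    (if χ = 1 then (((Chebyshev.psi x - x : ℝ)) : ℂ) else Sieve.chebyshevPsiChar χ.primitiveCharacter x)
  set Z := ∑ χ : DirichletCharacter ℂ q, charZeroSumTrunc χ x T
  have h1 : ‖Z‖ ≤ ‖A‖ + ‖A + Z‖ := by
    calc ‖Z‖ = ‖(A + Z) - A‖ := by ring_nf
      _ ≤ ‖A + Z‖ + ‖A‖ := norm_sub_le _ _
      _ = ‖A‖ + ‖A + Z‖ := add_comm _ _
  have hlogk : Real.log x ≤ Real.log x ^ k := by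
    calc Real.log x = Real.log x ^ 1 := (pow_one _).symm
      _ ≤ Real.log x ^ k := pow_le_pow_right₀ hx1 hk
  have hC' : C * (1 + Real.log x) ≤ max C 0 * (2 * Real.log x ^ k) := by
    calc C * (1 + Real.log x) ≤ max C 0 * (1 + Real.log x) :=
          mul_le_mul_of_nonneg_right (le_max_left _ _) (by linarith)
      _ ≤ max C 0 * (2 * Real.log x ^ k) := mul_le_mul_of_nonneg_left (by linarith) (le_max_right _ _)
  have hsqx : 8 * max C 0 ≤ ε * Real.sqrt x := by
    rw [div_le_iff₀ hε] at hsq; linarith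
  have hM0 : 0 ≤ max C 0 := le_max_right _ _
  have hlk0 : 0 ≤ Real.log x ^ k := by positivity
  calc ‖Z‖ ≤ ‖A‖ + ‖A + Z‖ := h1
    _ ≤ ε / 2 * (Real.sqrt x * Real.log x ^ k) + C * (1 + Real.log x) := add_le_add hx hT
    _ ≤ ε / 2 * (Real.sqrt x * Real.log x ^ k) + max C 0 * (2 * Real.log x ^ k) := by linarith
    _ ≤ ε / 2 * (Real.sqrt x * Real.log x ^ k) + (ε * Real.sqrt x / 4) * (2 * Real.log x ^ k) := by
        gcongr
        linarith
    _ = ε * (Real.sqrt x * Real.log x ^ k) := by ring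

/-- **The zero-sum condition ⟹ `A(y)` small** (with KEY ESTIMATE 2): the converse transfer.
[cite: Suzuki2025Chebyshev, §5.1 («Additionally, if we assume (1.25) …»)] -/
theorem A_small_of_zeroSum_small {k : ℕ} (hk : 1 ≤ k)
    (hZ : ∀ ε : ℝ, 0 < ε → ∀ᶠ x : ℝ in atTop, ∀ᶠ T : ℝ in atTop,
      ‖∑ χ : DirichletCharacter ℂ q, charZeroSumTrunc χ x T‖ ≤ ε * (Real.sqrt x * Real.log x ^ k)) :
    ∀ ε : ℝ, 0 < ε → ∀ᶠ y : ℝ in atTop,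
      ‖∑ χ : DirichletCharacter ℂ q,
          (if χ = 1 then (((Chebyshev.psi y - y : ℝ)) : ℂ) else Sieve.chebyshevPsiChar χ.primitiveCharacter y)‖ ≤
        ε * (Real.sqrt y * Real.log y ^ k) := by
  classical
  obtain ⟨C, hC⟩ := exists_eventually_norm_A_add_le (q := q)
  intro ε hε
  filter_upwards [hZ (ε / 2) (half_pos hε), eventually_ge_atTop (Real.exp 1), eventually_le_sqrt (8 * max C 0 / ε)]
    with x hx hxe hsq
  have hx1 : 1 ≤ Real.log x := by
    have := Real.log_le_log (Real.exp_pos 1) hxe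
    rwa [Real.log_exp] at this
  have hx2 : 2 ≤ x := le_trans (by have := Real.add_one_le_exp (1:ℝ); linarith) hxe
  obtain ⟨T, hT1, hT2⟩ := (hx.and (hC x hx2)).exists
  set A := ∑ χ : DirichletCharacter ℂ q,
    (if χ = 1 then (((Chebyshev.psi x - x : ℝ)) : ℂ) else Sieve.chebyshevPsiChar χ.primitiveCharacter x)
  set Z := ∑ χ : DirichletCharacter ℂ q, charZeroSumTrunc χ x T
  have h1 : ‖A‖ ≤ ‖Z‖ + ‖A + Z‖ := by
    calc ‖A‖ = ‖(A + Z) - Z‖ := by ring_nf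
      _ ≤ ‖A + Z‖ + ‖Z‖ := norm_sub_le _ _
      _ = ‖Z‖ + ‖A + Z‖ := add_comm _ _
  have hlogk : Real.log x ≤ Real.log x ^ k := by
    calc Real.log x = Real.log x ^ 1 := (pow_one _).symm
      _ ≤ Real.log x ^ k := pow_le_pow_right₀ hx1 hk
  have hC' : C * (1 + Real.log x) ≤ max C 0 * (2 * Real.log x ^ k) := by
    calc C * (1 + Real.log x) ≤ max C 0 * (1 + Real.log x) :=
          mul_le_mul_of_nonneg_right (le_max_left _ _) (by linarith)
      _ ≤ max C 0 * (2 * Real.log x ^ k) := mul_le_mul_of_nonneg_left (by linarith) (le_max_right _ _)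
  have hsqx : 8 * max C 0 ≤ ε * Real.sqrt x := by
    rw [div_le_iff₀ hε] at hsq; linarith
  have hM0 : 0 ≤ max C 0 := le_max_right _ _
  have hlk0 : 0 ≤ Real.log x ^ k := by positivity
  calc ‖A‖ ≤ ‖Z‖ + ‖A + Z‖ := h1
    _ ≤ ε / 2 * (Real.sqrt x * Real.log x ^ k) + C * (1 + Real.log x) := add_le_add hT1 hT2
    _ ≤ ε / 2 * (Real.sqrt x * Real.log x ^ k) + max C 0 * (2 * Real.log x ^ k) := by linarith
    _ ≤ ε / 2 * (Real.sqrt x * Real.log x ^ k) + (ε * Real.sqrt x / 4) * (2 * Real.log x ^ k) := by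
        gcongr
        linarith
    _ = ε * (Real.sqrt x * Real.log x ^ k) := by ring

/-- **The two-sided link for (iii)** under GRH and `L(½, χ) ≠ 0` for all `χ` (KEY ESTIMATE 1 with `c_χ = (L'/L)(½, χ)`,
`m_χ = 0`): with `τ = −φ(q)^{-1}Σ_χ (L'/L)(½, χ)`, `y = xe²`, for `x > 1`,
`(2/√y)‖A(y)‖ ≤ B' + φ log x ‖G(x) − τ‖` and `φ log x ‖G(x) − τ‖ ≤ B' + (2/√y)‖A(y)‖`.
[cite: Suzuki2025Chebyshev, §5.1 (5.9)] -/
theorem exists_cutoff_link (hGRH : ∀ χ : DirichletCharacter ℂ q, χ.RiemannHypothesis)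
    (hL : ∀ χ : DirichletCharacter ℂ q, χ.LFunction (1 / 2) ≠ 0) :
    ∃ B : ℝ, ∀ x : ℝ, 1 < x →
      2 / Real.sqrt (x * Real.exp 2) * ‖∑ χ : DirichletCharacter ℂ q,
          (if χ = 1 then (((Chebyshev.psi (x * Real.exp 2) - x * Real.exp 2 : ℝ)) : ℂ)
            else Sieve.chebyshevPsiChar χ.primitiveCharacter (x * Real.exp 2))‖ ≤
        B + q.totient * Real.log x *
          ‖((∑ n ∈ (Finset.Icc 1 ⌊x * Real.exp 2⌋₊).filter (fun n : ℕ ↦ (n : ZMod q) = 1),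
              Λ n / Real.sqrt n * (1 - Real.log n / Real.log x) : ℝ) : ℂ) -
            (-(1 / (Nat.totient q : ℂ)) * ∑ χ : DirichletCharacter ℂ q, logDeriv χ.LFunction (1 / 2))‖ ∧
      q.totient * Real.log x *
          ‖((∑ n ∈ (Finset.Icc 1 ⌊x * Real.exp 2⌋₊).filter (fun n : ℕ ↦ (n : ZMod q) = 1),
              Λ n / Real.sqrt n * (1 - Real.log n / Real.log x) : ℝ) : ℂ) -
            (-(1 / (Nat.totient q : ℂ)) * ∑ χ : DirichletCharacter ℂ q, logDeriv χ.LFunction (1 / 2))‖ ≤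
        B + 2 / Real.sqrt (x * Real.exp 2) * ‖∑ χ : DirichletCharacter ℂ q,
          (if χ = 1 then (((Chebyshev.psi (x * Real.exp 2) - x * Real.exp 2 : ℝ)) : ℂ)
            else Sieve.chebyshevPsiChar χ.primitiveCharacter (x * Real.exp 2))‖ := by
  classical
  obtain ⟨c, hc, B, hB⟩ := exists_norm_cutoff_sub_le hGRH
  set S : ℂ := ∑ χ : DirichletCharacter ℂ q, logDeriv χ.LFunction (1 / 2) with hS
  have hφ0 : (q.totient : ℂ) ≠ 0 := by exact_mod_cast (Nat.totient_pos.mpr (NeZero.pos q)).ne'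
  have hφpos : (0 : ℝ) < q.totient := by exact_mod_cast Nat.totient_pos.mpr (NeZero.pos q)
  have hcS : ∑ χ : DirichletCharacter ℂ q, c χ = S := Finset.sum_congr rfl fun χ _ ↦ hc χ (hL χ)
  have hm0 : ∑ χ : DirichletCharacter ℂ q, (DirichletDisc.zeroOrder χ (1 / 2) : ℂ) = 0 := by
    refine Finset.sum_eq_zero fun χ _ ↦ ?_
    by_cases hχ : χ = 1
    · subst hχ; rw [zeroOrder_one_half_eq_zero]; simp
    · rw [zeroOrder_half_eq_zero hχ (hL χ)]; simp
  refine ⟨B + 2 * ‖S‖, fun x hx ↦ ?_⟩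
  have hx0 : 0 < x := by linarith
  set y := x * Real.exp 2 with hy
  have hy0 : 0 < y := by positivity
  have hlogy : Real.log y = Real.log x + 2 := by
    rw [hy, Real.log_mul hx0.ne' (Real.exp_pos 2).ne', Real.log_exp]
  set Gx : ℂ := ((∑ n ∈ (Finset.Icc 1 ⌊y⌋₊).filter (fun n : ℕ ↦ (n : ZMod q) = 1),
    Λ n / Real.sqrt n * (1 - Real.log n / Real.log x) : ℝ) : ℂ)
  set A : ℂ := ∑ χ : DirichletCharacter ℂ q,
    (if χ = 1 then (((Chebyshev.psi y - y : ℝ)) : ℂ) else Sieve.chebyshevPsiChar χ.primitiveCharacter y)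
  set τ : ℂ := -(1 / (Nat.totient q : ℂ)) * S with hτ
  have key := hB x hx
  rw [hcS, hm0, mul_zero, add_zero] at key
  -- `φ log x G + log y S = φ log x (G − τ) + 2S`
  have hid : (q.totient : ℂ) * (Real.log x : ℂ) * Gx + (Real.log y : ℂ) * S =
      (q.totient : ℂ) * (Real.log x : ℂ) * (Gx - τ) + 2 * S := by
    rw [hlogy, hτ]
    push_cast
    field_simp
    ring
  have key' : ‖(q.totient : ℂ) * (Real.log x : ℂ) * (Gx - τ) + 2 * S + 2 / (Real.sqrt y : ℂ) * A‖ ≤ B := by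
    rw [← hid]; exact key
  have hn1 : ‖(q.totient : ℂ) * (Real.log x : ℂ) * (Gx - τ)‖ = q.totient * Real.log x * ‖Gx - τ‖ := by
    rw [norm_mul, norm_mul, Complex.norm_natCast, Complex.norm_real, Real.norm_eq_abs,
      abs_of_pos (Real.log_pos hx)]
  have hn2 : ‖2 / (Real.sqrt y : ℂ) * A‖ = 2 / Real.sqrt y * ‖A‖ := by
    rw [norm_mul, norm_div, Complex.norm_two, Complex.norm_real, Real.norm_eq_abs,
      abs_of_pos (Real.sqrt_pos.2 hy0)]
  have hn3 : ‖(2 : ℂ) * S‖ = 2 * ‖S‖ := by rw [norm_mul, Complex.norm_two]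
  constructor
  · calc 2 / Real.sqrt y * ‖A‖ = ‖2 / (Real.sqrt y : ℂ) * A‖ := hn2.symm
      _ = ‖((q.totient : ℂ) * (Real.log x : ℂ) * (Gx - τ) + 2 * S + 2 / (Real.sqrt y : ℂ) * A)
            - ((q.totient : ℂ) * (Real.log x : ℂ) * (Gx - τ) + 2 * S)‖ := by ring_nf
      _ ≤ ‖(q.totient : ℂ) * (Real.log x : ℂ) * (Gx - τ) + 2 * S + 2 / (Real.sqrt y : ℂ) * A‖
            + ‖(q.totient : ℂ) * (Real.log x : ℂ) * (Gx - τ) + 2 * S‖ := norm_sub_le _ _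
      _ ≤ B + (‖(q.totient : ℂ) * (Real.log x : ℂ) * (Gx - τ)‖ + ‖(2 : ℂ) * S‖) :=
            add_le_add key' (norm_add_le _ _)
      _ = B + 2 * ‖S‖ + q.totient * Real.log x * ‖Gx - τ‖ := by rw [hn1, hn3]; ring
  · calc q.totient * Real.log x * ‖Gx - τ‖ = ‖(q.totient : ℂ) * (Real.log x : ℂ) * (Gx - τ)‖ := hn1.symm
      _ = ‖((q.totient : ℂ) * (Real.log x : ℂ) * (Gx - τ) + 2 * S + 2 / (Real.sqrt y : ℂ) * A)
            - (2 * S + 2 / (Real.sqrt y : ℂ) * A)‖ := by ring_nf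
      _ ≤ ‖(q.totient : ℂ) * (Real.log x : ℂ) * (Gx - τ) + 2 * S + 2 / (Real.sqrt y : ℂ) * A‖
            + ‖2 * S + 2 / (Real.sqrt y : ℂ) * A‖ := norm_sub_le _ _
      _ ≤ B + (‖(2 : ℂ) * S‖ + ‖2 / (Real.sqrt y : ℂ) * A‖) := add_le_add key' (norm_add_le _ _)
      _ = B + 2 * ‖S‖ + 2 / Real.sqrt y * ‖A‖ := by rw [hn2, hn3]; ring


/-- **(1.24) ⟹ GRH for every `χ` mod `q`, for every limit value**. [cite: Suzuki2025Chebyshev, §1.3 Thm 6 (iii) ((1.24) ⟹ GRH), §5.1] -/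
theorem forall_riemannHypothesis_of_tendsto_cutoff {ℓ : ℂ}
    (h : Tendsto (fun x : ℝ ↦ ((∑ n ∈ (Finset.Icc 1 ⌊x * Real.exp 2⌋₊).filter (fun n : ℕ ↦ (n : ZMod q) = 1),
        Λ n / Real.sqrt n * (1 - Real.log n / Real.log x) : ℝ) : ℂ)) atTop (𝓝 ℓ)) :
    ∀ χ : DirichletCharacter ℂ q, χ.RiemannHypothesis := by
  have hev := (Metric.tendsto_nhds.1 h) 1 one_pos
  obtain ⟨x₁, hx₁⟩ := Filter.eventually_atTop.1 (hev.and (eventually_ge_atTop (1 : ℝ)))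
  refine forall_riemannHypothesis_of_cutoff_le (C := ‖ℓ‖ + 1) (x₁ := x₁) fun x hx ↦ ?_
  obtain ⟨hd, hx1⟩ := hx₁ x hx
  set G : ℝ := ∑ n ∈ (Finset.Icc 1 ⌊x * Real.exp 2⌋₊).filter (fun n : ℕ ↦ (n : ZMod q) = 1),
    Λ n / Real.sqrt n * (1 - Real.log n / Real.log x)
  have hlog : 0 ≤ Real.log x := Real.log_nonneg hx1
  rw [dist_eq_norm] at hd
  have h1 : |G| ≤ ‖ℓ‖ + 1 := by
    have h2 : |G| = ‖((G : ℝ) : ℂ)‖ := by rw [Complex.norm_real, Real.norm_eq_abs]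
    rw [h2]
    calc ‖((G : ℝ) : ℂ)‖ = ‖(((G : ℝ) : ℂ) - ℓ) + ℓ‖ := by rw [sub_add_cancel]
      _ ≤ ‖((G : ℝ) : ℂ) - ℓ‖ + ‖ℓ‖ := norm_add_le _ _
      _ ≤ ‖ℓ‖ + 1 := by linarith [hd.le]
  calc |G| ≤ ‖ℓ‖ + 1 := h1
    _ ≤ (‖ℓ‖ + 1) * (1 + Real.log x) := le_mul_of_one_le_right (by positivity) (by linarith)

/-- **(1.29) ⟹ GRH for every `χ` mod `q`, for every limit value** (of `(1/log x)·G(x)`).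
[cite: Suzuki2025Chebyshev, §1.3 Thm 6 (v) ((1.29) ⟹ GRH), §5.1] -/
theorem forall_riemannHypothesis_of_tendsto_cutoff_div_log {ℓ : ℝ}
    (h : Tendsto (fun x : ℝ ↦ (1 / Real.log x) *
        ∑ n ∈ (Finset.Icc 1 ⌊x * Real.exp 2⌋₊).filter (fun n : ℕ ↦ (n : ZMod q) = 1),
          Λ n / Real.sqrt n * (1 - Real.log n / Real.log x)) atTop (𝓝 ℓ)) :
    ∀ χ : DirichletCharacter ℂ q, χ.RiemannHypothesis := by
  have hev := (Metric.tendsto_nhds.1 h) 1 one_pos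
  obtain ⟨x₁, hx₁⟩ := Filter.eventually_atTop.1 (hev.and (eventually_ge_atTop (Real.exp 1)))
  refine forall_riemannHypothesis_of_cutoff_le (C := |ℓ| + 1) (x₁ := x₁) fun x hx ↦ ?_
  obtain ⟨hd, hxe⟩ := hx₁ x hx
  set G : ℝ := ∑ n ∈ (Finset.Icc 1 ⌊x * Real.exp 2⌋₊).filter (fun n : ℕ ↦ (n : ZMod q) = 1),
    Λ n / Real.sqrt n * (1 - Real.log n / Real.log x)
  have hx1 : 1 ≤ Real.log x := by
    have := Real.log_le_log (Real.exp_pos 1) hxe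
    rwa [Real.log_exp] at this
  have hlpos : 0 < Real.log x := by linarith
  rw [Real.dist_eq] at hd
  have h1 : |1 / Real.log x * G| ≤ |ℓ| + 1 := by
    calc |1 / Real.log x * G| = |(1 / Real.log x * G - ℓ) + ℓ| := by rw [sub_add_cancel]
      _ ≤ |1 / Real.log x * G - ℓ| + |ℓ| := abs_add_le _ _
      _ ≤ |ℓ| + 1 := by linarith [hd.le]
  have h2 : G = Real.log x * (1 / Real.log x * G) := by field_simp
  calc |G| = Real.log x * |1 / Real.log x * G| := by
        rw [h2, abs_mul, abs_of_pos hlpos, ← h2]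
    _ ≤ Real.log x * (|ℓ| + 1) := mul_le_mul_of_nonneg_left h1 hlpos.le
    _ ≤ (|ℓ| + 1) * (1 + Real.log x) := by nlinarith [abs_nonneg ℓ]

/-- **Suzuki 2025, Thm 6 (iii), PROVED** — the second clause of the named fact `Suzuki2025Chebyshev_thm6_limits`, AS
TYPED there: if `L(½, χ) ≠ 0` for every `χ` mod `q`, then
`lim_{x→∞} Σ_{n ≤ xe², n ≡ 1 (q)} Λ(n) n^{-1/2}(1 − log n/log x) = −φ(q)^{-1} Σ_χ (L'/L)(½, χ)` (1.24) holds iff the GRH holds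
for every `χ` mod `q` and `Σ_χ Σ_{ρ_{χ*}} x^ρ/ρ = o(√x log x)` (1.25). GRH-EQUIVALENT criterion proved as an equivalence; nothing
here bears on the truth of RH. [cite: Suzuki2025Chebyshev, §1.3 Thm 6 (iii), eqs. (1.24)–(1.25); proof §5.1 (5.5)–(5.9)] -/
theorem Suzuki2025Chebyshev_thm6_iii (hL : ∀ χ : DirichletCharacter ℂ q, χ.LFunction (1 / 2) ≠ 0) :
    Tendsto (fun x : ℝ ↦ ((∑ n ∈ (Finset.Icc 1 ⌊x * Real.exp 2⌋₊).filter (fun n : ℕ ↦ (n : ZMod q) = 1),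
          Λ n / Real.sqrt n * (1 - Real.log n / Real.log x) : ℝ) : ℂ)) atTop
      (𝓝 (-(1 / (Nat.totient q : ℂ)) * ∑ χ : DirichletCharacter ℂ q, logDeriv χ.LFunction (1 / 2))) ↔
      (∀ χ : DirichletCharacter ℂ q, χ.RiemannHypothesis) ∧
        ∀ ε : ℝ, 0 < ε → ∀ᶠ x : ℝ in atTop, ∀ᶠ T : ℝ in atTop,
          ‖∑ χ : DirichletCharacter ℂ q, charZeroSumTrunc χ x T‖ ≤ ε * (Real.sqrt x * Real.log x) := by
  classical
  have hφpos : (0 : ℝ) < q.totient := by exact_mod_cast Nat.totient_pos.mpr (NeZero.pos q)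
  set τ : ℂ := -(1 / (Nat.totient q : ℂ)) * ∑ χ : DirichletCharacter ℂ q, logDeriv χ.LFunction (1 / 2) with hτ
  constructor
  · intro h
    have hGRH := forall_riemannHypothesis_of_tendsto_cutoff h
    refine ⟨hGRH, ?_⟩
    have hZ := zeroSum_small_of_A_small (q := q) (k := 1) le_rfl ?_
    · simpa only [pow_one] using hZ
    intro ε hε
    obtain ⟨B, hB⟩ := exists_cutoff_link hGRH hL
    have hev := (Metric.tendsto_nhds.1 h) (ε / q.totient) (by positivity)
    have hev2 := Real.tendsto_log_atTop.eventually_ge_atTop (B / ε)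
    apply eventually_of_mul_exp_two
    filter_upwards [hev, hev2, eventually_gt_atTop (1 : ℝ)] with x hd hlogx hx1
    obtain ⟨h1, -⟩ := hB x hx1
    rw [dist_eq_norm] at hd
    have hx0 : 0 < x := by linarith
    set y := x * Real.exp 2 with hy
    have hy0 : 0 < y := by positivity
    have hsy : 0 < Real.sqrt y := Real.sqrt_pos.2 hy0
    have hlogy : Real.log y = Real.log x + 2 := by
      rw [hy, Real.log_mul hx0.ne' (Real.exp_pos 2).ne', Real.log_exp]
    set A := ∑ χ : DirichletCharacter ℂ q,
      (if χ = 1 then (((Chebyshev.psi y - y : ℝ)) : ℂ) else Sieve.chebyshevPsiChar χ.primitiveCharacter y)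
    have hlx : 0 < Real.log x := Real.log_pos hx1
    -- `(2/√y)‖A‖ ≤ B + φ log x · (ε/φ) = B + ε log x`
    have h2 : 2 / Real.sqrt y * ‖A‖ ≤ B + ε * Real.log x := by
      refine h1.trans ?_
      have : (q.totient : ℝ) * Real.log x * ‖((∑ n ∈ (Finset.Icc 1 ⌊y⌋₊).filter (fun n : ℕ ↦ (n : ZMod q) = 1),
          Λ n / Real.sqrt n * (1 - Real.log n / Real.log x) : ℝ) : ℂ) - τ‖ ≤ q.totient * Real.log x * (ε / q.totient) :=
        mul_le_mul_of_nonneg_left hd.le (by positivity)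
      have h3 : (q.totient : ℝ) * Real.log x * (ε / q.totient) = ε * Real.log x := by
        field_simp
      linarith
    have hBε : B ≤ ε * Real.log x := by rwa [div_le_iff₀ hε, mul_comm] at hlogx
    rw [div_mul_eq_mul_div, div_le_iff₀ hsy] at h2
    rw [pow_one, hlogy]
    nlinarith [norm_nonneg A, mul_le_mul_of_nonneg_right hBε hsy.le, mul_pos hε hsy, mul_pos hlx hsy]
  · rintro ⟨hGRH, hZ⟩
    have hA := A_small_of_zeroSum_small (q := q) (k := 1) le_rfl (by simpa only [pow_one] using hZ)
    obtain ⟨B, hB⟩ := exists_cutoff_link hGRH hL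
    rw [Metric.tendsto_nhds]
    intro ε hε
    have hA' := tendsto_mul_exp_two.eventually (hA (ε * q.totient / 8) (by positivity))
    have hev2 := Real.tendsto_log_atTop.eventually_ge_atTop (max 2 (4 * |B| / (ε * q.totient)))
    filter_upwards [hA', hev2, eventually_gt_atTop (1 : ℝ)] with x hAx hlogx hx1
    obtain ⟨-, h2⟩ := hB x hx1
    rw [dist_eq_norm]
    have hx0 : 0 < x := by linarith
    set y := x * Real.exp 2 with hy
    have hy0 : 0 < y := by positivity
    have hsy : 0 < Real.sqrt y := Real.sqrt_pos.2 hy0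
    have hlogy : Real.log y = Real.log x + 2 := by
      rw [hy, Real.log_mul hx0.ne' (Real.exp_pos 2).ne', Real.log_exp]
    have hlx2 : 2 ≤ Real.log x := le_trans (le_max_left _ _) hlogx
    have hlxB : 4 * |B| / (ε * q.totient) ≤ Real.log x := le_trans (le_max_right _ _) hlogx
    set A := ∑ χ : DirichletCharacter ℂ q,
      (if χ = 1 then (((Chebyshev.psi y - y : ℝ)) : ℂ) else Sieve.chebyshevPsiChar χ.primitiveCharacter y)
    set D := ‖((∑ n ∈ (Finset.Icc 1 ⌊y⌋₊).filter (fun n : ℕ ↦ (n : ZMod q) = 1),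
          Λ n / Real.sqrt n * (1 - Real.log n / Real.log x) : ℝ) : ℂ) - τ‖
    rw [pow_one] at hAx
    -- `(2/√y)‖A‖ ≤ 2ε' log y`
    have hA2 : 2 / Real.sqrt y * ‖A‖ ≤ 2 * (ε * q.totient / 8) * Real.log y := by
      rw [div_mul_eq_mul_div, div_le_iff₀ hsy]
      nlinarith [hAx, hsy]
    have h3 : (q.totient : ℝ) * Real.log x * D ≤ |B| + ε * q.totient / 4 * (Real.log x + 2) := by
      have := h2.trans (add_le_add (le_abs_self B) hA2)
      rw [hlogy] at this
      linarith
    -- divide by `φ log x`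
    have hlx : 0 < Real.log x := by linarith
    have hφl : 0 < (q.totient : ℝ) * Real.log x := by positivity
    have hD : D ≤ (|B| + ε * q.totient / 4 * (Real.log x + 2)) / ((q.totient : ℝ) * Real.log x) := by
      rw [le_div_iff₀ hφl]; linarith
    have hB4 : |B| / ((q.totient : ℝ) * Real.log x) ≤ ε / 4 := by
      rw [div_le_iff₀ hφl]
      rw [div_le_iff₀ (by positivity)] at hlxB
      nlinarith
    have hrest : ε * q.totient / 4 * (Real.log x + 2) / ((q.totient : ℝ) * Real.log x) ≤ ε / 2 := by
      rw [div_le_iff₀ hφl]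
      have : Real.log x + 2 ≤ 2 * Real.log x := by linarith
      have hεφ : 0 ≤ ε * q.totient := by positivity
      nlinarith [mul_le_mul_of_nonneg_left this hεφ]
    calc D ≤ (|B| + ε * q.totient / 4 * (Real.log x + 2)) / ((q.totient : ℝ) * Real.log x) := hD
      _ = |B| / ((q.totient : ℝ) * Real.log x) + ε * q.totient / 4 * (Real.log x + 2) / ((q.totient : ℝ) * Real.log x) := by
          rw [add_div]
      _ ≤ ε / 4 + ε / 2 := add_le_add hB4 hrest
      _ < ε := by linarith


/-- **The two-sided link for the corrected (v)** under GRH alone (KEY ESTIMATE 1, order-`m` form): with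
`τ' = −(2φ(q))^{-1} Σ_χ m_χ`, `R(x) = G(x)/log x − τ'`, `y = xe²`, there is `K` such that for `x > 1`,
`(2/√y)‖A(y)‖ ≤ K(1 + log y) + φ log²x |R(x)|` and `φ log²x |R(x)| ≤ K(1 + log y) + (2/√y)‖A(y)‖`
(`log²y/2 − 2 log y = log²x/2 − 2`). [cite: Suzuki2025Chebyshev, §5.1 (5.9) with the order-`m` terms of §4.1 (4.5')] -/
theorem exists_cutoff_link_v (hGRH : ∀ χ : DirichletCharacter ℂ q, χ.RiemannHypothesis) :
    ∃ K : ℝ, ∀ x : ℝ, 1 < x →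
      2 / Real.sqrt (x * Real.exp 2) * ‖∑ χ : DirichletCharacter ℂ q,
          (if χ = 1 then (((Chebyshev.psi (x * Real.exp 2) - x * Real.exp 2 : ℝ)) : ℂ)
            else Sieve.chebyshevPsiChar χ.primitiveCharacter (x * Real.exp 2))‖ ≤
        K * (1 + Real.log (x * Real.exp 2)) + q.totient * Real.log x ^ 2 *
          |1 / Real.log x * (∑ n ∈ (Finset.Icc 1 ⌊x * Real.exp 2⌋₊).filter (fun n : ℕ ↦ (n : ZMod q) = 1),
              Λ n / Real.sqrt n * (1 - Real.log n / Real.log x)) -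
            (-(1 / (2 * Nat.totient q) : ℝ) *
              ∑ χ : DirichletCharacter ℂ q, (DirichletDisc.zeroOrder χ (1 / 2) : ℝ))| ∧
      q.totient * Real.log x ^ 2 *
          |1 / Real.log x * (∑ n ∈ (Finset.Icc 1 ⌊x * Real.exp 2⌋₊).filter (fun n : ℕ ↦ (n : ZMod q) = 1),
              Λ n / Real.sqrt n * (1 - Real.log n / Real.log x)) -
            (-(1 / (2 * Nat.totient q) : ℝ) *
              ∑ χ : DirichletCharacter ℂ q, (DirichletDisc.zeroOrder χ (1 / 2) : ℝ))| ≤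
        K * (1 + Real.log (x * Real.exp 2)) + 2 / Real.sqrt (x * Real.exp 2) *
          ‖∑ χ : DirichletCharacter ℂ q,
            (if χ = 1 then (((Chebyshev.psi (x * Real.exp 2) - x * Real.exp 2 : ℝ)) : ℂ)
              else Sieve.chebyshevPsiChar χ.primitiveCharacter (x * Real.exp 2))‖ := by
  classical
  obtain ⟨c, -, B, hB⟩ := exists_norm_cutoff_sub_le hGRH
  set S : ℂ := ∑ χ : DirichletCharacter ℂ q, c χ with hS
  set Mr : ℝ := ∑ χ : DirichletCharacter ℂ q, (DirichletDisc.zeroOrder χ (1 / 2) : ℝ) with hMr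
  have hφ0 : (q.totient : ℂ) ≠ 0 := by exact_mod_cast (Nat.totient_pos.mpr (NeZero.pos q)).ne'
  have hφpos : (0 : ℝ) < q.totient := by exact_mod_cast Nat.totient_pos.mpr (NeZero.pos q)
  have hMc : ∑ χ : DirichletCharacter ℂ q, (DirichletDisc.zeroOrder χ (1 / 2) : ℂ) = ((Mr : ℝ) : ℂ) := by
    rw [hMr]; push_cast; rfl
  refine ⟨|B| + 2 * ‖((Mr : ℝ) : ℂ)‖ + ‖S‖, fun x hx ↦ ?_⟩
  have hx0 : 0 < x := by linarith
  set y := x * Real.exp 2 with hy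
  have hy0 : 0 < y := by positivity
  have hlogy : Real.log y = Real.log x + 2 := by
    rw [hy, Real.log_mul hx0.ne' (Real.exp_pos 2).ne', Real.log_exp]
  have hlx : 0 < Real.log x := Real.log_pos hx
  have hlxc : (Real.log x : ℂ) ≠ 0 := by exact_mod_cast hlx.ne'
  have hly0 : 0 ≤ Real.log y := by rw [hlogy]; linarith
  set G : ℝ := ∑ n ∈ (Finset.Icc 1 ⌊y⌋₊).filter (fun n : ℕ ↦ (n : ZMod q) = 1),
    Λ n / Real.sqrt n * (1 - Real.log n / Real.log x) with hG
  set A : ℂ := ∑ χ : DirichletCharacter ℂ q,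
    (if χ = 1 then (((Chebyshev.psi y - y : ℝ)) : ℂ) else Sieve.chebyshevPsiChar χ.primitiveCharacter y)
  set τ' : ℝ := -(1 / (2 * Nat.totient q) : ℝ) * Mr with hτ'
  set R : ℝ := 1 / Real.log x * G - τ' with hR
  have key := hB x hx
  rw [hMc] at key
  have hid : (q.totient : ℂ) * (Real.log x : ℂ) * (G : ℂ) + (Real.log y : ℂ) * S
      + ((((Real.log y) ^ 2 / 2 - 2 * Real.log y : ℝ)) : ℂ) * ((Mr : ℝ) : ℂ) =
      ((((q.totient : ℝ) * Real.log x ^ 2 * R : ℝ)) : ℂ) - 2 * ((Mr : ℝ) : ℂ) + (Real.log y : ℂ) * S := by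
    rw [hR, hτ', hlogy]
    push_cast
    field_simp
    ring
  have key' : ‖((((q.totient : ℝ) * Real.log x ^ 2 * R : ℝ)) : ℂ) - 2 * ((Mr : ℝ) : ℂ) + (Real.log y : ℂ) * S
      + 2 / (Real.sqrt y : ℂ) * A‖ ≤ B := by
    rw [← hid]; exact key
  have hn1 : ‖((((q.totient : ℝ) * Real.log x ^ 2 * R : ℝ)) : ℂ)‖ = q.totient * Real.log x ^ 2 * |R| := by
    rw [Complex.norm_real, Real.norm_eq_abs, abs_mul, abs_of_pos (by positivity)]
  have hn2 : ‖2 / (Real.sqrt y : ℂ) * A‖ = 2 / Real.sqrt y * ‖A‖ := by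
    rw [norm_mul, norm_div, Complex.norm_two, Complex.norm_real, Real.norm_eq_abs,
      abs_of_pos (Real.sqrt_pos.2 hy0)]
  have hn3 : ‖(2 : ℂ) * ((Mr : ℝ) : ℂ)‖ = 2 * ‖((Mr : ℝ) : ℂ)‖ := by rw [norm_mul, Complex.norm_two]
  have hn4 : ‖(Real.log y : ℂ) * S‖ = Real.log y * ‖S‖ := by
    rw [norm_mul, Complex.norm_real, Real.norm_eq_abs, abs_of_nonneg hly0]
  have hK : B + 2 * ‖((Mr : ℝ) : ℂ)‖ + Real.log y * ‖S‖ ≤ (|B| + 2 * ‖((Mr : ℝ) : ℂ)‖ + ‖S‖) * (1 + Real.log y) := by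
    have h1 := le_abs_self B
    have h2 : 0 ≤ ‖((Mr : ℝ) : ℂ)‖ := norm_nonneg _
    have h3 : 0 ≤ ‖S‖ := norm_nonneg _
    nlinarith [abs_nonneg B]
  set P : ℂ := ((((q.totient : ℝ) * Real.log x ^ 2 * R : ℝ)) : ℂ)
  constructor
  · calc 2 / Real.sqrt y * ‖A‖ = ‖2 / (Real.sqrt y : ℂ) * A‖ := hn2.symm
      _ = ‖(P - 2 * ((Mr : ℝ) : ℂ) + (Real.log y : ℂ) * S + 2 / (Real.sqrt y : ℂ) * A)
            - (P - 2 * ((Mr : ℝ) : ℂ) + (Real.log y : ℂ) * S)‖ := by ring_nf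
      _ ≤ ‖P - 2 * ((Mr : ℝ) : ℂ) + (Real.log y : ℂ) * S + 2 / (Real.sqrt y : ℂ) * A‖
            + ‖P - 2 * ((Mr : ℝ) : ℂ) + (Real.log y : ℂ) * S‖ := norm_sub_le _ _
      _ ≤ B + (‖P - 2 * ((Mr : ℝ) : ℂ)‖ + ‖(Real.log y : ℂ) * S‖) := add_le_add key' (norm_add_le _ _)
      _ ≤ B + (‖P‖ + ‖(2 : ℂ) * ((Mr : ℝ) : ℂ)‖ + ‖(Real.log y : ℂ) * S‖) := by
            gcongr; exact norm_sub_le _ _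
      _ = B + 2 * ‖((Mr : ℝ) : ℂ)‖ + Real.log y * ‖S‖ + q.totient * Real.log x ^ 2 * |R| := by
            rw [hn1, hn3, hn4]; ring
      _ ≤ (|B| + 2 * ‖((Mr : ℝ) : ℂ)‖ + ‖S‖) * (1 + Real.log y) + q.totient * Real.log x ^ 2 * |R| := by
            linarith [hK]
  · calc q.totient * Real.log x ^ 2 * |R| = ‖P‖ := hn1.symm
      _ = ‖(P - 2 * ((Mr : ℝ) : ℂ) + (Real.log y : ℂ) * S + 2 / (Real.sqrt y : ℂ) * A)
            - (-(2 * ((Mr : ℝ) : ℂ)) + (Real.log y : ℂ) * S + 2 / (Real.sqrt y : ℂ) * A)‖ := by ring_nf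
      _ ≤ ‖P - 2 * ((Mr : ℝ) : ℂ) + (Real.log y : ℂ) * S + 2 / (Real.sqrt y : ℂ) * A‖
            + ‖-(2 * ((Mr : ℝ) : ℂ)) + (Real.log y : ℂ) * S + 2 / (Real.sqrt y : ℂ) * A‖ := norm_sub_le _ _
      _ ≤ B + (‖-(2 * ((Mr : ℝ) : ℂ)) + (Real.log y : ℂ) * S‖ + ‖2 / (Real.sqrt y : ℂ) * A‖) :=
            add_le_add key' (norm_add_le _ _)
      _ ≤ B + (‖-(2 * ((Mr : ℝ) : ℂ))‖ + ‖(Real.log y : ℂ) * S‖ + ‖2 / (Real.sqrt y : ℂ) * A‖) := by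
            gcongr; exact norm_add_le _ _
      _ = B + 2 * ‖((Mr : ℝ) : ℂ)‖ + Real.log y * ‖S‖ + 2 / Real.sqrt y * ‖A‖ := by
            rw [norm_neg, hn3, hn4, hn2]; ring
      _ ≤ (|B| + 2 * ‖((Mr : ℝ) : ℂ)‖ + ‖S‖) * (1 + Real.log y) + 2 / Real.sqrt y * ‖A‖ := by linarith [hK]

/-- **Suzuki 2025, Thm 6 (v), PROVED AS AN EQUIVALENCE with the corrected limit `−(2φ(q))^{-1} Σ_χ m_χ`**:
`lim_{x→∞} (1/log x) Σ_{n ≤ xe², n ≡ 1 (q)} Λ(n) n^{-1/2}(1 − log n/log x) = −(2φ(q))^{-1} Σ_χ m_χ` holds iff the GRH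
holds for every `χ` mod `q` and `Σ_χ Σ_{ρ_{χ*}} x^ρ/ρ = o(√x log²x)` (1.30). The print (1.29) has `−½ Σ_χ m_χ`: the factor
`φ(q)^{-1}` of (1.23)/(5.2) was dropped in (1.28)/(1.29) (see `SuzukiThm6iv.Suzuki2025Chebyshev_thm6_iv_as_printed_iff` for
(1.28)); §5.1's own derivation («using (4.5) instead of (2.6)», with (5.2) and (5.8)) gives `−(2φ(q))^{-1} Σ_χ m_χ`.
GRH-EQUIVALENT criterion proved as an equivalence; nothing here bears on the truth of RH.
[cite: Suzuki2025Chebyshev, §1.3 Thm 6 (v), eqs. (1.29)–(1.30) (limit corrected by the factor `φ(q)^{-1}`); proof §5.1] -/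
theorem Suzuki2025Chebyshev_thm6_v_corrected :
    Tendsto (fun x : ℝ ↦ (1 / Real.log x) *
        ∑ n ∈ (Finset.Icc 1 ⌊x * Real.exp 2⌋₊).filter (fun n : ℕ ↦ (n : ZMod q) = 1),
          Λ n / Real.sqrt n * (1 - Real.log n / Real.log x)) atTop
      (𝓝 (-(1 / (2 * Nat.totient q) : ℝ) * ∑ χ : DirichletCharacter ℂ q, (DirichletDisc.zeroOrder χ (1 / 2) : ℝ))) ↔
      (∀ χ : DirichletCharacter ℂ q, χ.RiemannHypothesis) ∧
        ∀ ε : ℝ, 0 < ε → ∀ᶠ x : ℝ in atTop, ∀ᶠ T : ℝ in atTop,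
          ‖∑ χ : DirichletCharacter ℂ q, charZeroSumTrunc χ x T‖ ≤ ε * (Real.sqrt x * Real.log x ^ 2) := by
  classical
  have hφpos : (0 : ℝ) < q.totient := by exact_mod_cast Nat.totient_pos.mpr (NeZero.pos q)
  set τ' : ℝ := -(1 / (2 * Nat.totient q) : ℝ) *
    ∑ χ : DirichletCharacter ℂ q, (DirichletDisc.zeroOrder χ (1 / 2) : ℝ) with hτ'
  constructor
  · intro h
    have hGRH := forall_riemannHypothesis_of_tendsto_cutoff_div_log h
    refine ⟨hGRH, zeroSum_small_of_A_small (q := q) (k := 2) (by norm_num) ?_⟩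
    intro ε hε
    obtain ⟨K, hK⟩ := exists_cutoff_link_v hGRH
    have hev := (Metric.tendsto_nhds.1 h) (ε / q.totient) (by positivity)
    have hev2 := Real.tendsto_log_atTop.eventually_ge_atTop (max 1 (2 * |K| / ε))
    apply eventually_of_mul_exp_two
    filter_upwards [hev, hev2, eventually_gt_atTop (1 : ℝ)] with x hd hlogx hx1
    obtain ⟨h1, -⟩ := hK x hx1
    rw [Real.dist_eq] at hd
    have hx0 : 0 < x := by linarith
    set y := x * Real.exp 2 with hy
    have hy0 : 0 < y := by positivity
    have hsy : 0 < Real.sqrt y := Real.sqrt_pos.2 hy0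
    have hlogy : Real.log y = Real.log x + 2 := by
      rw [hy, Real.log_mul hx0.ne' (Real.exp_pos 2).ne', Real.log_exp]
    have hlx : 0 < Real.log x := Real.log_pos hx1
    have hlx1 : 1 ≤ Real.log x := le_trans (le_max_left _ _) hlogx
    have hlxK : 2 * |K| / ε ≤ Real.log x := le_trans (le_max_right _ _) hlogx
    set A := ∑ χ : DirichletCharacter ℂ q,
      (if χ = 1 then (((Chebyshev.psi y - y : ℝ)) : ℂ) else Sieve.chebyshevPsiChar χ.primitiveCharacter y)
    set R : ℝ := 1 / Real.log x * (∑ n ∈ (Finset.Icc 1 ⌊y⌋₊).filter (fun n : ℕ ↦ (n : ZMod q) = 1),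
      Λ n / Real.sqrt n * (1 - Real.log n / Real.log x)) - τ'
    -- `φ log²x |R| ≤ ε log²x ≤ ε log²y`
    have hR : (q.totient : ℝ) * Real.log x ^ 2 * |R| ≤ ε * Real.log y ^ 2 := by
      have h2 : (q.totient : ℝ) * Real.log x ^ 2 * |R| ≤ q.totient * Real.log x ^ 2 * (ε / q.totient) :=
        mul_le_mul_of_nonneg_left hd.le (by positivity)
      have h3 : (q.totient : ℝ) * Real.log x ^ 2 * (ε / q.totient) = ε * Real.log x ^ 2 := by field_simp
      have h4 : Real.log x ^ 2 ≤ Real.log y ^ 2 := by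
        rw [hlogy]; nlinarith
      nlinarith [h4, hε.le]
    -- `K(1 + log y) ≤ 2|K| log y ≤ ε log²y`
    have hKy : K * (1 + Real.log y) ≤ ε * Real.log y ^ 2 := by
      have hly1 : 1 ≤ Real.log y := by rw [hlogy]; linarith
      have h2 : K * (1 + Real.log y) ≤ |K| * (2 * Real.log y) :=
        (mul_le_mul_of_nonneg_right (le_abs_self K) (by linarith)).trans
          (mul_le_mul_of_nonneg_left (by linarith) (abs_nonneg K))
      have h3 : 2 * |K| ≤ ε * Real.log y := by
        rw [div_le_iff₀ hε] at hlxK; rw [hlogy]; nlinarith [abs_nonneg K]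
      nlinarith [h3, hly1]
    have h5 : 2 / Real.sqrt y * ‖A‖ ≤ 2 * ε * Real.log y ^ 2 := by linarith [h1, hR, hKy]
    rw [div_mul_eq_mul_div, div_le_iff₀ hsy] at h5
    nlinarith [h5, hsy, norm_nonneg A]
  · rintro ⟨hGRH, hZ⟩
    have hA := A_small_of_zeroSum_small (q := q) (k := 2) (by norm_num) hZ
    obtain ⟨K, hK⟩ := exists_cutoff_link_v hGRH
    rw [Metric.tendsto_nhds]
    intro ε hε
    have hA' := tendsto_mul_exp_two.eventually (hA (ε * q.totient / 16) (by positivity))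
    have hev2 := Real.tendsto_log_atTop.eventually_ge_atTop (max 2 (12 * |K| / (ε * q.totient)))
    filter_upwards [hA', hev2, eventually_gt_atTop (1 : ℝ)] with x hAx hlogx hx1
    obtain ⟨-, h2⟩ := hK x hx1
    rw [Real.dist_eq]
    have hx0 : 0 < x := by linarith
    set y := x * Real.exp 2 with hy
    have hy0 : 0 < y := by positivity
    have hsy : 0 < Real.sqrt y := Real.sqrt_pos.2 hy0
    have hlogy : Real.log y = Real.log x + 2 := by
      rw [hy, Real.log_mul hx0.ne' (Real.exp_pos 2).ne', Real.log_exp]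
    have hlx2 : 2 ≤ Real.log x := le_trans (le_max_left _ _) hlogx
    have hlxK : 12 * |K| / (ε * q.totient) ≤ Real.log x := le_trans (le_max_right _ _) hlogx
    have hlx : 0 < Real.log x := by linarith
    set A := ∑ χ : DirichletCharacter ℂ q,
      (if χ = 1 then (((Chebyshev.psi y - y : ℝ)) : ℂ) else Sieve.chebyshevPsiChar χ.primitiveCharacter y)
    set R : ℝ := 1 / Real.log x * (∑ n ∈ (Finset.Icc 1 ⌊y⌋₊).filter (fun n : ℕ ↦ (n : ZMod q) = 1),
      Λ n / Real.sqrt n * (1 - Real.log n / Real.log x)) - τ'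
    have hA2 : 2 / Real.sqrt y * ‖A‖ ≤ 2 * (ε * q.totient / 16) * Real.log y ^ 2 := by
      rw [div_mul_eq_mul_div, div_le_iff₀ hsy]
      nlinarith [hAx, hsy]
    have h1K : K * (1 + Real.log y) ≤ |K| * (3 * Real.log x) :=
      (mul_le_mul_of_nonneg_right (le_abs_self K) (by rw [hlogy]; linarith)).trans
        (mul_le_mul_of_nonneg_left (by rw [hlogy]; linarith) (abs_nonneg K))
    have hly2 : Real.log y ^ 2 ≤ 4 * Real.log x ^ 2 := by rw [hlogy]; nlinarith
    have h3 : (q.totient : ℝ) * Real.log x ^ 2 * |R| ≤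
        3 * |K| * Real.log x + ε * q.totient / 2 * Real.log x ^ 2 := by
      have h4 := mul_le_mul_of_nonneg_left hly2 (by positivity : (0 : ℝ) ≤ ε * q.totient / 8)
      linarith [h2, hA2, h1K, h4]
    have hφl2 : (0 : ℝ) < q.totient * Real.log x ^ 2 := by positivity
    have hR1 : |R| ≤ (3 * |K| * Real.log x + ε * q.totient / 2 * Real.log x ^ 2) / (q.totient * Real.log x ^ 2) := by
      rw [le_div_iff₀ hφl2]; linarith
    have hR2 : 3 * |K| * Real.log x / (q.totient * Real.log x ^ 2) ≤ ε / 4 := by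
      rw [div_le_iff₀ hφl2]
      have h12 : 12 * |K| ≤ ε * q.totient * Real.log x := by
        rw [div_le_iff₀ (by positivity)] at hlxK; linarith
      nlinarith [h12, hlx]
    have hR3 : ε * q.totient / 2 * Real.log x ^ 2 / (q.totient * Real.log x ^ 2) = ε / 2 := by
      rw [div_eq_iff hφl2.ne']; ring
    calc |R| ≤ (3 * |K| * Real.log x + ε * q.totient / 2 * Real.log x ^ 2) / (q.totient * Real.log x ^ 2) := hR1
      _ = 3 * |K| * Real.log x / (q.totient * Real.log x ^ 2)
            + ε * q.totient / 2 * Real.log x ^ 2 / (q.totient * Real.log x ^ 2) := add_div _ _ _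
      _ ≤ ε / 4 + ε / 2 := by rw [hR3]; exact add_le_add hR2 le_rfl
      _ < ε := by linarith

/-- **Clause (v) of `Suzuki2025Chebyshev_thm6_limits` with the limit AS PRINTED (`−½ Σ_χ m_χ`), PROVED whenever
`φ(q) = 1` or `Σ_χ m_χ = 0`** (then the printed and the corrected limits coincide).
[cite: Suzuki2025Chebyshev, §1.3 Thm 6 (v) (1.29)–(1.30)] -/
theorem Suzuki2025Chebyshev_thm6_v_as_printed_of
    (h01 : Nat.totient q = 1 ∨ ∑ χ : DirichletCharacter ℂ q, (DirichletDisc.zeroOrder χ (1 / 2) : ℝ) = 0) :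
    Tendsto (fun x : ℝ ↦ (1 / Real.log x) *
        ∑ n ∈ (Finset.Icc 1 ⌊x * Real.exp 2⌋₊).filter (fun n : ℕ ↦ (n : ZMod q) = 1),
          Λ n / Real.sqrt n * (1 - Real.log n / Real.log x)) atTop
      (𝓝 (-(1 / 2 : ℝ) * ∑ χ : DirichletCharacter ℂ q, (DirichletDisc.zeroOrder χ (1 / 2) : ℝ))) ↔
      (∀ χ : DirichletCharacter ℂ q, χ.RiemannHypothesis) ∧
        ∀ ε : ℝ, 0 < ε → ∀ᶠ x : ℝ in atTop, ∀ᶠ T : ℝ in atTop,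
          ‖∑ χ : DirichletCharacter ℂ q, charZeroSumTrunc χ x T‖ ≤ ε * (Real.sqrt x * Real.log x ^ 2) := by
  have hlim : -(1 / 2 : ℝ) * ∑ χ : DirichletCharacter ℂ q, (DirichletDisc.zeroOrder χ (1 / 2) : ℝ) =
      -(1 / (2 * Nat.totient q) : ℝ) * ∑ χ : DirichletCharacter ℂ q, (DirichletDisc.zeroOrder χ (1 / 2) : ℝ) := by
    rcases h01 with h | h
    · rw [h]; norm_num
    · rw [h, mul_zero, mul_zero]
  rw [hlim]
  exact Suzuki2025Chebyshev_thm6_v_corrected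

/-- **Clause (v) of `Suzuki2025Chebyshev_thm6_limits` AS TYPED (limit `−½ Σ_χ m_χ`), PROVED under `L(½, χ) ≠ 0` for
every `χ` mod `q`** — the standing hypothesis of clause (iii); then every `m_χ = 0` and both limits are `0`.
[cite: Suzuki2025Chebyshev, §1.3 Thm 6 (v) (1.29)–(1.30)] -/
theorem Suzuki2025Chebyshev_thm6_v_of_forall_ne_zero
    (hL : ∀ χ : DirichletCharacter ℂ q, χ.LFunction (1 / 2) ≠ 0) :
    Tendsto (fun x : ℝ ↦ (1 / Real.log x) *
        ∑ n ∈ (Finset.Icc 1 ⌊x * Real.exp 2⌋₊).filter (fun n : ℕ ↦ (n : ZMod q) = 1),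
          Λ n / Real.sqrt n * (1 - Real.log n / Real.log x)) atTop
      (𝓝 (-(1 / 2 : ℝ) * ∑ χ : DirichletCharacter ℂ q, (DirichletDisc.zeroOrder χ (1 / 2) : ℝ))) ↔
      (∀ χ : DirichletCharacter ℂ q, χ.RiemannHypothesis) ∧
        ∀ ε : ℝ, 0 < ε → ∀ᶠ x : ℝ in atTop, ∀ᶠ T : ℝ in atTop,
          ‖∑ χ : DirichletCharacter ℂ q, charZeroSumTrunc χ x T‖ ≤ ε * (Real.sqrt x * Real.log x ^ 2) := by
  refine Suzuki2025Chebyshev_thm6_v_as_printed_of (Or.inr (Finset.sum_eq_zero fun χ _ ↦ ?_))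
  by_cases hχ : χ = 1
  · subst hχ; rw [zeroOrder_one_half_eq_zero]; simp
  · rw [zeroOrder_half_eq_zero hχ (hL χ)]; simp

/-- **Clause 2 of the named fact `Suzuki2025Chebyshev_thm6_limits`, verbatim, PROVED** (Thm 6 (iii)).
[cite: Suzuki2025Chebyshev, §1.3 Thm 6 (iii)] -/
theorem Suzuki2025Chebyshev_thm6_limits_clause_iii :
    ∀ (q : ℕ) [NeZero q], (∀ χ : DirichletCharacter ℂ q, χ.LFunction (1 / 2) ≠ 0) →
      (Tendsto (fun x : ℝ ↦ ((∑ n ∈ (Finset.Icc 1 ⌊x * Real.exp 2⌋₊).filter (fun n : ℕ ↦ (n : ZMod q) = 1),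
          Λ n / Real.sqrt n * (1 - Real.log n / Real.log x) : ℝ) : ℂ)) atTop
        (𝓝 (-(1 / (Nat.totient q : ℂ)) * ∑ χ : DirichletCharacter ℂ q, logDeriv χ.LFunction (1 / 2))) ↔
      (∀ χ : DirichletCharacter ℂ q, χ.RiemannHypothesis) ∧
        ∀ ε : ℝ, 0 < ε → ∀ᶠ x : ℝ in atTop, ∀ᶠ T : ℝ in atTop,
          ‖∑ χ : DirichletCharacter ℂ q, charZeroSumTrunc χ x T‖ ≤ ε * (Real.sqrt x * Real.log x)) :=
  fun _ _ hL ↦ Suzuki2025Chebyshev_thm6_iii hL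

/-- **Clause 4 of the named fact `Suzuki2025Chebyshev_thm6_limits`, verbatim, PROVED for the moduli with `φ(q) = 1`**
(`q ≤ 2`, where the print (1.29) is correct as it stands). [cite: Suzuki2025Chebyshev, §1.3 Thm 6 (v)] -/
theorem Suzuki2025Chebyshev_thm6_limits_clause_v_of_totient_eq_one {q : ℕ} [NeZero q] (hq : Nat.totient q = 1) :
    Tendsto (fun x : ℝ ↦ (1 / Real.log x) *
        ∑ n ∈ (Finset.Icc 1 ⌊x * Real.exp 2⌋₊).filter (fun n : ℕ ↦ (n : ZMod q) = 1),
          Λ n / Real.sqrt n * (1 - Real.log n / Real.log x)) atTop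
      (𝓝 (-(1 / 2 : ℝ) * ∑ χ : DirichletCharacter ℂ q, (DirichletDisc.zeroOrder χ (1 / 2) : ℝ))) ↔
      (∀ χ : DirichletCharacter ℂ q, χ.RiemannHypothesis) ∧
        ∀ ε : ℝ, 0 < ε → ∀ᶠ x : ℝ in atTop, ∀ᶠ T : ℝ in atTop,
          ‖∑ χ : DirichletCharacter ℂ q, charZeroSumTrunc χ x T‖ ≤ ε * (Real.sqrt x * Real.log x ^ 2) :=
  Suzuki2025Chebyshev_thm6_v_as_printed_of (Or.inl hq)

end Assembly

end SuzukiThm6iii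

end Literature.NumberTheory.LFunctions

end
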